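import Literature.MathematicalPhysics.QuantumFieldTheory.Balaban1983to89.B15From190LayerSizes
import Literature.MathematicalPhysics.QuantumFieldTheory.Balaban1983to89.B11Ineq190ActualDeriv
import Literature.MathematicalPhysics.QuantumFieldTheory.Balaban1983to89.B14From190SectG

/-!
# `Balaban1983to89.B15From190SectG` — T. Bałaban, *Large field renormalization. I. The basic step of the 𝐑 operation*,
# Commun. Math. Phys. **122** (1989) 175–202 [Balaban1989LargeFieldI] = [IV], §1: the (190)-knittings of (1.31), (1.37)–(1.39),
# (1.42), (1.45)–(1.48), (1.54)/(1.56)–(1.58), (1.90)–(1.91), (1.96), (1.98) END TO END FROM THE LOCATED LEAVES OF [15] SECT. G — the pair of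
# located hypotheses `(h190, hmv)` of every knit of `B15From190LayerSizes` SUPPLIED BY NAME from [15] = [Balaban1985Variational]
# Prop. 9 / (190) as assembled in `B11Ineq190Actual` (r08) / `B11Ineq190ActualDeriv` (p29) through the lattice presentations of
# `B11Presentation190` (p29)

statement-level skeleton of published theorems with citation tags; proofs where landed; nothing here is a claim
about the Yang–Mills mass gap

CITATION HEADER (lean-in-tree rule 2026-08-18).  T. Bałaban, *Large field renormalization. I. The basic step of the 𝐑 operation*,
Commun. Math. Phys. **122**, 175–202 (1989), doi:10.1007/BF01257412, bib `Balaban1989LargeFieldI` (cell paper B15 = "[IV]"; PDF held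
`paper:balaban1989-cmp122-large-field-i`, journal page = PDF page + 174; pp. 183–188, 198–199 = PDF 9–14, 24–25).  "[15]" = T. Bałaban,
*The variational problem and background fields in renormalization group method for lattice gauge theories*, Commun. Math. Phys. **102**,
277–309 (1985), bib `Balaban1985Variational` (cell paper B11; Prop. 9 p. 309, (190) p. 308, (179)–(180) p. 306, (189) p. 308, (115)
p. 295).  "[3]" = [Balaban1984PropagatorsII] (2.61)/Lemma 2.1 p. 234 (`B11SectG.RowSum`), (2.54) (`Triangle254`).  Mega-formalization
`lit-balaban`, HOME `run/shared/lean/pub/lit-balaban/`, unit `lit-balaban-r12` gen 11 (reader/typer and fold owner of block B15; cell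
GAPS.md G-B15-r12-08, item (a) *«(190) between the concrete sizes»* and item (e′) *«the mean-value reading»* — this file closes both IN THE
TREE for the B15 rows below, following r11 gen 9's `B14From190SectG` (the [III] twin) and p29 gen 9's `B16Ineq123From190.ineq123_sectG`).

WHAT IS REPRODUCED.  SKELETON rows **B15.Eq1.31** (with 1.30), **B15.Eq1.37–1.39** (with 1.34–1.36, 1.38), **B15.Eq1.42** (with
1.40–1.41), **B15.Eq1.46**/**B15.Eq1.48** (with 1.44–1.45, 1.47), **B15.Eq1.54** (with 1.56–1.58), **B15.Eq1.91** (with 1.90),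
**B15.Eq1.96** (with 1.92–1.95), **B15.Eq1.98** (with 1.97, 1.80, 1.82).  THE PRINT (verbatim; the sentences whose words *"exponential decay property"* cite [15] (190)):
p. 183–184 *"The exponential decay property of ℍ_{j,□} implies that on the cube □^∼ this function and its covariant derivatives can be
bounded by B₃exp(−δ2M₂R_j)22d²ε_j < (β/10)ε_j … we obtain |U_{j,□}(∂p) − 1| < … < ε_j(L^{k−j}η)² for p ⊂ □^∼ (1.31)"*; p. 185 *"From this,
and the exponential decay property, it follows that [(1.38)] … the expression on the left-hand side of (1.37) can be bounded by ½δ_j"*,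
*"The function ℍ_{j+1,□′} is bounded on □′^{∼2} by B₃exp(−δLM₂R_{j+1})22d²ε_{j+1}, hence [(1.42)] ≦ ½δ_j"*; p. 186 *"therefore the
following estimate holds: sup_{B^i(y)} L^iη|ℍ^{(n)}_{k,Z}|, sup_{B^i(y)} (L^iη)²|∇^η_{U_k^{(n+1)}}ℍ^{(n)}_{k,Z}| ≦ B₃exp(−δd(y, Ω^c_{j+1}∖Z″_{j+1}))4δ′_j.
(1.45) Here d(·,·) is the scaled distance … Then the estimate (1.46) and the above bounds imply [(1.48)]"*; p. 188 *"The field in the argument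
of the function ℍ^{(n+1)}_{k,Z} has a support in the boundary layer of the width 2M₁ at the boundary of Z, and is bounded by 44d²B₃ε_k. Thus the
function considered on the domain Ω^c_{j+1}∖Z″_{j+1} satisfies the bound |ℍ^{(n+1)}_{k,Z}| ≦ (L^{j+1}η)^{−1}B₃exp(…)44d²B₃ε_k < … (1.57)"*; p. 198
*"The function ℍ_{h,□} and it[s] derivatives can be bounded on □^∼ by B₃exp(−δ2LM₂R_h)11d²ε_h < 11d²B₃exp(−R_h)ε_h < αε_h … we get
[(1.91)]"*; p. 199 *"The estimates (1.91), (1.95) yield |U″_{k,Z}(∂p) − 1| < ¾ε_h(L^{k−h}η)² < … (1.96)"*, *"The ℍ-function in the expansion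
can be bounded on the domain … by B₃exp(−δ(M/M₁)(j−h))exp(−½δMR_h)23d²ε_h … < αε_j. … The corresponding ℍ-function can be bounded on the same
domains as above by B₃δ′_k ≦ … < αε_j. … Combining the above estimates, and using the inequality … for j < k, we obtain [(1.98)]"* (pp. 199–200).
(v1.3, r12 gen 19, `lit-balaban-r12/QUOTE-AUDIT-B15.md` findings A2/A5/A10/L6: DOCSTRING ONLY — the p. 186 / p. 188 / p. 199 passages above re-read on
the page images PDF 12/14/25 and restored verbatim; v1–v1.2 carried inside the quotation marks «we have sup … ≦ B₃exp(−δL^{−i}dist(y, …))4δ′_j (1.45)»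
(the display altered: print has the scaled distance `d(y, ·)`, and «we have» introduces (1.44)), «it can be estimated there by 44d²B₃ε_k. This
implies …», «Thus the inequality (1.91) holds … yield …» and «… Thus U″_{k,Z} satisfy (1.98)» — paraphrases, not printed sentences; the same
restoration in the docstring of §10; no declaration, statement or proof changed.)  [15] (190) p. 308: *"|(δ/δB_ν(y′))𝓗_μ(B,x)|, |∇_x(δ/δB_ν(y′))𝓗_μ(B,x)|, … ≦ O(1)[(L^jη)^{−1}, (L^jη)^{−2}, …]·
(L^{j′}η)^{−d}exp(−⅛δ₀d(y,y′)) (190) for x ∈ Δ(y), … y ∈ Λ_j, y′ ∈ Λ_{j′}"*; Prop. 9 p. 309: *"The function 𝓗(B) is determined by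
Eqs. (174), (175) … It is an analytic function of B … and its functional derivative (182) satisfies the inequalities (190)."*

THE CHAIN, BY NAME (nothing restated, nothing modified).  r12's layer-level knits `B15From190LayerSizes.*` (gens 9–10; input size
`B11SupSize190.supSize gB boxB blkB` on the bond index set `X` of p29's cube towers, argument field concrete, B-sizes `hm` and
localisations `hD` discharged there) take, per knit, the PAIR(S) of located hypotheses `h190 : ∀ t, Ineq190 (supSize gB boxB blkB)
bout (dH t) C δ₀` ([15] (190) for a family of derivative functionals `dH t`, output size `bout` = `supSize gB box blk` — *"on the cube
□^∼ this function"* —, r11's `B11SeminormSize190.covDerivBlockSize gB y₀ S ξ U₀` — *"and its covariant derivatives"* —, or the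
WEIGHTED sizes of (1.45)/(1.57)) and `hmv : ∀ s, (∀ t, bout.loc y (dH t B) ≤ s) → bout.loc y ℍ ≤ s` (the mean-value reading: how
Prop. 9's derivative bound controls `ℍ = 𝓗(B)`, `𝓗(0) = 0`).  r08 g10's `B11Ineq190Actual.ineq190_and_hmv_supSize_sectG` and p29
g9's `B11Ineq190ActualDeriv.ineq190_and_hmv_covDerivBlockSize_sectG` / `ineq190_and_hmv_ofSeminorms_sectG` ([15] Sect. G (182)–(190)
for the ACTUAL Fréchet derivative `(δ/δB)𝓗` of the (179) chart `𝓗 = B11Eq183Differentiation.chartH179 𝒢 W D2 H₀ (· − H(D ·)) ε₄`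
— for the sup size —, transported to the lattice sizes by `B11Presentation190`, `hmv` via Prop. 9's analyticity,
`B11MeanValue190Chart`) PRODUCE exactly these pairs, for the presented lattice function `x ↦ ev x (𝓗(B))` and the canonical
derivative family `dH t = (x ↦ ev x) ∘ D𝓗(tB)`, `t ∈ [0,1]`, from the located leaves of [15] Sect. G only.  THIS FILE COMPOSES the
two, with the scheme's `B`-space THE FINITE PRODUCT `X → 𝔸` carrying p29's tower field (sup norm; input size `supSize gB boxB blkB`,
`κ_B = 1`; the compatibility letter `hBloc` of [15] Sect. G is r11's `B14From190SectG.norm_le_loc_supSize_of_isLoc` under `i ∈ boxB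
(blkB i)`), so that in each knit (190) ITSELF and `hmv` are no longer hypotheses.

WHAT THIS FILE PROVES (kernel-checked, zero `sorry`; theorems only — no `def`, no new `Prop`, no named fact; axioms standard).
§0 (private) `const190_nonneg'` (the (190) constant is `≥ 0` under `q < 1`), `pair_sup_sectG` / `pair_cov_sectG` (the two end-to-end
   pairs for the input size `supSize gB boxB blkB` on `X → 𝔸`, output sizes `supSize gB box blk` / `covDerivBlockSize gB y₀ S ξ U₀`, with
   `hBloc` discharged and `κ_B = 1` substituted — bookkeeping wrappers of r08's/p29's theorems).
§1 `ineq131_lt_layer_sectG`, `ineq131_lt_layer_scale_sectG` — **(1.31)** (`B15From190LayerSizes.ineq131_lt_of_ineq190_layer(_scale)`)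
   for the presented chart `ℍ = x ↦ ev x (𝓗(B))` at p29's (1.30) tower field `B`, with `h190₀`, `h190₁`, `hmv₀`, `hmv₁` DISCHARGED.
§2 `ineq142_le_half_layer_sectG` — **(1.42) «≦ ½δ_j»** (`ineq142_le_half_of_ineq190_layer`), `h190`, `hmv` DISCHARGED.
§3 `ineq139_half_layer_sectG` — **(1.37)–(1.39), lhs of (1.37) «≤ ½δ_j»** (`ineq139_half_of_ineq190_layer`; print's two regions /
   three pieces of the (1.34) argument field on one index set), `h190`, `hmv` DISCHARGED.
§4 `ineq191_twoSup_layer_sectG`, `ineq191_twoSup_layerW_sectG` — **(1.90) ⇒ (1.91)** (two-sup reading; `ineq191_twoSup_of_ineq190_layer`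
   and the fine-field-free form `…_layerW`), `h190₀`, `h190₁`, `hmv₀`, `hmv₁` DISCHARGED.
§5 `ineq148_layer_sectG` — **(1.46) ⇒ (1.48)** with print's WEIGHTED sizes of (1.45) (`ineq148_of_ineq190_layer`: `supSize` and
   `ofSeminorms gB y₀ (L^iη · covDerivSize (S ·) η U₀)` at the rescaled function `(L^iη) • ℍ`), the four located hypotheses DISCHARGED
   through the WEIGHTED presentation `x ↦ (L^iη) • ev x` (its compatibility letters `hevw`, `hevw₁` = the weighted entries of (190)'s
   bracket read into the `𝒴`-size `bN` of (115)).
§6 `second154_lt_layer_sectG` — **(1.57)–(1.58) ⇒ the second expression of (1.54)** (`second154_lt_of_ineq190_layer`, weighted sup size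
   at `(L^{k−j−1})⁻¹ • ℍ`), `h190`, `hmv` DISCHARGED through the weighted presentation `x ↦ (L^{k−j−1})⁻¹ • ev x`.
§7 `ineq196_twoSup_layer_sectG` — **(1.96)** (`ineq196_twoSup_of_ineq190_layer`: chain 1 = (1.90)/(1.91) from (190), chain 2 =
   (1.93)–(1.95) through the printed (1.94)), chain 1's `h190₀`, `h190₁`, `hmv₀`, `hmv₁` DISCHARGED (this supersedes the `_mv` form of
   `B15From190LayerSizes` §9, whose `Hop`/`hderiv` letters were the abstract mean-value data).
§8 `ineq198_twoSup_layer199_sectG` — **(1.98)** p. 200 (`ineq198_twoSup_of_ineq190_layer199`: BOTH p. 199 `ℍ`-chains from (190) with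
   their printed sizes 23d²ε_h / B₃δ′_k) with ALL EIGHT located hypotheses DISCHARGED — the two `ℍ`-functions are the charts of TWO
   SCHEMES of [15] (two backgrounds `C`, `C₀` ⇒ two spaces (115), two operator sets, indices ₁/₂; shared: the geometry, the rate `δ₀`,
   the [3] row-sum datum `c`); the knit's single (190) constant is the `max` of the two explicit constants (`HasMaj.mono`).
HONEST SCOPE.  Assembly of landed theorems BY NAME (r12 `B15From190LayerSizes` p297978/p298425/p303720/p304048; r08 `B11Ineq190Actual`
p304614; p29 `B11Ineq190ActualDeriv` p306169, `B11Presentation190` p303950, `B11MeanValue190Chart` p303712; r11 `B14From190SectG` p305926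
§0).  What is LEFT as hypothesis in every theorem here, exactly: (i) r08's located leaves of [15] Sect. G — the regime (117)–(121)
`Regime 𝒢 0 W B₀ θ C₄ a₃ 𝔧 𝔞 ε₄`, `W = (δ/δA′)V` analytic on `‖Y‖ < a₃`, the Sect. C map `Tm = · − H(D ·)` analytic on `‖Y‖ < ε₄ + 𝔞`
with `Tm 0 = 0` (for the concrete C_j of [4] these are r08's `B11Ineq190FromProp3` from Prop. 3's inputs, cf. `B14From190SectG` §3 —
not repeated here), the argument field `B` in the domain of (180) (`‖H₀B‖ < 𝔞 ∧ ‖Δ⁽²⁾H₀B‖ < 𝔧`), (189) `h189` on that domain (G-B11-G2,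
*«We do not perform these calculations here»*), the kernel letters of G̃ (`hG`), Δ⁽²⁾H₀ (`hD2H0`), H₀ (`hH0`), H (`hH`), (73) `hDfr`,
[3] (2.54) `htri`, the smallness `q < 1` of (187), the size↔norm compatibility letter `hN`; (ii) the presentation letters — real CLMs
`ev x : 𝒴 →L[ℝ] (Fin d → 𝔸)` reading off the bond values at the lattice point `x`, dominated on the box of `y` by the `𝒴`-size `bN`
(`hev`; for the covariant-derivative sizes `hev₁`, for the weighted sizes `hevw`/`hevw₁`), print's (115) being a weighted sup norm with
first covariant derivatives; (iii) the knits' own located side conditions verbatim — ONE row sum [3] (2.61) `RowSum gB σ c` with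
`τ ≥ 0`, `σ + τ ≤ ⅛δ₀` (fed to r08 at the rate `⅛δ₀` by `RowSum.mono`), the weight `const190·c ≤ B₃` (resp. `< B₃` in §3) of (190)'s
explicit constant `const190 1 κ_N κ₃ B_G θ_W c_Δ A₀ A_H θ_𝔇 c` against print's `B₃`, the box/tower GEOMETRY (`hbox`/`hx…`/`hS…`,
`hfar…`, `hX…`, `hgeom…`), p29's lattice regularity data and the explicit γ- and α₀-clauses of gens 8–10, all in the printed shapes.
The words *«and finally Proposition 2 and (181)»* of [15] p. 308 (transport from the base point, G-B11-G2a) are not typed, as in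
`B11SectG`.  No lattice object of [15] is constructed: the instantiation of `𝒴` as the space (115) on `T_η` with its coordinate
functionals is the presentation datum `ev` (p29's `B11MeanValue190Lattice` is the concrete (174) instance).  The scheme's `B`-space IS
the finite product `X → 𝔸` over the (finite) bond index set of the tower; the operators `H₀`, `H`, `D`, … on it stay data.  With this
file every (190)-consuming row of [IV] §1 ((1.31), (1.37)–(1.39), (1.42), (1.45)–(1.48), (1.54)/(1.57), (1.90)–(1.91), (1.96), (1.98)) is
derived in the tree from [15] Prop. 9's LOCATED LEAVES (GAPS G-B15-r12-08 items (a), (e′) closed by name; what stays named there: (189),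
the kernel letters, (73), (2.54), (2.61), `q < 1`, the (115)-presentation letters, the residual box geometry and located clauses).  NOT
summit progress.  r12 gen 11 (literature-prover-lit-balaban-r12-g11-0).

VERSIONS.  v1 = p308026 (commit 699d5a429b50; §§0–8).  v1.1 (this file, r12 gen 11) is APPEND-ONLY: no import added, no v1 declaration,
statement or proof changed, one section added —
§9 `ineq131_lt_layer_of_inputs` — §1's (1.31) with the three Sect. C letters of the scheme (`hTm`: `Tm = · − H(D ·)` analytic on
   `‖Y‖ < ε₄ + 𝔞`; `hTm0`: `Tm 0 = 0`; the differentiability half of `hDfr`) TAKEN FROM [15] PROPOSITION 3 at `D := B11Prop3Model.Dfix C H C₂`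
   (THE solution of [15] (49)) via r08's `B11Ineq190FromProp3` (`analyticOnNhd_Tm_of_le`, `Tm_zero`, `hasFDerivAt_Dfix_of_lt` ∘
   `norm_arg180_lt_eps3`): they are replaced by Proposition 3's inputs (44)/(46)/(72) `B11Prop3Model.Inputs C H C₂ C₃ B₀′ c₄`, the
   analyticity of `C` on `‖Y‖ < 2c₄` ((44) *«an analytic function of A»*), the printed smallness `18C₂B₀′ε₃ ≤ 1`, `2ε₃ ≤ c₄` and the nesting
   `ε₄ + 𝔞 ≤ ε₃` (print runs Sects. A–E «for this pair» with the same ε's, p. 305); the (73) letter becomes the decay majorant `h73` of the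
   ACTUAL derivative of `Dfix` (norm level is Prop. 3's, decay form = `B11Eq73KernelDecay.ineq73`, B11 territory).  The B15 twin of r11's
   `B14From190SectG.ineq319_lt_layer_of_inputs`; the same three-line discharge applies verbatim to §§2–8 (not restated).
v1.2 (r12 gen 14, 2026-08-22): CITELOC DOCFIX ONLY — the eight locators «(115) p.295» now read «(115) p.294» ([Balaban1985Variational] display (115)
is the last display of p. 294 = PDF 18 l. 34; (117) opens p. 295; r08 gen-13 citeloc map, re-run by this seat over the non-B11 files and re-read on
the text layer); no declaration, statement or proof changed.
v1.3 (r12 gen 19, 2026-08-22): QUOTATION DOCFIX ONLY — see the note after THE PRINT above (`lit-balaban-r12/QUOTE-AUDIT-B15.md` A2/A5/A10/L6);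
no declaration, statement or proof changed.
-/

noncomputable section

open scoped BigOperators NNReal
open NormedSpace Set

namespace Literature.MathematicalPhysics.QuantumFieldTheory.Balaban1983to89.B15From190SectG

open Literature.MathematicalPhysics.QuantumFieldTheory.Balaban1983to89
open MatrixLog B7Prop1Explicit B7Prop2Explicit B7Prop1Local B7Prop3Flat B7Eq92Concrete B7Eq162General B8Lemma1NonAbelian
  B8Ineq129 B8Ineq130 B8Ineq165Descent B15Ineq184BlockAxial B15Ineq184Local B8Eq115GaugeFixing B14ArgField36Lattice
  B15LayerLocal B15LayerSupSize
open B6RandomWalk B11SectG B11SupSize190 B11SeminormSize190 B11Eq174Chart B11Eq183Differentiation B11Presentation190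
  B11Ineq190Actual B11Ineq190ActualDeriv B14From190SectG B15From190LayerSizes
open B15.Ineq194Flow

variable {d : ℕ}

/-! ## §0 Bookkeeping: the (190) constant is non-negative; the two end-to-end pairs on the `B`-space `X → 𝔸` -/

/-- The (190) constant `const190 κ_B κ_N κ₃ B_G θ_W c_Δ A₀ A_H θ_𝔇 c` of `B11SectG` is `≥ 0` for non-negative data under the
smallness `q < 1` of (187) (as in `B14From190SectG`, private there). [cite: Balaban1985Variational, (187)–(190) p.308] -/
private theorem const190_nonneg' {κB κN κ₃ BG θW cΔ A₀ AH θD c : ℝ} (hκB : 0 ≤ κB) (hκN : 0 ≤ κN) (hκ₃ : 0 ≤ κ₃)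
    (hc : 0 ≤ c) (hBG : 0 ≤ BG) (hθW : 0 ≤ θW) (hcΔ : 0 ≤ cΔ) (hA₀ : 0 ≤ A₀) (hAH : 0 ≤ AH) (hθD : 0 ≤ θD)
    (hq : qG κ₃ κN BG θW c < 1) : 0 ≤ const190 κB κN κ₃ BG θW cΔ A₀ AH θD c := by
  unfold const190
  have h₁ := constA0_nonneg (cΔ := cΔ) hκ₃ hκN hBG hθW hcΔ hA₀ hc hq
  positivity

section Pairs

variable {X : Type} [Fintype X]
variable {𝒴 𝒵 : Type} [NormedAddCommGroup 𝒴] [NormedSpace ℂ 𝒴] [NormedAddCommGroup 𝒵] [NormedSpace ℂ 𝒵]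
  [CompleteSpace 𝒴] [CompleteSpace 𝒵] {gB : B6.Geometry}
variable {𝔸 : Type} [NormedRing 𝔸] [NormedAlgebra ℂ 𝔸] [CompleteSpace 𝔸]
  {𝒢 : 𝒵 →L[ℂ] 𝒴} {W : 𝒴 → 𝒵} {D2 : 𝒴 →L[ℂ] 𝒵} {H₀ : (X → 𝔸) →L[ℂ] 𝒴} {B₀ θ C₄ a₃ 𝔧 𝔞 ε₄ : ℝ}
  {E : Type} [NormedAddCommGroup E] [NormedSpace ℝ E]

/-- **The end-to-end pair for the SUP output size, input size `supSize gB boxB blkB` on `X → 𝔸`** (`κ_B = 1`, `hBloc` from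
`i ∈ boxB (blkB i)`): r08's `B11Ineq190Actual.ineq190_and_hmv_supSize_sectG` for the canonical presentation of the (179) chart,
together with `0 ≤ const190 1 …`. [cite: Balaban1985Variational, Prop. 9 (190) pp.308–309, (179)–(180) p.306] -/
private theorem pair_sup_sectG (Reg : Regime 𝒢 0 W B₀ θ C₄ a₃ 𝔧 𝔞 ε₄) (hWa : AnalyticOnNhd ℂ W {Y : 𝒴 | ‖Y‖ < a₃})
    {D : 𝒴 → X → 𝔸} (H : (X → 𝔸) →L[ℂ] 𝒴) (hTm : AnalyticOnNhd ℂ (fun Y : 𝒴 => Y - H (D Y)) {Y : 𝒴 | ‖Y‖ < ε₄ + 𝔞})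
    (hTm0 : (0 : 𝒴) - H (D 0) = 0) {B : X → 𝔸} (hB : ‖H₀ B‖ < 𝔞 ∧ ‖D2 (H₀ B)‖ < 𝔧)
    (boxB : gB.Site → Finset X) (blkB : X → gB.Site) (hcover : ∀ i, i ∈ boxB (blkB i))
    {Xo : Type} (box : gB.Site → Finset Xo) (blk : Xo → gB.Site) (ev : Xo → (𝒴 →L[ℝ] E))
    {bN : BlockNorm gB 𝒴} {b3 : BlockNorm gB 𝒵}
    (hev : ∀ (y : gB.Site) (v : 𝒴), ∀ x ∈ box y, ‖ev x v‖ ≤ bN.loc y v)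
    (hN : ∀ (y : gB.Site) (v : 𝒴), bN.loc y v ≤ ‖v‖)
    {δ₀ BG θW cΔ A₀ AH θD c : ℝ}
    (htri : Triangle254 gB) (hd : ∀ a b : gB.Site, 0 ≤ gB.dist a b) (hδ₀ : 0 ≤ δ₀) (hrow8 : RowSum gB (δ₀ / 8) c)
    (hc : 0 ≤ c) (hBG : 0 ≤ BG) (hθW : 0 ≤ θW) (hcΔ : 0 ≤ cΔ) (hA₀ : 0 ≤ A₀) (hAH : 0 ≤ AH) (hθD : 0 ≤ θD)
    (hG : HasMaj b3 bN (𝒢.restrictScalars ℝ : 𝒵 →ₗ[ℝ] 𝒴) (fun y y' => BG * Real.exp (-(δ₀ * gB.dist y y'))))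
    (hD2H0 : HasMaj (supSize (X := X) (E := 𝔸) gB boxB blkB) b3 ((D2 ∘L H₀).restrictScalars ℝ : (X → 𝔸) →ₗ[ℝ] 𝒵)
      (fun y y' => cΔ * Real.exp (-(δ₀ * gB.dist y y'))))
    (hH0 : HasMaj (supSize (X := X) (E := 𝔸) gB boxB blkB) bN (H₀.restrictScalars ℝ : (X → 𝔸) →ₗ[ℝ] 𝒴)
      (fun y y' => A₀ * Real.exp (-(δ₀ * gB.dist y y'))))
    (hH : HasMaj (supSize (X := X) (E := 𝔸) gB boxB blkB) bN (H.restrictScalars ℝ : (X → 𝔸) →ₗ[ℝ] 𝒴)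
      (fun y y' => AH * Real.exp (-(δ₀ / 2 * gB.dist y y'))))
    (h189 : ∀ B' : X → 𝔸, ‖H₀ B'‖ < 𝔞 → ‖D2 (H₀ B')‖ < 𝔧 →
      Ineq189 bN b3 ((fderiv ℂ W (solA180 𝒢 W D2 H₀ ε₄ B' + H₀ B')).restrictScalars ℝ : 𝒴 →ₗ[ℝ] 𝒵) θW δ₀)
    (hDfr : ∀ B' : X → 𝔸, ‖H₀ B'‖ < 𝔞 → ‖D2 (H₀ B')‖ < 𝔧 →
      ∃ 𝔇 : 𝒴 →L[ℂ] (X → 𝔸), HasFDerivAt D 𝔇 (solA180 𝒢 W D2 H₀ ε₄ B' + H₀ B') ∧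
        HasMaj bN (supSize (X := X) (E := 𝔸) gB boxB blkB) (𝔇.restrictScalars ℝ : 𝒴 →ₗ[ℝ] (X → 𝔸))
          (fun y y' => θD * Real.exp (-(δ₀ / 2 * gB.dist y y'))))
    (hq : qG b3.κ bN.κ BG θW c < 1) (y : gB.Site) :
    0 ≤ const190 1 bN.κ b3.κ BG θW cΔ A₀ AH θD c ∧
    (∀ t : Icc (0:ℝ) 1, Ineq190 (supSize (X := X) (E := 𝔸) gB boxB blkB) (supSize gB box blk : BlockNorm gB (Xo → E))
        ((LinearMap.pi fun x => ((ev x : 𝒴 →L[ℝ] E) : 𝒴 →ₗ[ℝ] E)) ∘ₗ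
          ((fderiv ℂ (chartH179 𝒢 W D2 H₀ (fun Y : 𝒴 => Y - H (D Y)) ε₄) ((t : ℝ) • B)).restrictScalars ℝ :
            (X → 𝔸) →ₗ[ℝ] 𝒴))
        (const190 1 bN.κ b3.κ BG θW cΔ A₀ AH θD c) δ₀) ∧
      ∀ s : ℝ, (∀ t : Icc (0:ℝ) 1, (supSize gB box blk : BlockNorm gB (Xo → E)).loc y
          (((LinearMap.pi fun x => ((ev x : 𝒴 →L[ℝ] E) : 𝒴 →ₗ[ℝ] E)) ∘ₗ
            ((fderiv ℂ (chartH179 𝒢 W D2 H₀ (fun Y : 𝒴 => Y - H (D Y)) ε₄) ((t : ℝ) • B)).restrictScalars ℝ :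
              (X → 𝔸) →ₗ[ℝ] 𝒴)) B) ≤ s) →
        (supSize gB box blk : BlockNorm gB (Xo → E)).loc y (fun x => ev x (chartH179 𝒢 W D2 H₀ (fun Y : 𝒴 => Y - H (D Y)) ε₄ B))
          ≤ s := by
  have hBloc : ∀ (y' : gB.Site) (μ : X → 𝔸), (supSize (X := X) (E := 𝔸) gB boxB blkB).IsLoc y' μ →
      ‖μ‖ ≤ (supSize (X := X) (E := 𝔸) gB boxB blkB).loc y' μ := fun y' μ hμ => norm_le_loc_supSize_of_isLoc hcover hμ
  obtain ⟨h190, hmv⟩ := ineq190_and_hmv_supSize_sectG (box := box) (blk := blk) Reg hWa H hTm hTm0 hB ev hev hN hBloc htri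
    hd hδ₀ hrow8 hc hBG hθW hcΔ hA₀ hAH hθD hG hD2H0 hH0 hH h189 hDfr hq
    (fun B' => fun x => ev x (chartH179 𝒢 W D2 H₀ (fun Y : 𝒴 => Y - H (D Y)) ε₄ B'))
    (fun t => (LinearMap.pi fun x => ((ev x : 𝒴 →L[ℝ] E) : 𝒴 →ₗ[ℝ] E)) ∘ₗ
      ((fderiv ℂ (chartH179 𝒢 W D2 H₀ (fun Y : 𝒴 => Y - H (D Y)) ε₄) ((t : ℝ) • B)).restrictScalars ℝ : (X → 𝔸) →ₗ[ℝ] 𝒴))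
    (fun _ => rfl) (fun _ => rfl) y
  rw [supSize_κ] at h190
  exact ⟨const190_nonneg' zero_le_one bN.κ_nonneg b3.κ_nonneg hc hBG hθW hcΔ hA₀ hAH hθD hq, h190, hmv⟩

/-- **The end-to-end pair for the FIRST-ORDER output size `covDerivBlockSize gB y₀ S ξ U₀`, input size `supSize gB boxB blkB` on
`X → 𝔸`**: p29's `B11Ineq190ActualDeriv.ineq190_and_hmv_covDerivBlockSize_sectG` for the canonical presentation, `hBloc` discharged,
`κ_B = 1`. [cite: Balaban1985Variational, Prop. 9 (190) pp.308–309, (179)–(180) p.306, (115) p.294] -/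
private theorem pair_cov_sectG (Reg : Regime 𝒢 0 W B₀ θ C₄ a₃ 𝔧 𝔞 ε₄) (hWa : AnalyticOnNhd ℂ W {Y : 𝒴 | ‖Y‖ < a₃})
    {D : 𝒴 → X → 𝔸} (H : (X → 𝔸) →L[ℂ] 𝒴) (hTm : AnalyticOnNhd ℂ (fun Y : 𝒴 => Y - H (D Y)) {Y : 𝒴 | ‖Y‖ < ε₄ + 𝔞})
    (hTm0 : (0 : 𝒴) - H (D 0) = 0) {B : X → 𝔸} (hB : ‖H₀ B‖ < 𝔞 ∧ ‖D2 (H₀ B)‖ < 𝔧)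
    (boxB : gB.Site → Finset X) (blkB : X → gB.Site) (hcover : ∀ i, i ∈ boxB (blkB i))
    (y₀ : gB.Site) (S : gB.Site → Finset (B7Prop1Explicit.Site d × Fin d × Fin d)) {ξ : ℝ}
    {U₀ : B7Prop1Explicit.Site d → Fin d → 𝔸ˣ} (ev : B7Prop1Explicit.Site d → (𝒴 →L[ℝ] (Fin d → 𝔸)))
    {bN : BlockNorm gB 𝒴} {b3 : BlockNorm gB 𝒵}
    (hev₁ : ∀ (y : gB.Site) (v : 𝒴), (covDerivBlockSize gB y₀ S ξ U₀).loc y (fun x => ev x v) ≤ bN.loc y v)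
    (hN : ∀ (y : gB.Site) (v : 𝒴), bN.loc y v ≤ ‖v‖)
    {δ₀ BG θW cΔ A₀ AH θD c : ℝ}
    (htri : Triangle254 gB) (hd : ∀ a b : gB.Site, 0 ≤ gB.dist a b) (hδ₀ : 0 ≤ δ₀) (hrow8 : RowSum gB (δ₀ / 8) c)
    (hc : 0 ≤ c) (hBG : 0 ≤ BG) (hθW : 0 ≤ θW) (hcΔ : 0 ≤ cΔ) (hA₀ : 0 ≤ A₀) (hAH : 0 ≤ AH) (hθD : 0 ≤ θD)
    (hG : HasMaj b3 bN (𝒢.restrictScalars ℝ : 𝒵 →ₗ[ℝ] 𝒴) (fun y y' => BG * Real.exp (-(δ₀ * gB.dist y y'))))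
    (hD2H0 : HasMaj (supSize (X := X) (E := 𝔸) gB boxB blkB) b3 ((D2 ∘L H₀).restrictScalars ℝ : (X → 𝔸) →ₗ[ℝ] 𝒵)
      (fun y y' => cΔ * Real.exp (-(δ₀ * gB.dist y y'))))
    (hH0 : HasMaj (supSize (X := X) (E := 𝔸) gB boxB blkB) bN (H₀.restrictScalars ℝ : (X → 𝔸) →ₗ[ℝ] 𝒴)
      (fun y y' => A₀ * Real.exp (-(δ₀ * gB.dist y y'))))
    (hH : HasMaj (supSize (X := X) (E := 𝔸) gB boxB blkB) bN (H.restrictScalars ℝ : (X → 𝔸) →ₗ[ℝ] 𝒴)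
      (fun y y' => AH * Real.exp (-(δ₀ / 2 * gB.dist y y'))))
    (h189 : ∀ B' : X → 𝔸, ‖H₀ B'‖ < 𝔞 → ‖D2 (H₀ B')‖ < 𝔧 →
      Ineq189 bN b3 ((fderiv ℂ W (solA180 𝒢 W D2 H₀ ε₄ B' + H₀ B')).restrictScalars ℝ : 𝒴 →ₗ[ℝ] 𝒵) θW δ₀)
    (hDfr : ∀ B' : X → 𝔸, ‖H₀ B'‖ < 𝔞 → ‖D2 (H₀ B')‖ < 𝔧 →
      ∃ 𝔇 : 𝒴 →L[ℂ] (X → 𝔸), HasFDerivAt D 𝔇 (solA180 𝒢 W D2 H₀ ε₄ B' + H₀ B') ∧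
        HasMaj bN (supSize (X := X) (E := 𝔸) gB boxB blkB) (𝔇.restrictScalars ℝ : 𝒴 →ₗ[ℝ] (X → 𝔸))
          (fun y y' => θD * Real.exp (-(δ₀ / 2 * gB.dist y y'))))
    (hq : qG b3.κ bN.κ BG θW c < 1) (y : gB.Site) :
    (∀ t : Icc (0:ℝ) 1, Ineq190 (supSize (X := X) (E := 𝔸) gB boxB blkB) (covDerivBlockSize gB y₀ S ξ U₀)
        ((LinearMap.pi fun x => ((ev x : 𝒴 →L[ℝ] (Fin d → 𝔸)) : 𝒴 →ₗ[ℝ] (Fin d → 𝔸))) ∘ₗ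
          ((fderiv ℂ (chartH179 𝒢 W D2 H₀ (fun Y : 𝒴 => Y - H (D Y)) ε₄) ((t : ℝ) • B)).restrictScalars ℝ :
            (X → 𝔸) →ₗ[ℝ] 𝒴))
        (const190 1 bN.κ b3.κ BG θW cΔ A₀ AH θD c) δ₀) ∧
      ∀ s : ℝ, (∀ t : Icc (0:ℝ) 1, (covDerivBlockSize gB y₀ S ξ U₀).loc y
          (((LinearMap.pi fun x => ((ev x : 𝒴 →L[ℝ] (Fin d → 𝔸)) : 𝒴 →ₗ[ℝ] (Fin d → 𝔸))) ∘ₗ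
            ((fderiv ℂ (chartH179 𝒢 W D2 H₀ (fun Y : 𝒴 => Y - H (D Y)) ε₄) ((t : ℝ) • B)).restrictScalars ℝ :
              (X → 𝔸) →ₗ[ℝ] 𝒴)) B) ≤ s) →
        (covDerivBlockSize gB y₀ S ξ U₀).loc y (fun x => ev x (chartH179 𝒢 W D2 H₀ (fun Y : 𝒴 => Y - H (D Y)) ε₄ B))
          ≤ s := by
  have hBloc : ∀ (y' : gB.Site) (μ : X → 𝔸), (supSize (X := X) (E := 𝔸) gB boxB blkB).IsLoc y' μ →
      ‖μ‖ ≤ (supSize (X := X) (E := 𝔸) gB boxB blkB).loc y' μ := fun y' μ hμ => norm_le_loc_supSize_of_isLoc hcover hμ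
  obtain ⟨h190, hmv⟩ := ineq190_and_hmv_covDerivBlockSize_sectG (y₀ := y₀) (S := S) (ξ := ξ) (U₀ := U₀) Reg hWa H hTm hTm0
    hB ev hev₁ hN hBloc htri hd hδ₀ hrow8 hc hBG hθW hcΔ hA₀ hAH hθD hG hD2H0 hH0 hH h189 hDfr hq
    (fun B' => fun x => ev x (chartH179 𝒢 W D2 H₀ (fun Y : 𝒴 => Y - H (D Y)) ε₄ B'))
    (fun t => (LinearMap.pi fun x => ((ev x : 𝒴 →L[ℝ] (Fin d → 𝔸)) : 𝒴 →ₗ[ℝ] (Fin d → 𝔸))) ∘ₗ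
      ((fderiv ℂ (chartH179 𝒢 W D2 H₀ (fun Y : 𝒴 => Y - H (D Y)) ε₄) ((t : ℝ) • B)).restrictScalars ℝ : (X → 𝔸) →ₗ[ℝ] 𝒴))
    (fun _ => rfl) (fun _ => rfl) y
  rw [supSize_κ] at h190
  exact ⟨h190, hmv⟩

end Pairs

/-! ## §1 (1.31): p29's (1.30) tower field, sup and covariant-derivative output sizes -/

section Eq131

variable {X : Type} [Fintype X]
variable {𝒴 𝒵 : Type} [NormedAddCommGroup 𝒴] [NormedSpace ℂ 𝒴] [NormedAddCommGroup 𝒵] [NormedSpace ℂ 𝒵]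
  [CompleteSpace 𝒴] [CompleteSpace 𝒵] {gB : B6.Geometry}
variable {𝔸 : Type} [CStarAlgebra 𝔸] [Nontrivial 𝔸]
  {𝒢 : 𝒵 →L[ℂ] 𝒴} {W : 𝒴 → 𝒵} {D2 : 𝒴 →L[ℂ] 𝒵} {H₀ : (X → 𝔸) →L[ℂ] 𝒴} {B₀ θ C₄ a₃ 𝔧 𝔞 ε₄ : ℝ}

/-- **(1.31) ⇒ "the functions (1.3) … are equal to 1" ON THE LATTICE MODEL, END TO END FROM THE LOCATED LEAVES OF [15] SECT. G,
ALL SIZES CONCRETE** — r12's `B15From190LayerSizes.ineq131_lt_of_ineq190_layer` (argument field `B :=` p29's (1.30) tower field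
`i ↦ log[M^{j−dep i}(U₀)(b_i)((Q^{s*}_{dep i}M^j(U₀))(b_i))⁻¹]` on the finite bond set `X`, input size `supSize gB boxB blkB`, B-size
`22d²ε_j` and localisation discharged there; output sizes `supSize gB box blk` — *"on the cube □^∼ this function"* — and
`covDerivBlockSize gB y₀ S ξ U₀` — *"and its covariant derivatives"*) for the presented chart `ℍ = x ↦ ev x (𝓗(B))`,
`𝓗 = chartH179 𝒢 W D2 H₀ (· − H(D ·)) ε₄` ([15] (179)), with its FOUR located hypotheses `h190₀`/`hmv₀` (values: r08's
`B11Ineq190Actual.ineq190_and_hmv_supSize_sectG`) and `h190₁`/`hmv₁` (covariant derivatives: p29's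
`B11Ineq190ActualDeriv.ineq190_and_hmv_covDerivBlockSize_sectG`) SUPPLIED; the (190) constant is `B11SectG.const190 1 …`, explicit, and
the two entries n = 0, 1 of (190) are read off ONE `𝒴`-size `bN` through the compatibility letters `hev` (values) and `hev₁` (first
covariant derivatives — print's (115) norm carries them).  Remaining: r08's located leaves of Sect. G, the presentation letters, and
the knit's side conditions verbatim ((1.24) `h124` on the finest cube, block-axial gauge `h15`, tower geometry `hX`/`hfar`,
`δ2M₂R_j ≤ τD`, the γ-clause `22d²B₃γ² < β/10`, plaquette data).
[cite: Balaban1989LargeFieldI, (1.30)–(1.31) pp.183–184, (1.24) p.181; Balaban1985Variational, Prop. 9 (190) pp.308–309, (179)–(180) p.306, (115) p.294] -/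
theorem ineq131_lt_layer_sectG (Reg : Regime 𝒢 0 W B₀ θ C₄ a₃ 𝔧 𝔞 ε₄) (hWa : AnalyticOnNhd ℂ W {Y : 𝒴 | ‖Y‖ < a₃})
    {D : 𝒴 → X → 𝔸} (H : (X → 𝔸) →L[ℂ] 𝒴) (hTm : AnalyticOnNhd ℂ (fun Y : 𝒴 => Y - H (D Y)) {Y : 𝒴 | ‖Y‖ < ε₄ + 𝔞})
    (hTm0 : (0 : 𝒴) - H (D 0) = 0)
    -- p29's (1.30) tower and its field `B`, which must lie in the domain of (180)
    (dep : X → ℕ) (pt : X → B7Prop1Explicit.Site d) (dir : X → Fin d)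
    {L : ℕ} (hL : 2 ≤ L) (hd1 : 1 ≤ d) {G : Subgroup 𝔸ˣ} (hAG : AvgClosed d L G) {j : ℕ}
    {U₀ : B7Prop1Explicit.Site d → Fin d → 𝔸ˣ} (hU₀ : ∀ x κ, U₀ x κ ∈ G)
    (hB : ‖H₀ (fun i => mlog (((avgIter L U₀ (j - dep i) (pt i) (dir i) *
          (pullIter L (avgIter L U₀ j) (dep i) (pt i) (dir i))⁻¹ : 𝔸ˣ) : 𝔸)))‖ < 𝔞 ∧
      ‖D2 (H₀ (fun i => mlog (((avgIter L U₀ (j - dep i) (pt i) (dir i) *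
          (pullIter L (avgIter L U₀ j) (dep i) (pt i) (dir i))⁻¹ : 𝔸ˣ) : 𝔸))))‖ < 𝔧)
    -- sizes and presentation
    (boxB : gB.Site → Finset X) (blkB : X → gB.Site) (hcover : ∀ i, i ∈ boxB (blkB i))
    (box : gB.Site → Finset (B7Prop1Explicit.Site d)) (blk : B7Prop1Explicit.Site d → gB.Site)
    (y₀ : gB.Site) (S : gB.Site → Finset (B7Prop1Explicit.Site d × Fin d × Fin d)) {ξ : ℝ}
    (ev : B7Prop1Explicit.Site d → (𝒴 →L[ℝ] (Fin d → 𝔸)))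
    {bN : BlockNorm gB 𝒴} {b3 : BlockNorm gB 𝒵}
    (hev : ∀ (y : gB.Site) (v : 𝒴), ∀ x ∈ box y, ‖ev x v‖ ≤ bN.loc y v)
    (hev₁ : ∀ (y : gB.Site) (v : 𝒴), (covDerivBlockSize gB y₀ S ξ U₀).loc y (fun x => ev x v) ≤ bN.loc y v)
    (hN : ∀ (y : gB.Site) (v : 𝒴), bN.loc y v ≤ ‖v‖)
    -- the located leaves of [15] Sect. G (r08's letters), input size `supSize gB boxB blkB`
    {δ₀ BG θW cΔ A₀ AH θD c : ℝ}
    (htri : Triangle254 gB) (hd : ∀ a b : gB.Site, 0 ≤ gB.dist a b) (hδ₀ : 0 ≤ δ₀)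
    (hc : 0 ≤ c) (hBG : 0 ≤ BG) (hθW : 0 ≤ θW) (hcΔ : 0 ≤ cΔ) (hA₀ : 0 ≤ A₀) (hAH : 0 ≤ AH) (hθD : 0 ≤ θD)
    (hG : HasMaj b3 bN (𝒢.restrictScalars ℝ : 𝒵 →ₗ[ℝ] 𝒴) (fun y y' => BG * Real.exp (-(δ₀ * gB.dist y y'))))
    (hD2H0 : HasMaj (supSize (X := X) (E := 𝔸) gB boxB blkB) b3 ((D2 ∘L H₀).restrictScalars ℝ : (X → 𝔸) →ₗ[ℝ] 𝒵)
      (fun y y' => cΔ * Real.exp (-(δ₀ * gB.dist y y'))))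
    (hH0 : HasMaj (supSize (X := X) (E := 𝔸) gB boxB blkB) bN (H₀.restrictScalars ℝ : (X → 𝔸) →ₗ[ℝ] 𝒴)
      (fun y y' => A₀ * Real.exp (-(δ₀ * gB.dist y y'))))
    (hH : HasMaj (supSize (X := X) (E := 𝔸) gB boxB blkB) bN (H.restrictScalars ℝ : (X → 𝔸) →ₗ[ℝ] 𝒴)
      (fun y y' => AH * Real.exp (-(δ₀ / 2 * gB.dist y y'))))
    (h189 : ∀ B' : X → 𝔸, ‖H₀ B'‖ < 𝔞 → ‖D2 (H₀ B')‖ < 𝔧 →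
      Ineq189 bN b3 ((fderiv ℂ W (solA180 𝒢 W D2 H₀ ε₄ B' + H₀ B')).restrictScalars ℝ : 𝒴 →ₗ[ℝ] 𝒵) θW δ₀)
    (hDfr : ∀ B' : X → 𝔸, ‖H₀ B'‖ < 𝔞 → ‖D2 (H₀ B')‖ < 𝔧 →
      ∃ 𝔇 : 𝒴 →L[ℂ] (X → 𝔸), HasFDerivAt D 𝔇 (solA180 𝒢 W D2 H₀ ε₄ B' + H₀ B') ∧
        HasMaj bN (supSize (X := X) (E := 𝔸) gB boxB blkB) (𝔇.restrictScalars ℝ : 𝒴 →ₗ[ℝ] (X → 𝔸))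
          (fun y y' => θD * Real.exp (-(δ₀ / 2 * gB.dist y y'))))
    (hq : qG b3.κ bN.κ BG θW c < 1)
    -- the [IV] side: the letters of `B15From190LayerSizes.ineq131_lt_of_ineq190_layer` minus `h190₀`, `h190₁`, `hmv₀`, `hmv₁`
    {σ τ Dd B₃ δ M₂ εj β γ gj : ℝ} {r R : ℕ}
    (hrow : RowSum gB σ c) (hτ : 0 ≤ τ) (hστ : σ + τ ≤ δ₀ / 8) (y : gB.Site)
    (hε : 0 < εj) (hε3 : C0 d * εj ≤ 1 / 3) (hε2 : 2 * εj ≤ c2' d L) (hεs : 11 * (d : ℝ) ^ 2 * εj ≤ 1 / 6)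
    (lo hi : B7Prop1Explicit.Site d) (hlohi : lo ≤ hi)
    (h124 : pdevOn (tlo L lo j) (thi L hi j) U₀ < (1 - β * (1 / 2)) * εj * (((L : ℝ) ^ j)⁻¹) ^ 2)
    (h15 : ∀ n, n < j → ∀ z, tlo L lo n ≤ z → z ≤ thi L hi n → ∀ r : Fin d → Fin L,
      axialFn (avgIter L U₀ (j - (n + 1))) ((L : ℤ) • z) ((L : ℤ) • z + boxVec L r) = 1)
    (hX : ∀ i, dep i ≤ j ∧ tlo L lo (dep i) ≤ pt i ∧ pt i + e (dir i) ≤ thi L hi (dep i))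
    (hfar : ∀ y' i, i ∈ boxB y' → Dd ≤ gB.dist y y')
    (hξ : 0 < ξ) {Hf : B7Prop1Explicit.Site d → Fin d → 𝔸}
    (hHf : Hf = fun x => ev x (chartH179 𝒢 W D2 H₀ (fun Y : 𝒴 => Y - H (D Y)) ε₄
      (fun i => mlog (((avgIter L U₀ (j - dep i) (pt i) (dir i) *
          (pullIter L (avgIter L U₀ j) (dep i) (pt i) (dir i))⁻¹ : 𝔸ˣ) : 𝔸)))))
    (hsa : ∀ z κ, IsSelfAdjoint (Hf z κ))
    {g : B7Prop1Explicit.Site d → 𝔸ˣ} (hg : ∀ z, g z ∈ U1 𝔸) (μ ν : Fin d) (x : B7Prop1Explicit.Site d)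
    (hgeom : δ * 2 * M₂ * R ≤ τ * Dd) (hCB : const190 1 bN.κ b3.κ BG θW cΔ A₀ AH θD c * c ≤ B₃) (hB₃ : 0 ≤ B₃)
    (hr : 1 ≤ r) (hR : B14.IsRj L r gj R) (hgj : 0 < gj) (hgγ : gj ≤ γ) (hγe : 1 ≤ Real.log (γ ^ 2)⁻¹)
    (hc1 : 1 ≤ δ * 2 * M₂) (hγ : B₃ * (22 * (d : ℝ) ^ 2) * γ ^ 2 < β / 10)
    (hx : x ∈ box y) (hxμ : x + e μ ∈ box y) (hxν : x + e ν ∈ box y)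
    (hS₁ : (x, μ, ν) ∈ S y) (hS₂ : (x, ν, μ) ∈ S y)
    (hβ0 : 0 < β) (hβ1 : β ≤ 1) (hε1 : εj ≤ 1) (hεξ : εj * ξ ≤ ((L : ℝ) ^ 2)⁻¹)
    (hdev₀ : ‖B8Ineq132.plaqF U₀ μ ν x - 1‖ < (1 - β / 2) * εj * ξ ^ 2) :
    ‖B8Ineq132.plaqF (gaugeAct g (B8Lemma1NonAbelian.mulCfg (B8Eq146AExpansion.expCfg
        (B8Eq146AExpansion.iEta ξ Hf)) U₀)) μ ν x - 1‖ < εj * ξ ^ 2 := by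
  have hrow8 : RowSum gB (δ₀ / 8) c := hrow.mono hd (by linarith)
  obtain ⟨hK, h190₀, hmv₀⟩ := pair_sup_sectG Reg hWa H hTm hTm0 hB boxB blkB hcover box blk ev hev hN htri hd hδ₀ hrow8 hc hBG
    hθW hcΔ hA₀ hAH hθD hG hD2H0 hH0 hH h189 hDfr hq y
  obtain ⟨h190₁, hmv₁⟩ := pair_cov_sectG Reg hWa H hTm hTm0 hB boxB blkB hcover y₀ S ev hev₁ hN htri hd hδ₀ hrow8 hc hBG hθW
    hcΔ hA₀ hAH hθD hG hD2H0 hH0 hH h189 hDfr hq y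
  subst hHf
  exact ineq131_lt_of_ineq190_layer boxB blkB dep pt dir box blk y₀ S h190₀ h190₁ hK hd hrow hτ hστ y hL hd1 hAG hU₀ hε hε3 hε2
    hεs lo hi hlohi h124 h15 hX hfar hξ hsa hg μ ν x hmv₀ hmv₁ hgeom hCB hB₃ hr hR hgj hgγ hγe hc1 hγ hx hxμ hxν hS₁ hS₂ hβ0
    hβ1 hε1 hεξ hdev₀

/-- **(1.31) AT PRINT'S SCALE `ξ = L^{−j}`, END TO END FROM [15] SECT. G** — r12's `ineq131_lt_of_ineq190_layer_scale` (the
consumer's `χ^{(n)}_k`-restriction at the plaquette is the SAME (1.24) hypothesis `h124` that sizes the argument field) for the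
presented chart, with `h190₀`, `h190₁`, `hmv₀`, `hmv₁` SUPPLIED as in `ineq131_lt_layer_sectG`.
[cite: Balaban1989LargeFieldI, (1.24) p.181, (1.30)–(1.31) pp.183–184; Balaban1985Variational, Prop. 9 (190) pp.308–309, (179)–(180) p.306, (115) p.294] -/
theorem ineq131_lt_layer_scale_sectG (Reg : Regime 𝒢 0 W B₀ θ C₄ a₃ 𝔧 𝔞 ε₄) (hWa : AnalyticOnNhd ℂ W {Y : 𝒴 | ‖Y‖ < a₃})
    {D : 𝒴 → X → 𝔸} (H : (X → 𝔸) →L[ℂ] 𝒴) (hTm : AnalyticOnNhd ℂ (fun Y : 𝒴 => Y - H (D Y)) {Y : 𝒴 | ‖Y‖ < ε₄ + 𝔞})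
    (hTm0 : (0 : 𝒴) - H (D 0) = 0)
    (dep : X → ℕ) (pt : X → B7Prop1Explicit.Site d) (dir : X → Fin d)
    {L : ℕ} (hL : 2 ≤ L) (hd1 : 1 ≤ d) {G : Subgroup 𝔸ˣ} (hAG : AvgClosed d L G) {j : ℕ}
    {U₀ : B7Prop1Explicit.Site d → Fin d → 𝔸ˣ} (hU₀ : ∀ x κ, U₀ x κ ∈ G)
    (hB : ‖H₀ (fun i => mlog (((avgIter L U₀ (j - dep i) (pt i) (dir i) *
          (pullIter L (avgIter L U₀ j) (dep i) (pt i) (dir i))⁻¹ : 𝔸ˣ) : 𝔸)))‖ < 𝔞 ∧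
      ‖D2 (H₀ (fun i => mlog (((avgIter L U₀ (j - dep i) (pt i) (dir i) *
          (pullIter L (avgIter L U₀ j) (dep i) (pt i) (dir i))⁻¹ : 𝔸ˣ) : 𝔸))))‖ < 𝔧)
    (boxB : gB.Site → Finset X) (blkB : X → gB.Site) (hcover : ∀ i, i ∈ boxB (blkB i))
    (box : gB.Site → Finset (B7Prop1Explicit.Site d)) (blk : B7Prop1Explicit.Site d → gB.Site)
    (y₀ : gB.Site) (S : gB.Site → Finset (B7Prop1Explicit.Site d × Fin d × Fin d))
    (ev : B7Prop1Explicit.Site d → (𝒴 →L[ℝ] (Fin d → 𝔸)))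
    {bN : BlockNorm gB 𝒴} {b3 : BlockNorm gB 𝒵}
    (hev : ∀ (y : gB.Site) (v : 𝒴), ∀ x ∈ box y, ‖ev x v‖ ≤ bN.loc y v)
    (hev₁ : ∀ (y : gB.Site) (v : 𝒴),
      (covDerivBlockSize gB y₀ S (((L : ℝ) ^ j)⁻¹) U₀).loc y (fun x => ev x v) ≤ bN.loc y v)
    (hN : ∀ (y : gB.Site) (v : 𝒴), bN.loc y v ≤ ‖v‖)
    {δ₀ BG θW cΔ A₀ AH θD c : ℝ}
    (htri : Triangle254 gB) (hd : ∀ a b : gB.Site, 0 ≤ gB.dist a b) (hδ₀ : 0 ≤ δ₀)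
    (hc : 0 ≤ c) (hBG : 0 ≤ BG) (hθW : 0 ≤ θW) (hcΔ : 0 ≤ cΔ) (hA₀ : 0 ≤ A₀) (hAH : 0 ≤ AH) (hθD : 0 ≤ θD)
    (hG : HasMaj b3 bN (𝒢.restrictScalars ℝ : 𝒵 →ₗ[ℝ] 𝒴) (fun y y' => BG * Real.exp (-(δ₀ * gB.dist y y'))))
    (hD2H0 : HasMaj (supSize (X := X) (E := 𝔸) gB boxB blkB) b3 ((D2 ∘L H₀).restrictScalars ℝ : (X → 𝔸) →ₗ[ℝ] 𝒵)
      (fun y y' => cΔ * Real.exp (-(δ₀ * gB.dist y y'))))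
    (hH0 : HasMaj (supSize (X := X) (E := 𝔸) gB boxB blkB) bN (H₀.restrictScalars ℝ : (X → 𝔸) →ₗ[ℝ] 𝒴)
      (fun y y' => A₀ * Real.exp (-(δ₀ * gB.dist y y'))))
    (hH : HasMaj (supSize (X := X) (E := 𝔸) gB boxB blkB) bN (H.restrictScalars ℝ : (X → 𝔸) →ₗ[ℝ] 𝒴)
      (fun y y' => AH * Real.exp (-(δ₀ / 2 * gB.dist y y'))))
    (h189 : ∀ B' : X → 𝔸, ‖H₀ B'‖ < 𝔞 → ‖D2 (H₀ B')‖ < 𝔧 →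
      Ineq189 bN b3 ((fderiv ℂ W (solA180 𝒢 W D2 H₀ ε₄ B' + H₀ B')).restrictScalars ℝ : 𝒴 →ₗ[ℝ] 𝒵) θW δ₀)
    (hDfr : ∀ B' : X → 𝔸, ‖H₀ B'‖ < 𝔞 → ‖D2 (H₀ B')‖ < 𝔧 →
      ∃ 𝔇 : 𝒴 →L[ℂ] (X → 𝔸), HasFDerivAt D 𝔇 (solA180 𝒢 W D2 H₀ ε₄ B' + H₀ B') ∧
        HasMaj bN (supSize (X := X) (E := 𝔸) gB boxB blkB) (𝔇.restrictScalars ℝ : 𝒴 →ₗ[ℝ] (X → 𝔸))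
          (fun y y' => θD * Real.exp (-(δ₀ / 2 * gB.dist y y'))))
    (hq : qG b3.κ bN.κ BG θW c < 1)
    -- the [IV] side: the letters of `B15From190LayerSizes.ineq131_lt_of_ineq190_layer_scale` minus `h190₀,₁`, `hmv₀,₁`
    {σ τ Dd B₃ δ M₂ εj β γ gj : ℝ} {r R : ℕ}
    (hrow : RowSum gB σ c) (hτ : 0 ≤ τ) (hστ : σ + τ ≤ δ₀ / 8) (y : gB.Site)
    (hε : 0 < εj) (hε3 : C0 d * εj ≤ 1 / 3) (hε2 : 2 * εj ≤ c2' d L) (hεs : 11 * (d : ℝ) ^ 2 * εj ≤ 1 / 6)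
    (lo hi : B7Prop1Explicit.Site d) (hlohi : lo ≤ hi)
    (h124 : pdevOn (tlo L lo j) (thi L hi j) U₀ < (1 - β * (1 / 2)) * εj * (((L : ℝ) ^ j)⁻¹) ^ 2)
    (h15 : ∀ n, n < j → ∀ z, tlo L lo n ≤ z → z ≤ thi L hi n → ∀ r : Fin d → Fin L,
      axialFn (avgIter L U₀ (j - (n + 1))) ((L : ℤ) • z) ((L : ℤ) • z + boxVec L r) = 1)
    (hX : ∀ i, dep i ≤ j ∧ tlo L lo (dep i) ≤ pt i ∧ pt i + e (dir i) ≤ thi L hi (dep i))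
    (hfar : ∀ y' i, i ∈ boxB y' → Dd ≤ gB.dist y y')
    {Hf : B7Prop1Explicit.Site d → Fin d → 𝔸}
    (hHf : Hf = fun x => ev x (chartH179 𝒢 W D2 H₀ (fun Y : 𝒴 => Y - H (D Y)) ε₄
      (fun i => mlog (((avgIter L U₀ (j - dep i) (pt i) (dir i) *
          (pullIter L (avgIter L U₀ j) (dep i) (pt i) (dir i))⁻¹ : 𝔸ˣ) : 𝔸)))))
    (hsa : ∀ z κ, IsSelfAdjoint (Hf z κ))
    {g : B7Prop1Explicit.Site d → 𝔸ˣ} (hg : ∀ z, g z ∈ U1 𝔸) (μ ν : Fin d) (x : B7Prop1Explicit.Site d)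
    (hgeom : δ * 2 * M₂ * R ≤ τ * Dd) (hCB : const190 1 bN.κ b3.κ BG θW cΔ A₀ AH θD c * c ≤ B₃) (hB₃ : 0 ≤ B₃)
    (hr : 1 ≤ r) (hR : B14.IsRj L r gj R) (hgj : 0 < gj) (hgγ : gj ≤ γ) (hγe : 1 ≤ Real.log (γ ^ 2)⁻¹)
    (hc1 : 1 ≤ δ * 2 * M₂) (hγ : B₃ * (22 * (d : ℝ) ^ 2) * γ ^ 2 < β / 10)
    (hx : x ∈ box y) (hxμ : x + e μ ∈ box y) (hxν : x + e ν ∈ box y)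
    (hS₁ : (x, μ, ν) ∈ S y) (hS₂ : (x, ν, μ) ∈ S y)
    (hβ0 : 0 < β) (hβ1 : β ≤ 1) (hε1 : εj ≤ 1) (hεξ : εj * ((L : ℝ) ^ j)⁻¹ ≤ ((L : ℝ) ^ 2)⁻¹)
    (hp : PlaqIn (tlo L lo j) (thi L hi j) (x, μ, ν)) :
    ‖B8Ineq132.plaqF (gaugeAct g (B8Lemma1NonAbelian.mulCfg (B8Eq146AExpansion.expCfg
        (B8Eq146AExpansion.iEta (((L : ℝ) ^ j)⁻¹) Hf)) U₀)) μ ν x - 1‖ < εj * (((L : ℝ) ^ j)⁻¹) ^ 2 := by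
  have hrow8 : RowSum gB (δ₀ / 8) c := hrow.mono hd (by linarith)
  obtain ⟨hK, h190₀, hmv₀⟩ := pair_sup_sectG Reg hWa H hTm hTm0 hB boxB blkB hcover box blk ev hev hN htri hd hδ₀ hrow8 hc hBG
    hθW hcΔ hA₀ hAH hθD hG hD2H0 hH0 hH h189 hDfr hq y
  obtain ⟨h190₁, hmv₁⟩ := pair_cov_sectG Reg hWa H hTm hTm0 hB boxB blkB hcover y₀ S ev hev₁ hN htri hd hδ₀ hrow8 hc hBG hθW
    hcΔ hA₀ hAH hθD hG hD2H0 hH0 hH h189 hDfr hq y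
  subst hHf
  exact ineq131_lt_of_ineq190_layer_scale boxB blkB dep pt dir box blk y₀ S h190₀ h190₁ hK hd hrow hτ hστ y hL hd1 hAG hU₀ hε
    hε3 hε2 hεs lo hi hlohi h124 h15 hX hfar hsa hg μ ν x hmv₀ hmv₁ hgeom hCB hB₃ hr hR hgj hgγ hγe hc1 hγ hx hxμ hxν hS₁ hS₂
    hβ0 hβ1 hε1 hεξ hp

end Eq131

/-! ## §2 (1.42): the tower field of `ℍ_{j+1,□′}`, sup output size -/

section Eq142

variable {X : Type} [Fintype X]
variable {𝒴 𝒵 : Type} [NormedAddCommGroup 𝒴] [NormedSpace ℂ 𝒴] [NormedAddCommGroup 𝒵] [NormedSpace ℂ 𝒵]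
  [CompleteSpace 𝒴] [CompleteSpace 𝒵] {gB : B6.Geometry}
variable {𝔸 : Type} [NormedRing 𝔸] [NormedAlgebra ℂ 𝔸] [CompleteSpace 𝔸] [NormOneClass 𝔸]
  {𝒢 : 𝒵 →L[ℂ] 𝒴} {W : 𝒴 → 𝒵} {D2 : 𝒴 →L[ℂ] 𝒵} {H₀ : (X → 𝔸) →L[ℂ] 𝒴} {B₀ θ C₄ a₃ 𝔧 𝔞 ε₄ : ℝ}

/-- **(1.42) «≦ ½δ_j» ON THE LATTICE MODEL, END TO END FROM THE LOCATED LEAVES OF [15] SECT. G, ALL SIZES CONCRETE** — r12's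
`B15From190LayerSizes.ineq142_le_half_of_ineq190_layer` (argument field `B :=` the (1.30)-type tower field of `ℍ_{j+1,□′}`, `j + 1`
levels, on the finite bond set `X`; input size `supSize gB boxB blkB`, B-size `22d²ε_{j+1}` and localisation discharged there; output
size `supSize gB box blk` — *"bounded on □′^{∼2}"*) for the presented chart `ℍ = x ↦ ev x (𝓗(B))`, with `h190`, `hmv` SUPPLIED by
r08's `B11Ineq190Actual.ineq190_and_hmv_supSize_sectG` on the `B`-space `X → 𝔸` (`hBloc` by `i ∈ boxB (blkB i)`).  Remaining:
r08's located leaves of Sect. G, the presentation letters, the knit's side conditions verbatim (`δLM₂R_{j+1} ≤ τD`, (1.24) at `j + 1`,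
`h15`, `hX`/`hfar`/`hbox`, the flow/γ-clauses).
[cite: Balaban1989LargeFieldI, (1.40)–(1.42) p.185; Balaban1985Variational, Prop. 9 (190) pp.308–309, (179)–(180) p.306] -/
theorem ineq142_le_half_layer_sectG (Reg : Regime 𝒢 0 W B₀ θ C₄ a₃ 𝔧 𝔞 ε₄) (hWa : AnalyticOnNhd ℂ W {Y : 𝒴 | ‖Y‖ < a₃})
    {D : 𝒴 → X → 𝔸} (H : (X → 𝔸) →L[ℂ] 𝒴) (hTm : AnalyticOnNhd ℂ (fun Y : 𝒴 => Y - H (D Y)) {Y : 𝒴 | ‖Y‖ < ε₄ + 𝔞})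
    (hTm0 : (0 : 𝒴) - H (D 0) = 0)
    (dep : X → ℕ) (pt : X → B7Prop1Explicit.Site d) (dir : X → Fin d)
    {L : ℕ} (hL : 2 ≤ L) (hd1 : 1 ≤ d) {G : Subgroup 𝔸ˣ} (hAG : AvgClosed d L G) {j : ℕ}
    {U₀ : B7Prop1Explicit.Site d → Fin d → 𝔸ˣ} (hU₀ : ∀ x κ, U₀ x κ ∈ G)
    (hB : ‖H₀ (fun i => mlog (((avgIter L U₀ (j + 1 - dep i) (pt i) (dir i) *
          (pullIter L (avgIter L U₀ (j + 1)) (dep i) (pt i) (dir i))⁻¹ : 𝔸ˣ) : 𝔸)))‖ < 𝔞 ∧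
      ‖D2 (H₀ (fun i => mlog (((avgIter L U₀ (j + 1 - dep i) (pt i) (dir i) *
          (pullIter L (avgIter L U₀ (j + 1)) (dep i) (pt i) (dir i))⁻¹ : 𝔸ˣ) : 𝔸))))‖ < 𝔧)
    (boxB : gB.Site → Finset X) (blkB : X → gB.Site) (hcover : ∀ i, i ∈ boxB (blkB i))
    (box : gB.Site → Finset (B7Prop1Explicit.Site d)) (blk : B7Prop1Explicit.Site d → gB.Site)
    (ev : B7Prop1Explicit.Site d → (𝒴 →L[ℝ] (Fin d → 𝔸)))
    {bN : BlockNorm gB 𝒴} {b3 : BlockNorm gB 𝒵}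
    (hev : ∀ (y : gB.Site) (v : 𝒴), ∀ x ∈ box y, ‖ev x v‖ ≤ bN.loc y v)
    (hN : ∀ (y : gB.Site) (v : 𝒴), bN.loc y v ≤ ‖v‖)
    {δ₀ BG θW cΔ A₀ AH θD c : ℝ}
    (htri : Triangle254 gB) (hd : ∀ a b : gB.Site, 0 ≤ gB.dist a b) (hδ₀ : 0 ≤ δ₀)
    (hc : 0 ≤ c) (hBG : 0 ≤ BG) (hθW : 0 ≤ θW) (hcΔ : 0 ≤ cΔ) (hA₀ : 0 ≤ A₀) (hAH : 0 ≤ AH) (hθD : 0 ≤ θD)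
    (hG : HasMaj b3 bN (𝒢.restrictScalars ℝ : 𝒵 →ₗ[ℝ] 𝒴) (fun y y' => BG * Real.exp (-(δ₀ * gB.dist y y'))))
    (hD2H0 : HasMaj (supSize (X := X) (E := 𝔸) gB boxB blkB) b3 ((D2 ∘L H₀).restrictScalars ℝ : (X → 𝔸) →ₗ[ℝ] 𝒵)
      (fun y y' => cΔ * Real.exp (-(δ₀ * gB.dist y y'))))
    (hH0 : HasMaj (supSize (X := X) (E := 𝔸) gB boxB blkB) bN (H₀.restrictScalars ℝ : (X → 𝔸) →ₗ[ℝ] 𝒴)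
      (fun y y' => A₀ * Real.exp (-(δ₀ * gB.dist y y'))))
    (hH : HasMaj (supSize (X := X) (E := 𝔸) gB boxB blkB) bN (H.restrictScalars ℝ : (X → 𝔸) →ₗ[ℝ] 𝒴)
      (fun y y' => AH * Real.exp (-(δ₀ / 2 * gB.dist y y'))))
    (h189 : ∀ B' : X → 𝔸, ‖H₀ B'‖ < 𝔞 → ‖D2 (H₀ B')‖ < 𝔧 →
      Ineq189 bN b3 ((fderiv ℂ W (solA180 𝒢 W D2 H₀ ε₄ B' + H₀ B')).restrictScalars ℝ : 𝒴 →ₗ[ℝ] 𝒵) θW δ₀)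
    (hDfr : ∀ B' : X → 𝔸, ‖H₀ B'‖ < 𝔞 → ‖D2 (H₀ B')‖ < 𝔧 →
      ∃ 𝔇 : 𝒴 →L[ℂ] (X → 𝔸), HasFDerivAt D 𝔇 (solA180 𝒢 W D2 H₀ ε₄ B' + H₀ B') ∧
        HasMaj bN (supSize (X := X) (E := 𝔸) gB boxB blkB) (𝔇.restrictScalars ℝ : 𝒴 →ₗ[ℝ] (X → 𝔸))
          (fun y y' => θD * Real.exp (-(δ₀ / 2 * gB.dist y y'))))
    (hq : qG b3.κ bN.κ BG θW c < 1)
    -- the [IV] side: the letters of `B15From190LayerSizes.ineq142_le_half_of_ineq190_layer` minus `h190`, `hmv`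
    {σ τ Dd : ℝ} (hrow : RowSum gB σ c) (hτ : 0 ≤ τ) (hστ : σ + τ ≤ δ₀ / 8) (y : gB.Site)
    {B₃ δ M₂ β₀ A₀' A₁ εj εj1 δj γ gj1 β : ℝ} {R r : ℕ}
    (hβ : 0 ≤ β) (hε' : 0 < εj1) (hε3 : C0 d * εj1 ≤ 1 / 3) (hε2 : 2 * εj1 ≤ c2' d L)
    (hεs : 11 * (d : ℝ) ^ 2 * εj1 ≤ 1 / 6) (lo hi : B7Prop1Explicit.Site d) (hlohi : lo ≤ hi)
    (h124 : pdevOn (tlo L lo (j + 1)) (thi L hi (j + 1)) U₀ < (1 - β * (1 / 2)) * εj1 * (((L : ℝ) ^ (j + 1))⁻¹) ^ 2)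
    (h15 : ∀ n, n < j + 1 → ∀ z, tlo L lo n ≤ z → z ≤ thi L hi n → ∀ r : Fin d → Fin L,
      axialFn (avgIter L U₀ (j + 1 - (n + 1))) ((L : ℤ) • z) ((L : ℤ) • z + boxVec L r) = 1)
    (hX : ∀ i, dep i ≤ j + 1 ∧ tlo L lo (dep i) ≤ pt i ∧ pt i + e (dir i) ≤ thi L hi (dep i))
    (hfar : ∀ y' i, i ∈ boxB y' → Dd ≤ gB.dist y y')
    {Hf : B7Prop1Explicit.Site d → Fin d → 𝔸}
    (hHf : Hf = fun x => ev x (chartH179 𝒢 W D2 H₀ (fun Y : 𝒴 => Y - H (D Y)) ε₄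
      (fun i => mlog (((avgIter L U₀ (j + 1 - dep i) (pt i) (dir i) *
          (pullIter L (avgIter L U₀ (j + 1)) (dep i) (pt i) (dir i))⁻¹ : 𝔸ˣ) : 𝔸)))))
    {α₀ : ℝ} (hα : 0 < α₀) (hα3 : C0 d * α₀ ≤ 1 / 3) (hα4 : 4 * α₀ ≤ c2' d L)
    (h52 : pdev U₀ < α₀ * (((L : ℝ) ^ j)⁻¹) ^ 2) (q : B7Prop1Explicit.Site d) (κ : Fin d)
    (hgeom : δ * L * M₂ * R ≤ τ * Dd) (hCB : const190 1 bN.κ b3.κ BG θW cΔ A₀ AH θD c * c ≤ B₃) (hB₃ : 0 ≤ B₃)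
    (hbox : ∀ y', B7Prop1Local.InBox (B7Prop1Local.loK L j q) (B7Prop1Local.bondHiK L j q κ) y' → y' ∈ box y)
    (hflow : εj1 ≤ (1 + β₀) * εj) (hεδ : εj = A₀' / A₁ * δj) (hL1 : 1 ≤ L)
    (hr : 1 ≤ r) (hR : B14.IsRj L r gj1 R) (hgr : 0 < gj1) (hgγ : gj1 ≤ γ) (hγe : 1 ≤ Real.log (γ ^ 2)⁻¹)
    (hc1 : 1 ≤ δ * L * M₂) (hβ₀ : 0 ≤ 1 + β₀) (hA : 0 ≤ A₀' / A₁) (hδj : 0 ≤ δj)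
    (hγ : (68 * ((d : ℝ) + 1) + 160 * d) * B₃ * (22 * d ^ 2) * (1 + β₀) * (A₀' / A₁) * γ ^ 2 ≤ 1 / 2)
    (hεj1 : εj ≤ 1)
    (hsmγ : 2048 * (d : ℝ) * (B₃ * (22 * (d : ℝ) ^ 2) * (1 + β₀) * γ ^ 2) ≤ 1)
    (hc₃γ : 2 * (B₃ * (22 * (d : ℝ) ^ 2) * (1 + β₀) * γ ^ 2) ≤ c3 d L)
    (hsmallγ : Real.exp (4 * (800 * ((d : ℝ) + 1) ^ 2 * ((d : ℝ) + 4)) * α₀)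
      * (1 + 8 * (131072 * ((d : ℝ) + 1) ^ 2) * (B₃ * (22 * (d : ℝ) ^ 2) * (1 + β₀) * γ ^ 2)) ≤ 2) :
    ‖((avgIter L
          (gaugeAct (B7Eq84Concrete.glev L hL1 U₀
              (expCfg (fun y μ => ((Complex.I : ℂ) * ((((L : ℝ) ^ (j + 1))⁻¹ : ℝ) : ℂ)) • Hf y μ)) j 0)⁻¹
            (expCfg (fun y μ => ((Complex.I : ℂ) * ((((L : ℝ) ^ (j + 1))⁻¹ : ℝ) : ℂ)) • Hf y μ) * U₀)) j q κ : 𝔸ˣ) : 𝔸)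
        * (((avgIter L U₀ j q κ)⁻¹ : 𝔸ˣ) : 𝔸) - 1‖ ≤ δj / 2 := by
  have hrow8 : RowSum gB (δ₀ / 8) c := hrow.mono hd (by linarith)
  obtain ⟨hK, h190, hmv⟩ := pair_sup_sectG Reg hWa H hTm hTm0 hB boxB blkB hcover box blk ev hev hN htri hd hδ₀ hrow8 hc hBG
    hθW hcΔ hA₀ hAH hθD hG hD2H0 hH0 hH h189 hDfr hq y
  subst hHf
  exact ineq142_le_half_of_ineq190_layer boxB blkB dep pt dir box blk h190 hK hd hrow hτ hστ y hL hd1 hAG hU₀ hβ hε' hε3 hε2 hεs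
    lo hi hlohi h124 h15 hX hfar hmv hα hα3 hα4 h52 q κ hgeom hCB hB₃ hbox hflow hεδ hL1 hr hR hgr hgγ hγe hc1 hβ₀ hA hδj hγ
    hεj1 hsmγ hc₃γ hsmallγ

end Eq142

/-! ## §3 (1.37)–(1.39): print's two regions / three pieces of the (1.34) argument field on one index set, sup output size -/

section Eq139

variable {X : Type} [Fintype X]
variable {𝒴 𝒵 : Type} [NormedAddCommGroup 𝒴] [NormedSpace ℂ 𝒴] [NormedAddCommGroup 𝒵] [NormedSpace ℂ 𝒵]
  [CompleteSpace 𝒴] [CompleteSpace 𝒵] {gB : B6.Geometry}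
variable {𝔸 : Type} [NormedRing 𝔸] [NormedAlgebra ℂ 𝔸] [CompleteSpace 𝔸] [NormOneClass 𝔸]
  {𝒢 : 𝒵 →L[ℂ] 𝒴} {W : 𝒴 → 𝒵} {D2 : 𝒴 →L[ℂ] 𝒵} {H₀ : (X → 𝔸) →L[ℂ] 𝒴} {B₀ θ C₄ a₃ 𝔧 𝔞 ε₄ : ℝ}

/-- **p. 185 «lhs of (1.37) ≤ ½δ_j» ON THE LATTICE MODEL, END TO END FROM THE LOCATED LEAVES OF [15] SECT. G, ALL SIZES CONCRETE**
— r12's `B15From190LayerSizes.ineq139_half_of_ineq190_layer` (the (1.34) argument field on ONE finite bond index set `X` carrying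
print's two regions, tag `rg`: `rg i = true` = the `Ω_{j+1}∩Z_{j+1}` tower of `j + 1` levels, *"equal to 0 … bounded by 22d²ε_{j+1}"*;
`rg i = false` = the `Ω^c_{j+1}∩Z^c_j` tower of `j` levels with top field `V = V_j`, *"equal to (1/i)log[V_j(V_Z^{(j)})⁻¹], hence …
4δ′_j … On the boundary layer … 22d²ε_j"*; the three B-sizes and two localisations discharged there; output size `supSize gB box blk`)
for the presented chart `ℍ = x ↦ ev x (𝓗(B))` at that field, with `h190`, `hmv` SUPPLIED by r08's
`B11Ineq190Actual.ineq190_and_hmv_supSize_sectG` on `X → 𝔸`.  Remaining: r08's located leaves of Sect. G, the presentation letters,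
the knit's side conditions verbatim ((1.24) on both finest cubes, (1.27) `h127`, `6δ′_j ≤ ε_j`, `hfar₂`/`hfar₃` = *"R_{j+1}M"* /
*"6LMR_{j+1}"*, the strict weight `const190·c < B₃`, the (1.38) profile letters and γ-clauses).
[cite: Balaban1989LargeFieldI, (1.34)–(1.39) pp.184–185, (1.27) p.183; Balaban1985Variational, Prop. 9 (190) pp.308–309, (179)–(180) p.306] -/
theorem ineq139_half_layer_sectG (Reg : Regime 𝒢 0 W B₀ θ C₄ a₃ 𝔧 𝔞 ε₄) (hWa : AnalyticOnNhd ℂ W {Y : 𝒴 | ‖Y‖ < a₃})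
    {D : 𝒴 → X → 𝔸} (H : (X → 𝔸) →L[ℂ] 𝒴) (hTm : AnalyticOnNhd ℂ (fun Y : 𝒴 => Y - H (D Y)) {Y : 𝒴 | ‖Y‖ < ε₄ + 𝔞})
    (hTm0 : (0 : 𝒴) - H (D 0) = 0)
    -- the two towers (region tag `rg`), fine field `U₀` shared, top field `V` of the second region; the field in the domain of (180)
    (rg : X → Bool) (dep : X → ℕ) (pt : X → B7Prop1Explicit.Site d) (dir : X → Fin d)
    {L : ℕ} (hL : 2 ≤ L) (hd1 : 1 ≤ d) {G : Subgroup 𝔸ˣ} (hAG : AvgClosed d L G) {j : ℕ}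
    {U₀ : B7Prop1Explicit.Site d → Fin d → 𝔸ˣ} (hU₀ : ∀ x κ, U₀ x κ ∈ G) (V : B7Prop1Explicit.Site d → Fin d → 𝔸ˣ)
    (hB : ‖H₀ (fun i => if rg i then
            mlog (((avgIter L U₀ (j + 1 - dep i) (pt i) (dir i) *
              (pullIter L (avgIter L U₀ (j + 1)) (dep i) (pt i) (dir i))⁻¹ : 𝔸ˣ) : 𝔸))
          else
            mlog (((pullIter L V (dep i) (pt i) (dir i) *
              (avgIter L U₀ (j - dep i) (pt i) (dir i))⁻¹ : 𝔸ˣ) : 𝔸)))‖ < 𝔞 ∧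
      ‖D2 (H₀ (fun i => if rg i then
            mlog (((avgIter L U₀ (j + 1 - dep i) (pt i) (dir i) *
              (pullIter L (avgIter L U₀ (j + 1)) (dep i) (pt i) (dir i))⁻¹ : 𝔸ˣ) : 𝔸))
          else
            mlog (((pullIter L V (dep i) (pt i) (dir i) *
              (avgIter L U₀ (j - dep i) (pt i) (dir i))⁻¹ : 𝔸ˣ) : 𝔸))))‖ < 𝔧)
    (boxB : gB.Site → Finset X) (blkB : X → gB.Site) (hcover : ∀ i, i ∈ boxB (blkB i))
    (box : gB.Site → Finset (B7Prop1Explicit.Site d)) (blk : B7Prop1Explicit.Site d → gB.Site)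
    (ev : B7Prop1Explicit.Site d → (𝒴 →L[ℝ] (Fin d → 𝔸)))
    {bN : BlockNorm gB 𝒴} {b3 : BlockNorm gB 𝒵}
    (hev : ∀ (y : gB.Site) (v : 𝒴), ∀ x ∈ box y, ‖ev x v‖ ≤ bN.loc y v)
    (hN : ∀ (y : gB.Site) (v : 𝒴), bN.loc y v ≤ ‖v‖)
    {δ₀ BG θW cΔ A₀ AH θD c : ℝ}
    (htri : Triangle254 gB) (hd : ∀ a b : gB.Site, 0 ≤ gB.dist a b) (hδ₀ : 0 ≤ δ₀)
    (hc : 0 ≤ c) (hBG : 0 ≤ BG) (hθW : 0 ≤ θW) (hcΔ : 0 ≤ cΔ) (hA₀ : 0 ≤ A₀) (hAH : 0 ≤ AH) (hθD : 0 ≤ θD)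
    (hG : HasMaj b3 bN (𝒢.restrictScalars ℝ : 𝒵 →ₗ[ℝ] 𝒴) (fun y y' => BG * Real.exp (-(δ₀ * gB.dist y y'))))
    (hD2H0 : HasMaj (supSize (X := X) (E := 𝔸) gB boxB blkB) b3 ((D2 ∘L H₀).restrictScalars ℝ : (X → 𝔸) →ₗ[ℝ] 𝒵)
      (fun y y' => cΔ * Real.exp (-(δ₀ * gB.dist y y'))))
    (hH0 : HasMaj (supSize (X := X) (E := 𝔸) gB boxB blkB) bN (H₀.restrictScalars ℝ : (X → 𝔸) →ₗ[ℝ] 𝒴)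
      (fun y y' => A₀ * Real.exp (-(δ₀ * gB.dist y y'))))
    (hH : HasMaj (supSize (X := X) (E := 𝔸) gB boxB blkB) bN (H.restrictScalars ℝ : (X → 𝔸) →ₗ[ℝ] 𝒴)
      (fun y y' => AH * Real.exp (-(δ₀ / 2 * gB.dist y y'))))
    (h189 : ∀ B' : X → 𝔸, ‖H₀ B'‖ < 𝔞 → ‖D2 (H₀ B')‖ < 𝔧 →
      Ineq189 bN b3 ((fderiv ℂ W (solA180 𝒢 W D2 H₀ ε₄ B' + H₀ B')).restrictScalars ℝ : 𝒴 →ₗ[ℝ] 𝒵) θW δ₀)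
    (hDfr : ∀ B' : X → 𝔸, ‖H₀ B'‖ < 𝔞 → ‖D2 (H₀ B')‖ < 𝔧 →
      ∃ 𝔇 : 𝒴 →L[ℂ] (X → 𝔸), HasFDerivAt D 𝔇 (solA180 𝒢 W D2 H₀ ε₄ B' + H₀ B') ∧
        HasMaj bN (supSize (X := X) (E := 𝔸) gB boxB blkB) (𝔇.restrictScalars ℝ : 𝒴 →ₗ[ℝ] (X → 𝔸))
          (fun y y' => θD * Real.exp (-(δ₀ / 2 * gB.dist y y'))))
    (hq : qG b3.κ bN.κ BG θW c < 1)
    -- the [IV] side: the letters of `B15From190LayerSizes.ineq139_half_of_ineq190_layer` minus `h190`, `hmv`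
    {σ τ : ℝ} (hrow : RowSum gB σ c) (hτ : 0 ≤ τ) (hστ : σ + τ ≤ δ₀ / 8) (y : gB.Site)
    {B₃ δ'j M εj εj1 β₀ A₀' A₁ δj γ gj gj1 β : ℝ} {R r p₀ p₁ : ℕ}
    (hβ : 0 ≤ β) (hε1' : 0 < εj1) (hε3' : C0 d * εj1 ≤ 1 / 3) (hε2' : 2 * εj1 ≤ c2' d L)
    (hεs' : 11 * (d : ℝ) ^ 2 * εj1 ≤ 1 / 6) (lo₁ hi₁ : B7Prop1Explicit.Site d) (hlohi₁ : lo₁ ≤ hi₁)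
    (h124₁ : pdevOn (tlo L lo₁ (j + 1)) (thi L hi₁ (j + 1)) U₀ < (1 - β * (1 / 2)) * εj1 * (((L : ℝ) ^ (j + 1))⁻¹) ^ 2)
    (h15₁ : ∀ n, n < j + 1 → ∀ z, tlo L lo₁ n ≤ z → z ≤ thi L hi₁ n → ∀ r : Fin d → Fin L,
      axialFn (avgIter L U₀ (j + 1 - (n + 1))) ((L : ℤ) • z) ((L : ℤ) • z + boxVec L r) = 1)
    (hX₁ : ∀ i, rg i = true → dep i ≤ j + 1 ∧ tlo L lo₁ (dep i) ≤ pt i ∧ pt i + e (dir i) ≤ thi L hi₁ (dep i))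
    (hε : 0 < εj) (hε3 : C0 d * εj ≤ 1 / 3) (hε2 : 2 * εj ≤ c2' d L) (lo₂ hi₂ : B7Prop1Explicit.Site d) (hlohi₂ : lo₂ ≤ hi₂)
    (h124₂ : pdevOn (tlo L lo₂ j) (thi L hi₂ j) U₀ < εj * (((L : ℝ) ^ j)⁻¹) ^ 2)
    (hV : ∀ x μ, V x μ ∈ U1 𝔸) (hδ0 : 0 ≤ δ'j) (hδε : 6 * δ'j ≤ εj)
    (hs : 2 * δ'j + 11 * (d : ℝ) ^ 2 * εj ≤ 1 / 6) (hδ2 : 2 * δ'j ≤ 1 / 2)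
    (h15₂ : ∀ n, n < j → ∀ z, tlo L lo₂ n ≤ z → z ≤ thi L hi₂ n → ∀ r : Fin d → Fin L,
      axialFn (avgIter L U₀ (j - (n + 1))) ((L : ℤ) • z) ((L : ℤ) • z + boxVec L r) = 1)
    (h127 : ∀ x ν, lo₂ ≤ x → x + e ν ≤ hi₂ → ‖((V x ν * (avgIter L U₀ j x ν)⁻¹ : 𝔸ˣ) : 𝔸) - 1‖ < 2 * δ'j)
    (hX₂ : ∀ i, rg i = false → dep i ≤ j ∧ tlo L lo₂ (dep i) ≤ pt i ∧ pt i + e (dir i) ≤ thi L hi₂ (dep i))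
    (hfar₂ : ∀ y' i, i ∈ boxB y' → rg i = true → M * R ≤ gB.dist y y')
    (hfar₃ : ∀ y' i, i ∈ boxB y' → rg i = false → dep i ≠ 0 → 6 * (L : ℝ) * M * R ≤ gB.dist y y')
    {α₀ : ℝ} (hα : 0 < α₀) (hα3 : C0 d * α₀ ≤ 1 / 3) (hα4 : 4 * α₀ ≤ c2' d L)
    (h52 : pdev U₀ < α₀ * (((L : ℝ) ^ j)⁻¹) ^ 2)
    {Hf : B7Prop1Explicit.Site d → Fin d → 𝔸}
    (hHf : Hf = fun x => ev x (chartH179 𝒢 W D2 H₀ (fun Y : 𝒴 => Y - H (D Y)) ε₄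
      (fun i => if rg i then
            mlog (((avgIter L U₀ (j + 1 - dep i) (pt i) (dir i) *
              (pullIter L (avgIter L U₀ (j + 1)) (dep i) (pt i) (dir i))⁻¹ : 𝔸ˣ) : 𝔸))
          else
            mlog (((pullIter L V (dep i) (pt i) (dir i) *
              (avgIter L U₀ (j - dep i) (pt i) (dir i))⁻¹ : 𝔸ˣ) : 𝔸)))))
    (q : B7Prop1Explicit.Site d) (κ : Fin d)
    (hCB : const190 1 bN.κ b3.κ BG θW cΔ A₀ AH θD c * c < B₃) (hB₃ : 0 ≤ B₃)
    (hbox : ∀ y', B7Prop1Local.InBox (B7Prop1Local.loK L j q) (B7Prop1Local.bondHiK L j q κ) y' → y' ∈ box y)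
    (hL1 : 1 ≤ L)
    (hA₁0 : 0 ≤ A₁) (hp₀1 : 1 ≤ p₀) (hγ1 : γ ≤ 1)
    (hsmγ : 2048 * (d : ℝ) * (A₁ * (4 * (p₀ : ℝ)) ^ p₀ * Real.sqrt γ / (2 * (136 * ((d : ℝ) + 1) + 320 * d))) ≤ 1)
    (hc₃γ : 2 * (A₁ * (4 * (p₀ : ℝ)) ^ p₀ * Real.sqrt γ / (2 * (136 * ((d : ℝ) + 1) + 320 * d))) ≤ c3 d L)
    (hsmallγ : Real.exp (4 * (800 * ((d : ℝ) + 1) ^ 2 * ((d : ℝ) + 4)) * α₀)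
      * (1 + 8 * (131072 * ((d : ℝ) + 1) ^ 2)
        * (A₁ * (4 * (p₀ : ℝ)) ^ p₀ * Real.sqrt γ / (2 * (136 * ((d : ℝ) + 1) + 320 * d)))) ≤ 2)
    (hflow : εj1 ≤ (1 + 2 * β₀) * εj) (hA₁ : A₁ ≠ 0) (hp₀v : logPow p₀ gj ≠ 0)
    (hδ' : δ'j = gj * A₁ * logPow p₁ gj) (hεj : εj = gj * A₀' * logPow p₀ gj) (hδj : δj = gj * A₁ * logPow p₀ gj)
    (hr : 1 ≤ r) (hp : p₁ < p₀) (hgj : 0 < gj) (hgjγ : gj ≤ γ) (hR : B14.IsRj L r gj1 R) (hgj1 : 0 < gj1)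
    (hgj1γ : gj1 ≤ γ) (hγe : 1 ≤ Real.log (γ ^ 2)⁻¹) (hτM : 1 ≤ τ * M)
    (hK' : 0 ≤ 44 * (d : ℝ) ^ 2 * (1 + β₀) * (A₀' / A₁)) (hδj0 : 0 ≤ δj) (hδ'j : 0 < δ'j)
    (hγ : (136 * ((d : ℝ) + 1) + 320 * d) * B₃
      * (4 * (Real.log (γ ^ 2)⁻¹)⁻¹ + 44 * (d : ℝ) ^ 2 * (1 + β₀) * (A₀' / A₁) * γ ^ 2) ≤ 1 / 2) :
    ‖((avgIter L
          (gaugeAct (B7Eq84Concrete.glev L hL1 U₀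
              (expCfg (fun y μ => ((Complex.I : ℂ) * ((((L : ℝ) ^ j)⁻¹ : ℝ) : ℂ)) • Hf y μ)) j 0)⁻¹
            (expCfg (fun y μ => ((Complex.I : ℂ) * ((((L : ℝ) ^ j)⁻¹ : ℝ) : ℂ)) • Hf y μ) * U₀)) j q κ : 𝔸ˣ) : 𝔸)
        * (((avgIter L U₀ j q κ)⁻¹ : 𝔸ˣ) : 𝔸) - 1‖ ≤ δj / 2 := by
  have hrow8 : RowSum gB (δ₀ / 8) c := hrow.mono hd (by linarith)
  obtain ⟨hK, h190, hmv⟩ := pair_sup_sectG Reg hWa H hTm hTm0 hB boxB blkB hcover box blk ev hev hN htri hd hδ₀ hrow8 hc hBG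
    hθW hcΔ hA₀ hAH hθD hG hD2H0 hH0 hH h189 hDfr hq y
  subst hHf
  exact ineq139_half_of_ineq190_layer boxB blkB rg dep pt dir box blk h190 hK hd hrow hτ hστ y hL hd1 hAG hU₀ hβ hε1' hε3' hε2'
    hεs' lo₁ hi₁ hlohi₁ h124₁ h15₁ hX₁ hε hε3 hε2 lo₂ hi₂ hlohi₂ h124₂ V hV hδ0 hδε hs hδ2 h15₂ h127 hX₂ hfar₂ hfar₃ hα hα3 hα4
    h52 _ q κ hmv hCB hB₃ hbox hL1 hA₁0 hp₀1 hγ1 hsmγ hc₃γ hsmallγ hflow hA₁ hp₀v hδ' hεj hδj hr hp hgj hgjγ hR hgj1 hgj1γ hγe hτM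
    hK' hδj0 hδ'j hγ

end Eq139

/-! ## §4 (1.90) ⇒ (1.91): the (1.90) tower field (fine field `U₀`, resp. a free fine field `Wf`), sup and covariant-derivative
output sizes (two-sup reading) -/

section Eq191

variable {X : Type} [Fintype X]
variable {𝒴 𝒵 : Type} [NormedAddCommGroup 𝒴] [NormedSpace ℂ 𝒴] [NormedAddCommGroup 𝒵] [NormedSpace ℂ 𝒵]
  [CompleteSpace 𝒴] [CompleteSpace 𝒵] {gB : B6.Geometry}
variable {𝔸 : Type} [CStarAlgebra 𝔸] [Nontrivial 𝔸]
  {𝒢 : 𝒵 →L[ℂ] 𝒴} {W : 𝒴 → 𝒵} {D2 : 𝒴 →L[ℂ] 𝒵} {H₀ : (X → 𝔸) →L[ℂ] 𝒴} {B₀ θ C₄ a₃ 𝔧 𝔞 ε₄ : ℝ}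

/-- **(1.90) ⇒ (1.91) ON THE LATTICE, END TO END FROM THE LOCATED LEAVES OF [15] SECT. G, ALL SIZES CONCRETE, the tower's fine field
FREE (two-sup reading, `α ↦ 2α`)** — r12's `B15From190LayerSizes.ineq191_twoSup_of_ineq190_layerW` (argument field `B :=` the (1.90)
tower field `i ↦ log[M^{K−dep i}(Wf)(b_i)((Q^{s*}_{dep i}M^K(Wf))(b_i))⁻¹]` of a free lattice field `Wf` — print: `U″_{k,Z}`, the
REPRESENTED field of (1.90) — on the finite bond set `X`; input size `supSize gB boxB blkB`, B-size `11d²ε_h` (p29's located input `h190p`,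
GAPS G-B15-r12-09) and localisation discharged there; output sizes `supSize gB box blk` / `covDerivBlockSize gB y₀ S ξ U₀` at the
consumer's background `U₀ =` print's `U_{h,□}(V″)`) for the presented chart `ℍ = x ↦ ev x (𝓗(B))`, with `h190₀`/`hmv₀` (r08) and
`h190₁`/`hmv₁` (p29) SUPPLIED.  Remaining: r08's located leaves of Sect. G, the presentation letters `hev`/`hev₁`, the knit's side
conditions verbatim (`δ2LM₂R_h ≤ τD`, `h190p`, `h15`, `hX`/`hfar`, the γ-clause `11d²B₃γ² < α`, membership of the plaquette data).
[cite: Balaban1989LargeFieldI, (1.90)–(1.91) p.198; Balaban1985Variational, Prop. 9 (190) pp.308–309, (179)–(180) p.306, (115) p.294] -/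
theorem ineq191_twoSup_layerW_sectG (Reg : Regime 𝒢 0 W B₀ θ C₄ a₃ 𝔧 𝔞 ε₄) (hWa : AnalyticOnNhd ℂ W {Y : 𝒴 | ‖Y‖ < a₃})
    {D : 𝒴 → X → 𝔸} (H : (X → 𝔸) →L[ℂ] 𝒴) (hTm : AnalyticOnNhd ℂ (fun Y : 𝒴 => Y - H (D Y)) {Y : 𝒴 | ‖Y‖ < ε₄ + 𝔞})
    (hTm0 : (0 : 𝒴) - H (D 0) = 0)
    -- the (1.90) tower of the fine field `Wf` (print: `U″_{k,Z}`), `K` levels, and its field in the domain of (180)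
    (dep : X → ℕ) (pt : X → B7Prop1Explicit.Site d) (dir : X → Fin d)
    {L : ℕ} (hL : 2 ≤ L) (hd1 : 1 ≤ d) {G : Subgroup 𝔸ˣ} (hAG : AvgClosed d L G) {K : ℕ}
    (Wf : B7Prop1Explicit.Site d → Fin d → 𝔸ˣ) (hWf : ∀ x κ, Wf x κ ∈ G)
    (hB : ‖H₀ (fun i => mlog (((avgIter L Wf (K - dep i) (pt i) (dir i) *
          (pullIter L (avgIter L Wf K) (dep i) (pt i) (dir i))⁻¹ : 𝔸ˣ) : 𝔸)))‖ < 𝔞 ∧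
      ‖D2 (H₀ (fun i => mlog (((avgIter L Wf (K - dep i) (pt i) (dir i) *
          (pullIter L (avgIter L Wf K) (dep i) (pt i) (dir i))⁻¹ : 𝔸ˣ) : 𝔸))))‖ < 𝔧)
    -- sizes and presentation; the consumer's background `U₀` (print: `U_{h,□}(V″)`)
    (boxB : gB.Site → Finset X) (blkB : X → gB.Site) (hcover : ∀ i, i ∈ boxB (blkB i))
    (box : gB.Site → Finset (B7Prop1Explicit.Site d)) (blk : B7Prop1Explicit.Site d → gB.Site)
    (y₀ : gB.Site) (S : gB.Site → Finset (B7Prop1Explicit.Site d × Fin d × Fin d)) {ξ : ℝ}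
    {U₀ : B7Prop1Explicit.Site d → Fin d → 𝔸ˣ}
    (ev : B7Prop1Explicit.Site d → (𝒴 →L[ℝ] (Fin d → 𝔸)))
    {bN : BlockNorm gB 𝒴} {b3 : BlockNorm gB 𝒵}
    (hev : ∀ (y : gB.Site) (v : 𝒴), ∀ x ∈ box y, ‖ev x v‖ ≤ bN.loc y v)
    (hev₁ : ∀ (y : gB.Site) (v : 𝒴), (covDerivBlockSize gB y₀ S ξ U₀).loc y (fun x => ev x v) ≤ bN.loc y v)
    (hN : ∀ (y : gB.Site) (v : 𝒴), bN.loc y v ≤ ‖v‖)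
    {δ₀ BG θW cΔ A₀ AH θD c : ℝ}
    (htri : Triangle254 gB) (hd : ∀ a b : gB.Site, 0 ≤ gB.dist a b) (hδ₀ : 0 ≤ δ₀)
    (hc : 0 ≤ c) (hBG : 0 ≤ BG) (hθW : 0 ≤ θW) (hcΔ : 0 ≤ cΔ) (hA₀ : 0 ≤ A₀) (hAH : 0 ≤ AH) (hθD : 0 ≤ θD)
    (hG : HasMaj b3 bN (𝒢.restrictScalars ℝ : 𝒵 →ₗ[ℝ] 𝒴) (fun y y' => BG * Real.exp (-(δ₀ * gB.dist y y'))))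
    (hD2H0 : HasMaj (supSize (X := X) (E := 𝔸) gB boxB blkB) b3 ((D2 ∘L H₀).restrictScalars ℝ : (X → 𝔸) →ₗ[ℝ] 𝒵)
      (fun y y' => cΔ * Real.exp (-(δ₀ * gB.dist y y'))))
    (hH0 : HasMaj (supSize (X := X) (E := 𝔸) gB boxB blkB) bN (H₀.restrictScalars ℝ : (X → 𝔸) →ₗ[ℝ] 𝒴)
      (fun y y' => A₀ * Real.exp (-(δ₀ * gB.dist y y'))))
    (hH : HasMaj (supSize (X := X) (E := 𝔸) gB boxB blkB) bN (H.restrictScalars ℝ : (X → 𝔸) →ₗ[ℝ] 𝒴)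
      (fun y y' => AH * Real.exp (-(δ₀ / 2 * gB.dist y y'))))
    (h189 : ∀ B' : X → 𝔸, ‖H₀ B'‖ < 𝔞 → ‖D2 (H₀ B')‖ < 𝔧 →
      Ineq189 bN b3 ((fderiv ℂ W (solA180 𝒢 W D2 H₀ ε₄ B' + H₀ B')).restrictScalars ℝ : 𝒴 →ₗ[ℝ] 𝒵) θW δ₀)
    (hDfr : ∀ B' : X → 𝔸, ‖H₀ B'‖ < 𝔞 → ‖D2 (H₀ B')‖ < 𝔧 →
      ∃ 𝔇 : 𝒴 →L[ℂ] (X → 𝔸), HasFDerivAt D 𝔇 (solA180 𝒢 W D2 H₀ ε₄ B' + H₀ B') ∧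
        HasMaj bN (supSize (X := X) (E := 𝔸) gB boxB blkB) (𝔇.restrictScalars ℝ : 𝒴 →ₗ[ℝ] (X → 𝔸))
          (fun y y' => θD * Real.exp (-(δ₀ / 2 * gB.dist y y'))))
    (hq : qG b3.κ bN.κ BG θW c < 1)
    -- the [IV] side: the letters of `B15From190LayerSizes.ineq191_twoSup_of_ineq190_layerW` minus `h190₀,₁`, `hmv₀,₁`
    {σ τ Dd B₃ δ M₂ εh γ gh α : ℝ} {r R : ℕ}
    (hrow : RowSum gB σ c) (hτ : 0 ≤ τ) (hστ : σ + τ ≤ δ₀ / 8) (y : gB.Site) (hε : 0 < εh)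
    (hs3 : C0 d * (εh * (1 / 2)) ≤ 1 / 3) (hs2 : 2 * (εh * (1 / 2)) ≤ c2' d L)
    (hs : 11 * (d : ℝ) ^ 2 * (εh * (1 / 2)) ≤ 1 / 6) (lo hi : B7Prop1Explicit.Site d) (hlohi : lo ≤ hi)
    (h190p : pdevOn (tlo L lo K) (thi L hi K) Wf < εh * (1 / 2) * (((L : ℝ) ^ K)⁻¹) ^ 2)
    (h15 : ∀ n, n < K → ∀ z, tlo L lo n ≤ z → z ≤ thi L hi n → ∀ r : Fin d → Fin L,
      axialFn (avgIter L Wf (K - (n + 1))) ((L : ℤ) • z) ((L : ℤ) • z + boxVec L r) = 1)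
    (hX : ∀ i, dep i ≤ K ∧ tlo L lo (dep i) ≤ pt i ∧ pt i + e (dir i) ≤ thi L hi (dep i))
    (hfar : ∀ y' i, i ∈ boxB y' → Dd ≤ gB.dist y y')
    (hξ : 0 < ξ) (h₀ : ∀ z κ, U₀ z κ ∈ U1 𝔸) {Hf : B7Prop1Explicit.Site d → Fin d → 𝔸}
    (hHf : Hf = fun x => ev x (chartH179 𝒢 W D2 H₀ (fun Y : 𝒴 => Y - H (D Y)) ε₄
      (fun i => mlog (((avgIter L Wf (K - dep i) (pt i) (dir i) *
          (pullIter L (avgIter L Wf K) (dep i) (pt i) (dir i))⁻¹ : 𝔸ˣ) : 𝔸)))))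
    (hsa : ∀ z κ, IsSelfAdjoint (Hf z κ))
    {g : B7Prop1Explicit.Site d → 𝔸ˣ} (hg : ∀ z, g z ∈ U1 𝔸) (μ ν : Fin d) (x : B7Prop1Explicit.Site d) {Linv : ℝ}
    (hgeom : δ * 2 * L * M₂ * R ≤ τ * Dd) (hCB : const190 1 bN.κ b3.κ BG θW cΔ A₀ AH θD c * c ≤ B₃) (hB₃ : 0 < B₃)
    (hr : 1 ≤ r) (hR : B14.IsRj L r gh R) (hgh : 0 < gh) (hgγ : gh ≤ γ) (hγe : 1 ≤ Real.log (γ ^ 2)⁻¹)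
    (hc1 : 1 < δ * 2 * L * M₂) (hRh : 0 < (R : ℝ)) (hγ : 11 * (d : ℝ) ^ 2 * B₃ * γ ^ 2 < α)
    (hx : x ∈ box y) (hxμ : x + e μ ∈ box y) (hxν : x + e ν ∈ box y)
    (hS₁ : (x, μ, ν) ∈ S y) (hS₂ : (x, ν, μ) ∈ S y) (hLinv : 0 ≤ Linv) :
    B15.PrelimIntegrations.Ineq191 ‖B8Ineq132.plaqF (gaugeAct g (B8Lemma1NonAbelian.mulCfg (B8Eq146AExpansion.expCfg
        (B8Eq146AExpansion.iEta ξ Hf)) U₀)) μ ν x - 1‖ ‖B8Ineq132.plaqF U₀ μ ν x - 1‖ (2 * α) Linv εh (εh * ξ ^ 2) := by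
  have hrow8 : RowSum gB (δ₀ / 8) c := hrow.mono hd (by linarith)
  obtain ⟨hK, h190₀, hmv₀⟩ := pair_sup_sectG Reg hWa H hTm hTm0 hB boxB blkB hcover box blk ev hev hN htri hd hδ₀ hrow8 hc hBG
    hθW hcΔ hA₀ hAH hθD hG hD2H0 hH0 hH h189 hDfr hq y
  obtain ⟨h190₁, hmv₁⟩ := pair_cov_sectG Reg hWa H hTm hTm0 hB boxB blkB hcover y₀ S ev hev₁ hN htri hd hδ₀ hrow8 hc hBG hθW
    hcΔ hA₀ hAH hθD hG hD2H0 hH0 hH h189 hDfr hq y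
  subst hHf
  exact ineq191_twoSup_of_ineq190_layerW boxB blkB dep pt dir box blk y₀ S h190₀ h190₁ hK hd hrow hτ hστ y hL hd1 hAG Wf hWf hε
    hs3 hs2 hs lo hi hlohi h190p h15 hX hfar hξ h₀ hsa hg μ ν x hmv₀ hmv₁ hgeom hCB hB₃ hr hR hgh hgγ hγe hc1 hRh hγ hx hxμ hxν
    hS₁ hS₂ hLinv

/-- **(1.90) ⇒ (1.91), END TO END FROM [15] SECT. G, the special case `Wf = U₀`** of `ineq191_twoSup_layerW_sectG` (r12's
`B15From190LayerSizes.ineq191_twoSup_of_ineq190_layer`: the tower's fine field identified with the consumer's background; see the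
ERRATUM / READING NOTE in `B15From190LayerSizes` v1.2 §7, GAPS G-B15-r12-09). [cite: Balaban1989LargeFieldI, (1.90)–(1.91) p.198; Balaban1985Variational, Prop. 9 (190) pp.308–309, (179)–(180) p.306] -/
theorem ineq191_twoSup_layer_sectG (Reg : Regime 𝒢 0 W B₀ θ C₄ a₃ 𝔧 𝔞 ε₄) (hWa : AnalyticOnNhd ℂ W {Y : 𝒴 | ‖Y‖ < a₃})
    {D : 𝒴 → X → 𝔸} (H : (X → 𝔸) →L[ℂ] 𝒴) (hTm : AnalyticOnNhd ℂ (fun Y : 𝒴 => Y - H (D Y)) {Y : 𝒴 | ‖Y‖ < ε₄ + 𝔞})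
    (hTm0 : (0 : 𝒴) - H (D 0) = 0)
    (dep : X → ℕ) (pt : X → B7Prop1Explicit.Site d) (dir : X → Fin d)
    {L : ℕ} (hL : 2 ≤ L) (hd1 : 1 ≤ d) {G : Subgroup 𝔸ˣ} (hAG : AvgClosed d L G) {K : ℕ}
    {U₀ : B7Prop1Explicit.Site d → Fin d → 𝔸ˣ} (hU₀ : ∀ x κ, U₀ x κ ∈ G)
    (hB : ‖H₀ (fun i => mlog (((avgIter L U₀ (K - dep i) (pt i) (dir i) *
          (pullIter L (avgIter L U₀ K) (dep i) (pt i) (dir i))⁻¹ : 𝔸ˣ) : 𝔸)))‖ < 𝔞 ∧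
      ‖D2 (H₀ (fun i => mlog (((avgIter L U₀ (K - dep i) (pt i) (dir i) *
          (pullIter L (avgIter L U₀ K) (dep i) (pt i) (dir i))⁻¹ : 𝔸ˣ) : 𝔸))))‖ < 𝔧)
    (boxB : gB.Site → Finset X) (blkB : X → gB.Site) (hcover : ∀ i, i ∈ boxB (blkB i))
    (box : gB.Site → Finset (B7Prop1Explicit.Site d)) (blk : B7Prop1Explicit.Site d → gB.Site)
    (y₀ : gB.Site) (S : gB.Site → Finset (B7Prop1Explicit.Site d × Fin d × Fin d)) {ξ : ℝ}
    (ev : B7Prop1Explicit.Site d → (𝒴 →L[ℝ] (Fin d → 𝔸)))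
    {bN : BlockNorm gB 𝒴} {b3 : BlockNorm gB 𝒵}
    (hev : ∀ (y : gB.Site) (v : 𝒴), ∀ x ∈ box y, ‖ev x v‖ ≤ bN.loc y v)
    (hev₁ : ∀ (y : gB.Site) (v : 𝒴), (covDerivBlockSize gB y₀ S ξ U₀).loc y (fun x => ev x v) ≤ bN.loc y v)
    (hN : ∀ (y : gB.Site) (v : 𝒴), bN.loc y v ≤ ‖v‖)
    {δ₀ BG θW cΔ A₀ AH θD c : ℝ}
    (htri : Triangle254 gB) (hd : ∀ a b : gB.Site, 0 ≤ gB.dist a b) (hδ₀ : 0 ≤ δ₀)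
    (hc : 0 ≤ c) (hBG : 0 ≤ BG) (hθW : 0 ≤ θW) (hcΔ : 0 ≤ cΔ) (hA₀ : 0 ≤ A₀) (hAH : 0 ≤ AH) (hθD : 0 ≤ θD)
    (hG : HasMaj b3 bN (𝒢.restrictScalars ℝ : 𝒵 →ₗ[ℝ] 𝒴) (fun y y' => BG * Real.exp (-(δ₀ * gB.dist y y'))))
    (hD2H0 : HasMaj (supSize (X := X) (E := 𝔸) gB boxB blkB) b3 ((D2 ∘L H₀).restrictScalars ℝ : (X → 𝔸) →ₗ[ℝ] 𝒵)
      (fun y y' => cΔ * Real.exp (-(δ₀ * gB.dist y y'))))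
    (hH0 : HasMaj (supSize (X := X) (E := 𝔸) gB boxB blkB) bN (H₀.restrictScalars ℝ : (X → 𝔸) →ₗ[ℝ] 𝒴)
      (fun y y' => A₀ * Real.exp (-(δ₀ * gB.dist y y'))))
    (hH : HasMaj (supSize (X := X) (E := 𝔸) gB boxB blkB) bN (H.restrictScalars ℝ : (X → 𝔸) →ₗ[ℝ] 𝒴)
      (fun y y' => AH * Real.exp (-(δ₀ / 2 * gB.dist y y'))))
    (h189 : ∀ B' : X → 𝔸, ‖H₀ B'‖ < 𝔞 → ‖D2 (H₀ B')‖ < 𝔧 →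
      Ineq189 bN b3 ((fderiv ℂ W (solA180 𝒢 W D2 H₀ ε₄ B' + H₀ B')).restrictScalars ℝ : 𝒴 →ₗ[ℝ] 𝒵) θW δ₀)
    (hDfr : ∀ B' : X → 𝔸, ‖H₀ B'‖ < 𝔞 → ‖D2 (H₀ B')‖ < 𝔧 →
      ∃ 𝔇 : 𝒴 →L[ℂ] (X → 𝔸), HasFDerivAt D 𝔇 (solA180 𝒢 W D2 H₀ ε₄ B' + H₀ B') ∧
        HasMaj bN (supSize (X := X) (E := 𝔸) gB boxB blkB) (𝔇.restrictScalars ℝ : 𝒴 →ₗ[ℝ] (X → 𝔸))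
          (fun y y' => θD * Real.exp (-(δ₀ / 2 * gB.dist y y'))))
    (hq : qG b3.κ bN.κ BG θW c < 1)
    {σ τ Dd B₃ δ M₂ εh γ gh α : ℝ} {r R : ℕ}
    (hrow : RowSum gB σ c) (hτ : 0 ≤ τ) (hστ : σ + τ ≤ δ₀ / 8) (y : gB.Site) (hε : 0 < εh)
    (hs3 : C0 d * (εh * (1 / 2)) ≤ 1 / 3) (hs2 : 2 * (εh * (1 / 2)) ≤ c2' d L)
    (hs : 11 * (d : ℝ) ^ 2 * (εh * (1 / 2)) ≤ 1 / 6) (lo hi : B7Prop1Explicit.Site d) (hlohi : lo ≤ hi)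
    (h190p : pdevOn (tlo L lo K) (thi L hi K) U₀ < εh * (1 / 2) * (((L : ℝ) ^ K)⁻¹) ^ 2)
    (h15 : ∀ n, n < K → ∀ z, tlo L lo n ≤ z → z ≤ thi L hi n → ∀ r : Fin d → Fin L,
      axialFn (avgIter L U₀ (K - (n + 1))) ((L : ℤ) • z) ((L : ℤ) • z + boxVec L r) = 1)
    (hX : ∀ i, dep i ≤ K ∧ tlo L lo (dep i) ≤ pt i ∧ pt i + e (dir i) ≤ thi L hi (dep i))
    (hfar : ∀ y' i, i ∈ boxB y' → Dd ≤ gB.dist y y')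
    (hξ : 0 < ξ) {Hf : B7Prop1Explicit.Site d → Fin d → 𝔸}
    (hHf : Hf = fun x => ev x (chartH179 𝒢 W D2 H₀ (fun Y : 𝒴 => Y - H (D Y)) ε₄
      (fun i => mlog (((avgIter L U₀ (K - dep i) (pt i) (dir i) *
          (pullIter L (avgIter L U₀ K) (dep i) (pt i) (dir i))⁻¹ : 𝔸ˣ) : 𝔸)))))
    (hsa : ∀ z κ, IsSelfAdjoint (Hf z κ))
    {g : B7Prop1Explicit.Site d → 𝔸ˣ} (hg : ∀ z, g z ∈ U1 𝔸) (μ ν : Fin d) (x : B7Prop1Explicit.Site d) {Linv : ℝ}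
    (hgeom : δ * 2 * L * M₂ * R ≤ τ * Dd) (hCB : const190 1 bN.κ b3.κ BG θW cΔ A₀ AH θD c * c ≤ B₃) (hB₃ : 0 < B₃)
    (hr : 1 ≤ r) (hR : B14.IsRj L r gh R) (hgh : 0 < gh) (hgγ : gh ≤ γ) (hγe : 1 ≤ Real.log (γ ^ 2)⁻¹)
    (hc1 : 1 < δ * 2 * L * M₂) (hRh : 0 < (R : ℝ)) (hγ : 11 * (d : ℝ) ^ 2 * B₃ * γ ^ 2 < α)
    (hx : x ∈ box y) (hxμ : x + e μ ∈ box y) (hxν : x + e ν ∈ box y)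
    (hS₁ : (x, μ, ν) ∈ S y) (hS₂ : (x, ν, μ) ∈ S y) (hLinv : 0 ≤ Linv) :
    B15.PrelimIntegrations.Ineq191 ‖B8Ineq132.plaqF (gaugeAct g (B8Lemma1NonAbelian.mulCfg (B8Eq146AExpansion.expCfg
        (B8Eq146AExpansion.iEta ξ Hf)) U₀)) μ ν x - 1‖ ‖B8Ineq132.plaqF U₀ μ ν x - 1‖ (2 * α) Linv εh (εh * ξ ^ 2) :=
  ineq191_twoSup_layerW_sectG Reg hWa H hTm hTm0 dep pt dir hL hd1 hAG U₀ hU₀ hB boxB blkB hcover box blk y₀ S ev hev hev₁ hN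
    htri hd hδ₀ hc hBG hθW hcΔ hA₀ hAH hθD hG hD2H0 hH0 hH h189 hDfr hq hrow hτ hστ y hε hs3 hs2 hs lo hi hlohi h190p h15 hX hfar
    hξ (fun z κ => hAG.le_U1 (hU₀ z κ)) hHf hsa hg μ ν x hgeom hCB hB₃ hr hR hgh hgγ hγe hc1 hRh hγ hx hxμ hxν hS₁ hS₂ hLinv

end Eq191

/-! ## §5 (1.45)–(1.48): the (1.44) argument field, print's WEIGHTED output sizes through the weighted presentation `(L^iη) • ev` -/

section Weighted

variable {X : Type} [Fintype X]
variable {𝒴 𝒵 : Type} [NormedAddCommGroup 𝒴] [NormedSpace ℂ 𝒴] [NormedAddCommGroup 𝒵] [NormedSpace ℂ 𝒵]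
  [CompleteSpace 𝒴] [CompleteSpace 𝒵] {gB : B6.Geometry}
variable {𝔸 : Type} [CStarAlgebra 𝔸] [Nontrivial 𝔸]
  {𝒢 : 𝒵 →L[ℂ] 𝒴} {W : 𝒴 → 𝒵} {D2 : 𝒴 →L[ℂ] 𝒵} {H₀ : (X → 𝔸) →L[ℂ] 𝒴} {B₀ θ C₄ a₃ 𝔧 𝔞 ε₄ : ℝ}

/-- **(1.46) ⇒ (1.48) ON THE LATTICE MODEL, END TO END FROM THE LOCATED LEAVES OF [15] SECT. G, (1.47)'s distance input AND γ,
ALL SIZES CONCRETE** — r12's `B15From190LayerSizes.ineq148_of_ineq190_layer` (argument field `B :=` the (1.44) field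
`i ↦ log[V_j(b_i)(V_Z^{(j)}(b_i))⁻¹]` on the finite set `X` of top bonds of `Ω^c_{j+1}∖Z″_{j+1}`, input size `supSize gB boxB blkB`,
B-size `4δ′_j` from (1.27) and localisation discharged there; output sizes WITH PRINT'S WEIGHTS (1.45) *"sup_{B^i(y)} L^iη|ℍ|,
sup_{B^i(y)} (L^iη)²|∇^η ℍ|"*: `supSize gB box blk` and r11's `ofSeminorms gB y₀ (L^iη · covDerivSize (S ·) η U₀)` at the rescaled
function `(L^iη) • ℍ`) for the presented chart `ℍ = x ↦ ev x (𝓗(B))`, with its four located hypotheses SUPPLIED through the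
WEIGHTED presentation `x ↦ (L^iη) • ev x` (a real CLM): `h190₀`/`hmv₀` by r08's `B11Ineq190Actual.ineq190_and_hmv_supSize_sectG`,
`h190₁`/`hmv₁` by p29's `B11Ineq190ActualDeriv.ineq190_and_hmv_ofSeminorms_sectG`; the compatibility letters `hevw` / `hevw₁` say
that the WEIGHTED values / scaled first covariant derivatives of the presented function are dominated by the `𝒴`-size `bN` — the
entries `(L^jη)^{−1}`, `(L^jη)^{−2}` of (190)'s bracket read into print's weighted (115) norm.  Remaining: r08's located leaves of
Sect. G, the presentation letters, the knit's side conditions verbatim ((1.27) `h127`, `2δ′_j ≤ ½`, `hX`/`hfar`, the (1.47) distance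
input `hgeo` and `δ(M/M₁) ≥ 2` as `hM`, the flow/profile letters, the γ-clauses with `C = const190 1 …`).
[cite: Balaban1989LargeFieldI, (1.44)–(1.48) p.186, (1.27) p.183; Balaban1985Variational, Prop. 9 (190) pp.308–309, (179)–(180) p.306, (115) p.294] -/
theorem ineq148_layer_sectG (Reg : Regime 𝒢 0 W B₀ θ C₄ a₃ 𝔧 𝔞 ε₄) (hWa : AnalyticOnNhd ℂ W {Y : 𝒴 | ‖Y‖ < a₃})
    {D : 𝒴 → X → 𝔸} (H : (X → 𝔸) →L[ℂ] 𝒴) (hTm : AnalyticOnNhd ℂ (fun Y : 𝒴 => Y - H (D Y)) {Y : 𝒴 | ‖Y‖ < ε₄ + 𝔞})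
    (hTm0 : (0 : 𝒴) - H (D 0) = 0)
    -- the (1.44) field on the top bonds `b_i = ⟨pt i, pt i + e_{dir i}⟩` (`V = V_j`, `A = V_Z^{(j)}`), in the domain of (180)
    (pt : X → B7Prop1Explicit.Site d) (dir : X → Fin d) (A V : B7Prop1Explicit.Site d → Fin d → 𝔸ˣ)
    (hB : ‖H₀ (fun i => mlog (((V (pt i) (dir i) * (A (pt i) (dir i))⁻¹ : 𝔸ˣ) : 𝔸)))‖ < 𝔞 ∧
      ‖D2 (H₀ (fun i => mlog (((V (pt i) (dir i) * (A (pt i) (dir i))⁻¹ : 𝔸ˣ) : 𝔸))))‖ < 𝔧)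
    -- sizes, weight `L^iη = Lpow * η`, and the weighted presentation
    (boxB : gB.Site → Finset X) (blkB : X → gB.Site) (hcover : ∀ i, i ∈ boxB (blkB i))
    (box : gB.Site → Finset (B7Prop1Explicit.Site d)) (blk : B7Prop1Explicit.Site d → gB.Site)
    (y₀ : gB.Site) (S : gB.Site → Finset (B7Prop1Explicit.Site d × Fin d × Fin d))
    {η Lpow : ℝ} {U₀ : B7Prop1Explicit.Site d → Fin d → 𝔸ˣ}
    (ev : B7Prop1Explicit.Site d → (𝒴 →L[ℝ] (Fin d → 𝔸)))
    {bN : BlockNorm gB 𝒴} {b3 : BlockNorm gB 𝒵}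
    (hevw : ∀ (y : gB.Site) (v : 𝒴), ∀ x ∈ box y, ‖((Lpow * η) • ev x) v‖ ≤ bN.loc y v)
    (hevw₁ : ∀ (y : gB.Site) (v : 𝒴),
      (ofSeminorms gB y₀ (fun y => (Lpow * η).toNNReal • covDerivSize (S y) η U₀)).loc y (fun x => ((Lpow * η) • ev x) v)
        ≤ bN.loc y v)
    (hN : ∀ (y : gB.Site) (v : 𝒴), bN.loc y v ≤ ‖v‖)
    {δ₀ BG θW cΔ A₀ AH θD c : ℝ}
    (htri : Triangle254 gB) (hd : ∀ a b : gB.Site, 0 ≤ gB.dist a b) (hδ₀ : 0 ≤ δ₀)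
    (hc : 0 ≤ c) (hBG : 0 ≤ BG) (hθW : 0 ≤ θW) (hcΔ : 0 ≤ cΔ) (hA₀ : 0 ≤ A₀) (hAH : 0 ≤ AH) (hθD : 0 ≤ θD)
    (hG : HasMaj b3 bN (𝒢.restrictScalars ℝ : 𝒵 →ₗ[ℝ] 𝒴) (fun y y' => BG * Real.exp (-(δ₀ * gB.dist y y'))))
    (hD2H0 : HasMaj (supSize (X := X) (E := 𝔸) gB boxB blkB) b3 ((D2 ∘L H₀).restrictScalars ℝ : (X → 𝔸) →ₗ[ℝ] 𝒵)
      (fun y y' => cΔ * Real.exp (-(δ₀ * gB.dist y y'))))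
    (hH0 : HasMaj (supSize (X := X) (E := 𝔸) gB boxB blkB) bN (H₀.restrictScalars ℝ : (X → 𝔸) →ₗ[ℝ] 𝒴)
      (fun y y' => A₀ * Real.exp (-(δ₀ * gB.dist y y'))))
    (hH : HasMaj (supSize (X := X) (E := 𝔸) gB boxB blkB) bN (H.restrictScalars ℝ : (X → 𝔸) →ₗ[ℝ] 𝒴)
      (fun y y' => AH * Real.exp (-(δ₀ / 2 * gB.dist y y'))))
    (h189 : ∀ B' : X → 𝔸, ‖H₀ B'‖ < 𝔞 → ‖D2 (H₀ B')‖ < 𝔧 →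
      Ineq189 bN b3 ((fderiv ℂ W (solA180 𝒢 W D2 H₀ ε₄ B' + H₀ B')).restrictScalars ℝ : 𝒴 →ₗ[ℝ] 𝒵) θW δ₀)
    (hDfr : ∀ B' : X → 𝔸, ‖H₀ B'‖ < 𝔞 → ‖D2 (H₀ B')‖ < 𝔧 →
      ∃ 𝔇 : 𝒴 →L[ℂ] (X → 𝔸), HasFDerivAt D 𝔇 (solA180 𝒢 W D2 H₀ ε₄ B' + H₀ B') ∧
        HasMaj bN (supSize (X := X) (E := 𝔸) gB boxB blkB) (𝔇.restrictScalars ℝ : 𝒴 →ₗ[ℝ] (X → 𝔸))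
          (fun y y' => θD * Real.exp (-(δ₀ / 2 * gB.dist y y'))))
    (hq : qG b3.κ bN.κ BG θW c < 1)
    -- the [IV] side: the letters of `B15From190LayerSizes.ineq148_of_ineq190_layer` minus `h190₀,₁`, `hmv₀,₁` (and `hC`, `hc`)
    {σ τ δ'j dist : ℝ} (hrow : RowSum gB σ c) (hτ : 0 ≤ τ) (hστ : σ + τ ≤ δ₀ / 8) (y : gB.Site)
    (hδ'j : 0 ≤ δ'j) (hδ2 : 2 * δ'j ≤ 1 / 2) (lo hi : B7Prop1Explicit.Site d)
    (h127 : ∀ x ν, lo ≤ x → x + e ν ≤ hi → ‖((V x ν * (A x ν)⁻¹ : 𝔸ˣ) : 𝔸) - 1‖ < 2 * δ'j)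
    (hX : ∀ i, lo ≤ pt i ∧ pt i + e (dir i) ≤ hi)
    (hfar : ∀ y' i, i ∈ boxB y' → dist ≤ gB.dist y y')
    (hη : 0 < η) (h₀ : ∀ z κ, U₀ z κ ∈ U1 𝔸)
    {Hf : B7Prop1Explicit.Site d → Fin d → 𝔸}
    (hHf : Hf = fun x => ev x (chartH179 𝒢 W D2 H₀ (fun Y : 𝒴 => Y - H (D Y)) ε₄
      (fun i => mlog (((V (pt i) (dir i) * (A (pt i) (dir i))⁻¹ : 𝔸ˣ) : 𝔸)))))
    (hsa : ∀ z κ, IsSelfAdjoint (Hf z κ))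
    {g : B7Prop1Explicit.Site d → 𝔸ˣ} (hg : ∀ z, g z ∈ U1 𝔸) (μ ν : Fin d) (x : B7Prop1Explicit.Site d)
    {β₀ εi εj Linv γ gj A₀' A₁ M M₁ α β : ℝ} {i j p₀ p₁ : ℕ}
    (hx : x ∈ box y) (hxμ : x + e μ ∈ box y) (hxν : x + e ν ∈ box y)
    (hS₁ : (x, μ, ν) ∈ S y) (hS₂ : (x, ν, μ) ∈ S y)
    (hL : Lpow * Linv = 1) (hLinv : 0 ≤ Linv) (hLinv1 : Linv ≤ 1)
    (hdist0 : 0 ≤ τ * dist)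
    (hsmallγ : 128 * (const190 1 bN.κ b3.κ BG θW cΔ A₀ AH θD c * c) * (A₁ * (4 * (p₁ : ℝ)) ^ p₁ * Real.sqrt γ) ≤ 1)
    (hflow : εj ≤ (1 + β₀) * (1 + ((j - i : ℕ) : ℝ) ^ (1 / 2 : ℝ)) * εi) (hεi : 0 ≤ εi)
    (hA₀' : 0 < A₀') (hA₁ : 0 ≤ A₁) (hβ₀ : 0 ≤ 1 + β₀)
    (hδ' : δ'j = gj * A₁ * logPow p₁ gj) (hεj : εj = gj * A₀' * logPow p₀ gj)
    (hgeo : i < j → M / M₁ * ((j - i : ℕ) : ℝ) ≤ dist) (hM : 2 ≤ τ * (M / M₁))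
    (hp : p₁ < p₀) (hgj : 0 < gj) (hgjγ : gj ≤ γ) (hγe : 1 ≤ Real.log (γ ^ 2)⁻¹)
    (hγ₁ : 9 * (const190 1 bN.κ b3.κ BG θW cΔ A₀ AH θD c * c) * (A₁ / A₀') * (Real.log (γ ^ 2)⁻¹)⁻¹ * (1 + β₀) ≤ α * β)
    (hδ'γ : δ'j ≤ A₁ * (4 * (p₁ : ℝ)) ^ p₁ * Real.sqrt γ)
    (hγ₂ : 8 * (const190 1 bN.κ b3.κ BG θW cΔ A₀ AH θD c * c) * (A₁ * (4 * (p₁ : ℝ)) ^ p₁ * Real.sqrt γ) ≤ α * β) :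
    B15.BasicStep.Ineq148 ‖B8Ineq132.plaqF (gaugeAct g (B8Lemma1NonAbelian.mulCfg (B8Eq146AExpansion.expCfg
        (B8Eq146AExpansion.iEta η Hf)) U₀)) μ ν x - 1‖ ‖B8Ineq132.plaqF U₀ μ ν x - 1‖
      α β ((1 / 2 : ℝ) ^ (j - i)) (εi * Linv ^ 2) := by
  have hrow8 : RowSum gB (δ₀ / 8) c := hrow.mono hd (by linarith)
  have hK : 0 ≤ const190 1 bN.κ b3.κ BG θW cΔ A₀ AH θD c :=
    const190_nonneg' zero_le_one bN.κ_nonneg b3.κ_nonneg hc hBG hθW hcΔ hA₀ hAH hθD hq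
  have hBloc : ∀ (y' : gB.Site) (m : X → 𝔸), (supSize (X := X) (E := 𝔸) gB boxB blkB).IsLoc y' m →
      ‖m‖ ≤ (supSize (X := X) (E := 𝔸) gB boxB blkB).loc y' m := fun y' m hm => norm_le_loc_supSize_of_isLoc hcover hm
  -- the weighted presentation `x ↦ (L^iη) • ev x`; the presented weighted function is `(L^iη) • ℍ`
  obtain ⟨h190₀, hmv₀⟩ := ineq190_and_hmv_supSize_sectG (box := box) (blk := blk) Reg hWa H hTm hTm0 hB
    (fun x => (Lpow * η) • ev x) hevw hN hBloc htri hd hδ₀ hrow8 hc hBG hθW hcΔ hA₀ hAH hθD hG hD2H0 hH0 hH h189 hDfr hq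
    (fun B' => (Lpow * η) • fun x => ev x (chartH179 𝒢 W D2 H₀ (fun Y : 𝒴 => Y - H (D Y)) ε₄ B'))
    (fun t => (LinearMap.pi fun x => (((Lpow * η) • ev x : 𝒴 →L[ℝ] (Fin d → 𝔸)) : 𝒴 →ₗ[ℝ] (Fin d → 𝔸))) ∘ₗ
      ((fderiv ℂ (chartH179 𝒢 W D2 H₀ (fun Y : 𝒴 => Y - H (D Y)) ε₄) ((t : ℝ) •
        (fun i => mlog (((V (pt i) (dir i) * (A (pt i) (dir i))⁻¹ : 𝔸ˣ) : 𝔸))))).restrictScalars ℝ : (X → 𝔸) →ₗ[ℝ] 𝒴))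
    (fun _ => rfl) (fun _ => rfl) y
  obtain ⟨h190₁, hmv₁⟩ := ineq190_and_hmv_ofSeminorms_sectG (y₀ := y₀) (S := S) (ξ := η) (U₀ := U₀) Reg hWa H hTm hTm0 hB
    (fun x => (Lpow * η) • ev x) (Lpow * η).toNNReal hevw₁ hN hBloc htri hd hδ₀ hrow8 hc hBG hθW hcΔ hA₀ hAH hθD hG hD2H0 hH0
    hH h189 hDfr hq
    (fun B' => (Lpow * η) • fun x => ev x (chartH179 𝒢 W D2 H₀ (fun Y : 𝒴 => Y - H (D Y)) ε₄ B'))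
    (fun t => (LinearMap.pi fun x => (((Lpow * η) • ev x : 𝒴 →L[ℝ] (Fin d → 𝔸)) : 𝒴 →ₗ[ℝ] (Fin d → 𝔸))) ∘ₗ
      ((fderiv ℂ (chartH179 𝒢 W D2 H₀ (fun Y : 𝒴 => Y - H (D Y)) ε₄) ((t : ℝ) •
        (fun i => mlog (((V (pt i) (dir i) * (A (pt i) (dir i))⁻¹ : 𝔸ˣ) : 𝔸))))).restrictScalars ℝ : (X → 𝔸) →ₗ[ℝ] 𝒴))
    (fun _ => rfl) (fun _ => rfl) y
  subst hHf
  rw [supSize_κ] at h190₀ h190₁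
  exact ineq148_of_ineq190_layer boxB blkB pt dir box blk y₀ S h190₀ h190₁ hK hd hrow hτ hστ y A V hδ'j hδ2 lo hi h127 hX hfar hη
    h₀ hsa hg μ ν x hmv₀ hmv₁ hx hxμ hxν hS₁ hS₂ hL hLinv hLinv1 hc hdist0 hsmallγ hflow hεi hA₀' hA₁ hβ₀ hδ' hεj hgeo hM hp hgj
    hgjγ hγe hγ₁ hδ'γ hγ₂

end Weighted

/-! ## §6 (1.56)–(1.58) ⇒ the second expression of (1.54): the (1.56) tower field, weighted sup output size through the
weighted presentation `(L^{k−j−1})⁻¹ • ev` -/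

section Eq154

variable {X : Type} [Fintype X]
variable {𝒴 𝒵 : Type} [NormedAddCommGroup 𝒴] [NormedSpace ℂ 𝒴] [NormedAddCommGroup 𝒵] [NormedSpace ℂ 𝒵]
  [CompleteSpace 𝒴] [CompleteSpace 𝒵] {gB : B6.Geometry}
variable {𝔸 : Type} [NormedRing 𝔸] [NormedAlgebra ℂ 𝔸] [CompleteSpace 𝔸] [NormOneClass 𝔸]
  {𝒢 : 𝒵 →L[ℂ] 𝒴} {W : 𝒴 → 𝒵} {D2 : 𝒴 →L[ℂ] 𝒵} {H₀ : (X → 𝔸) →L[ℂ] 𝒴} {B₀ θ C₄ a₃ 𝔧 𝔞 ε₄ : ℝ}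

/-- **(1.57)–(1.58) ⇒ «the second expression on the right-hand side [of (1.54)] is much smaller than δ′_j» ON THE LATTICE MODEL,
END TO END FROM THE LOCATED LEAVES OF [15] SECT. G, ALL SIZES CONCRETE** — r12's `B15From190LayerSizes.second154_lt_of_ineq190_layer`
(argument field `B :=` p29's (1.56) tower field of the fine field `U = U_k^{(n+1)}`, `k` levels, on the finite bond set `X`; input size
`supSize gB boxB blkB`, B-size `44d²B₃ε_k` and localisation discharged there; output size WITH PRINT'S WEIGHT (1.57) `(L^{j+1}η) =
(L^{k−j−1})⁻¹`: `supSize gB box blk` at the rescaled function `(L^{k−j−1})⁻¹ • ℍ`) for the presented chart `ℍ = x ↦ ev x (𝓗(B))`, with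
`h190`, `hmv` SUPPLIED by r08's `B11Ineq190Actual.ineq190_and_hmv_supSize_sectG` through the WEIGHTED presentation
`x ↦ (L^{k−j−1})⁻¹ • ev x` (compatibility letter `hevw`: the weighted values are dominated by the `𝒴`-size `bN` — the entry
`(L^jη)^{−1}` of (190)'s bracket).  Remaining: r08's located leaves of Sect. G, the presentation letters, the knit's side conditions
verbatim (the ten-layers geometry `δ10MΣR + δMR_k ≤ τD` as `hgeom`, `h156`, `h15`, `hX`/`hfar`/`hbox`, the [III] (2.4) letters, the
flow and γ-clauses); the tower's fine field `U` and the consumer's background `U₀` are not identified (print: two objects).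
[cite: Balaban1989LargeFieldI, (1.54) p.187, (1.56)–(1.58) p.188; Balaban1985Variational, Prop. 9 (190) pp.308–309, (179)–(180) p.306, (115) p.294] -/
theorem second154_lt_layer_sectG (Reg : Regime 𝒢 0 W B₀ θ C₄ a₃ 𝔧 𝔞 ε₄) (hWa : AnalyticOnNhd ℂ W {Y : 𝒴 | ‖Y‖ < a₃})
    {D : 𝒴 → X → 𝔸} (H : (X → 𝔸) →L[ℂ] 𝒴) (hTm : AnalyticOnNhd ℂ (fun Y : 𝒴 => Y - H (D Y)) {Y : 𝒴 | ‖Y‖ < ε₄ + 𝔞})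
    (hTm0 : (0 : 𝒴) - H (D 0) = 0)
    -- p29's (1.56) tower of the fine field `U`, `k` levels, and its field in the domain of (180)
    (dep : X → ℕ) (pt : X → B7Prop1Explicit.Site d) (dir : X → Fin d)
    {L : ℕ} (hL : 2 ≤ L) (hd1 : 1 ≤ d) {G : Subgroup 𝔸ˣ} (hAG : AvgClosed d L G) {j k : ℕ}
    (U : B7Prop1Explicit.Site d → Fin d → 𝔸ˣ) (hU : ∀ x κ, U x κ ∈ G)
    (hB : ‖H₀ (fun i => mlog (((avgIter L U (k - dep i) (pt i) (dir i) *
          (pullIter L (avgIter L U k) (dep i) (pt i) (dir i))⁻¹ : 𝔸ˣ) : 𝔸)))‖ < 𝔞 ∧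
      ‖D2 (H₀ (fun i => mlog (((avgIter L U (k - dep i) (pt i) (dir i) *
          (pullIter L (avgIter L U k) (dep i) (pt i) (dir i))⁻¹ : 𝔸ˣ) : 𝔸))))‖ < 𝔧)
    -- sizes and the weighted presentation
    (boxB : gB.Site → Finset X) (blkB : X → gB.Site) (hcover : ∀ i, i ∈ boxB (blkB i))
    (box : gB.Site → Finset (B7Prop1Explicit.Site d)) (blk : B7Prop1Explicit.Site d → gB.Site)
    (ev : B7Prop1Explicit.Site d → (𝒴 →L[ℝ] (Fin d → 𝔸)))
    {bN : BlockNorm gB 𝒴} {b3 : BlockNorm gB 𝒵}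
    (hevw : ∀ (y : gB.Site) (v : 𝒴), ∀ x ∈ box y, ‖((((L : ℝ) ^ (k - j - 1))⁻¹) • ev x) v‖ ≤ bN.loc y v)
    (hN : ∀ (y : gB.Site) (v : 𝒴), bN.loc y v ≤ ‖v‖)
    {δ₀ BG θW cΔ A₀ AH θD c : ℝ}
    (htri : Triangle254 gB) (hd : ∀ a b : gB.Site, 0 ≤ gB.dist a b) (hδ₀ : 0 ≤ δ₀)
    (hc : 0 ≤ c) (hBG : 0 ≤ BG) (hθW : 0 ≤ θW) (hcΔ : 0 ≤ cΔ) (hA₀ : 0 ≤ A₀) (hAH : 0 ≤ AH) (hθD : 0 ≤ θD)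
    (hG : HasMaj b3 bN (𝒢.restrictScalars ℝ : 𝒵 →ₗ[ℝ] 𝒴) (fun y y' => BG * Real.exp (-(δ₀ * gB.dist y y'))))
    (hD2H0 : HasMaj (supSize (X := X) (E := 𝔸) gB boxB blkB) b3 ((D2 ∘L H₀).restrictScalars ℝ : (X → 𝔸) →ₗ[ℝ] 𝒵)
      (fun y y' => cΔ * Real.exp (-(δ₀ * gB.dist y y'))))
    (hH0 : HasMaj (supSize (X := X) (E := 𝔸) gB boxB blkB) bN (H₀.restrictScalars ℝ : (X → 𝔸) →ₗ[ℝ] 𝒴)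
      (fun y y' => A₀ * Real.exp (-(δ₀ * gB.dist y y'))))
    (hH : HasMaj (supSize (X := X) (E := 𝔸) gB boxB blkB) bN (H.restrictScalars ℝ : (X → 𝔸) →ₗ[ℝ] 𝒴)
      (fun y y' => AH * Real.exp (-(δ₀ / 2 * gB.dist y y'))))
    (h189 : ∀ B' : X → 𝔸, ‖H₀ B'‖ < 𝔞 → ‖D2 (H₀ B')‖ < 𝔧 →
      Ineq189 bN b3 ((fderiv ℂ W (solA180 𝒢 W D2 H₀ ε₄ B' + H₀ B')).restrictScalars ℝ : 𝒴 →ₗ[ℝ] 𝒵) θW δ₀)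
    (hDfr : ∀ B' : X → 𝔸, ‖H₀ B'‖ < 𝔞 → ‖D2 (H₀ B')‖ < 𝔧 →
      ∃ 𝔇 : 𝒴 →L[ℂ] (X → 𝔸), HasFDerivAt D 𝔇 (solA180 𝒢 W D2 H₀ ε₄ B' + H₀ B') ∧
        HasMaj bN (supSize (X := X) (E := 𝔸) gB boxB blkB) (𝔇.restrictScalars ℝ : 𝒴 →ₗ[ℝ] (X → 𝔸))
          (fun y y' => θD * Real.exp (-(δ₀ / 2 * gB.dist y y'))))
    (hq : qG b3.κ bN.κ BG θW c < 1)
    -- the [IV] side: the letters of `B15From190LayerSizes.second154_lt_of_ineq190_layer` minus `h190`, `hmv`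
    {σ τ Dd B₃ δ M εk εj β₀ γ gj A₀' A₁ : ℝ} {R : ℕ → ℝ} {Rn r p₀ p₁ : ℕ}
    (hrow : RowSum gB σ c) (hτ : 0 ≤ τ) (hστ : σ + τ ≤ δ₀ / 8) (y : gB.Site)
    (hB₃ : 0 < B₃) (hεk : 0 < εk)
    (hs3 : C0 d * (2 * B₃ * εk) ≤ 1 / 3) (hs2 : 2 * (2 * B₃ * εk) ≤ c2' d L)
    (hs : 11 * (d : ℝ) ^ 2 * (2 * B₃ * εk) ≤ 1 / 6) (lo hi : B7Prop1Explicit.Site d) (hlohi : lo ≤ hi)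
    (h156 : pdevOn (tlo L lo k) (thi L hi k) U < 2 * B₃ * εk * (((L : ℝ) ^ k)⁻¹) ^ 2)
    (h15 : ∀ n, n < k → ∀ z, tlo L lo n ≤ z → z ≤ thi L hi n → ∀ r : Fin d → Fin L,
      axialFn (avgIter L U (k - (n + 1))) ((L : ℤ) • z) ((L : ℤ) • z + boxVec L r) = 1)
    (hX : ∀ i, dep i ≤ k ∧ tlo L lo (dep i) ≤ pt i ∧ pt i + e (dir i) ≤ thi L hi (dep i))
    (hfar : ∀ y' i, i ∈ boxB y' → Dd ≤ gB.dist y y')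
    {U₀ : B7Prop1Explicit.Site d → Fin d → 𝔸ˣ} (hU₀ : ∀ x κ, U₀ x κ ∈ G) {α₀ : ℝ} (hα : 0 < α₀)
    (hα3 : C0 d * α₀ ≤ 1 / 3) (hα4 : 4 * α₀ ≤ c2' d L) (h52 : pdev U₀ < α₀ * (((L : ℝ) ^ j)⁻¹) ^ 2)
    {Hf : B7Prop1Explicit.Site d → Fin d → 𝔸}
    (hHf : Hf = fun x => ev x (chartH179 𝒢 W D2 H₀ (fun Y : 𝒴 => Y - H (D Y)) ε₄
      (fun i => mlog (((avgIter L U (k - dep i) (pt i) (dir i) *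
          (pullIter L (avgIter L U k) (dep i) (pt i) (dir i))⁻¹ : 𝔸ˣ) : 𝔸)))))
    (q : B7Prop1Explicit.Site d) (κ : Fin d)
    (hgeom : δ * 10 * M * (∑ l ∈ Finset.Ico (j + 1) k, R l) + δ * M * R k ≤ τ * Dd)
    (hCB : const190 1 bN.κ b3.κ BG θW cΔ A₀ AH θD c * c ≤ B₃)
    (hjk : j < k) (hδM : (L : ℝ) + 1 ≤ δ * M) (hR1 : ∀ l, 1 ≤ R l)
    (hstep : ∀ l, j ≤ l → l < k → R l ≤ (L : ℝ) * R (l + 1)) (hεkflow : εk ≤ (1 + β₀) * Real.sqrt ((k : ℝ) - j) * εj)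
    (hεj : 0 < εj) (hβ₀ : 0 ≤ β₀)
    (hbox : ∀ y', B7Prop1Local.InBox (B7Prop1Local.loK L j q) (B7Prop1Local.bondHiK L j q κ) y' → y' ∈ box y) (hL1 : 1 ≤ L)
    (hRj : R j = (Rn : ℝ)) (hr : 1 ≤ r) (hp : p₁ ≤ p₀) (hRn : B14.IsRj L r gj Rn) (hgj : 0 < gj) (hgjγ : gj ≤ γ)
    (hγe : 1 ≤ Real.log (γ ^ 2)⁻¹) (hA₀' : 0 ≤ A₀') (hεjdef : εj = gj * p0Profile A₀' p₀ gj)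
    (hγ : (136 * ((d : ℝ) + 1) + 320 * d) * (44 * (d : ℝ) ^ 2 * B₃ ^ 2 * (1 + β₀)) * A₀'
      * (2 * ((p₀ - p₁ : ℕ) : ℝ)) ^ (p₀ - p₁) * γ < A₁)
    (hεj1 : εj ≤ 1)
    (hsmγ : 2048 * (d : ℝ) * (44 * (d : ℝ) ^ 2 * B₃ ^ 2 * (1 + β₀) * γ ^ 2) ≤ 1)
    (hc₃γ : 2 * (44 * (d : ℝ) ^ 2 * B₃ ^ 2 * (1 + β₀) * γ ^ 2) ≤ c3 d L)
    (hsmallγ : Real.exp (4 * (800 * ((d : ℝ) + 1) ^ 2 * ((d : ℝ) + 4)) * α₀)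
      * (1 + 8 * (131072 * ((d : ℝ) + 1) ^ 2) * (44 * (d : ℝ) ^ 2 * B₃ ^ 2 * (1 + β₀) * γ ^ 2)) ≤ 2) :
    ‖((avgIter L
          (gaugeAct (B7Eq84Concrete.glev L hL1 U₀
              (expCfg (fun y μ => ((Complex.I : ℂ) * ((((L : ℝ) ^ j)⁻¹ : ℝ) : ℂ)) • Hf y μ)) j 0)⁻¹
            (expCfg (fun y μ => ((Complex.I : ℂ) * ((((L : ℝ) ^ j)⁻¹ : ℝ) : ℂ)) • Hf y μ) * U₀)) j q κ : 𝔸ˣ) : 𝔸)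
        * (((avgIter L U₀ j q κ)⁻¹ : 𝔸ˣ) : 𝔸) - 1‖ < gj * p0Profile A₁ p₁ gj := by
  have hrow8 : RowSum gB (δ₀ / 8) c := hrow.mono hd (by linarith)
  have hK : 0 ≤ const190 1 bN.κ b3.κ BG θW cΔ A₀ AH θD c :=
    const190_nonneg' zero_le_one bN.κ_nonneg b3.κ_nonneg hc hBG hθW hcΔ hA₀ hAH hθD hq
  have hBloc : ∀ (y' : gB.Site) (m : X → 𝔸), (supSize (X := X) (E := 𝔸) gB boxB blkB).IsLoc y' m →
      ‖m‖ ≤ (supSize (X := X) (E := 𝔸) gB boxB blkB).loc y' m := fun y' m hm => norm_le_loc_supSize_of_isLoc hcover hm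
  obtain ⟨h190, hmv⟩ := ineq190_and_hmv_supSize_sectG (box := box) (blk := blk) Reg hWa H hTm hTm0 hB
    (fun x => (((L : ℝ) ^ (k - j - 1))⁻¹) • ev x) hevw hN hBloc htri hd hδ₀ hrow8 hc hBG hθW hcΔ hA₀ hAH hθD hG hD2H0 hH0 hH
    h189 hDfr hq
    (fun B' => (((L : ℝ) ^ (k - j - 1))⁻¹) • fun x => ev x (chartH179 𝒢 W D2 H₀ (fun Y : 𝒴 => Y - H (D Y)) ε₄ B'))
    (fun t => (LinearMap.pi fun x => (((((L : ℝ) ^ (k - j - 1))⁻¹) • ev x : 𝒴 →L[ℝ] (Fin d → 𝔸)) : 𝒴 →ₗ[ℝ] (Fin d → 𝔸))) ∘ₗ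
      ((fderiv ℂ (chartH179 𝒢 W D2 H₀ (fun Y : 𝒴 => Y - H (D Y)) ε₄) ((t : ℝ) •
        (fun i => mlog (((avgIter L U (k - dep i) (pt i) (dir i) *
          (pullIter L (avgIter L U k) (dep i) (pt i) (dir i))⁻¹ : 𝔸ˣ) : 𝔸))))).restrictScalars ℝ : (X → 𝔸) →ₗ[ℝ] 𝒴))
    (fun _ => rfl) (fun _ => rfl) y
  subst hHf
  rw [supSize_κ] at h190
  exact second154_lt_of_ineq190_layer boxB blkB dep pt dir box blk h190 hK hd hrow hτ hστ y hL hd1 hAG U hU hB₃ hεk hs3 hs2 hs lo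
    hi hlohi h156 h15 hX hfar hU₀ hα hα3 hα4 h52 _ q κ hmv hgeom hCB hjk hδM hR1 hstep hεkflow hεj hβ₀ hbox hL1 hRj hr hp hRn hgj
    hgjγ hγe hA₀' hεjdef hγ hεj1 hsmγ hc₃γ hsmallγ

end Eq154

/-! ## §7 (1.96): chain 1 (= (1.90)/(1.91)) END TO END from [15] Sect. G, chain 2 (= (1.93)–(1.95)) through the printed (1.94) -/

section Eq196

variable {X : Type} [Fintype X]
variable {𝒴 𝒵 : Type} [NormedAddCommGroup 𝒴] [NormedSpace ℂ 𝒴] [NormedAddCommGroup 𝒵] [NormedSpace ℂ 𝒵]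
  [CompleteSpace 𝒴] [CompleteSpace 𝒵] {gB : B6.Geometry}
variable {𝔸 : Type} [CStarAlgebra 𝔸] [Nontrivial 𝔸]
  {𝒢 : 𝒵 →L[ℂ] 𝒴} {W : 𝒴 → 𝒵} {D2 : 𝒴 →L[ℂ] 𝒵} {H₀ : (X → 𝔸) →L[ℂ] 𝒴} {B₀ θ C₄ a₃ 𝔧 𝔞 ε₄ : ℝ}

/-- **(1.96) p. 199 ON THE LATTICE, chain 1 END TO END FROM THE LOCATED LEAVES OF [15] SECT. G WITH ALL SIZES CONCRETE, chain 2 FROM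
THE PRINTED (1.94)** — r12's `B15From190LayerSizes.ineq196_twoSup_of_ineq190_layer` (p. 199: *"From the representation (1.93) and the
above bounds we get [(1.95)]. The estimates (1.91), (1.95) yield |U″_{k,Z}(∂p) − 1| < ¾ε_h(L^{k−h}η)² < (1 − β(1 − 2^{−(k−h+1)}))ε_h(L^{k−h}η)²
(1.96)"*; two-sup reading) with CHAIN 1 — `ℍ₁ = ℍ_{h,□}` of the representation (1.90) of `U″_{k,Z} =
(e^{iξℍ₁}Uhb)^{g₁}` over `Uhb := U_{h,□}(V″)`, argument field `B :=` the (1.90) tower field of the free fine field `Wf` (print: `U″_{k,Z}`)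
on the finite bond set `X` — being the presented chart `ℍ₁ = x ↦ ev x (𝓗(B))`, its four located hypotheses `h190₀`/`hmv₀` (r08's
`B11Ineq190Actual.ineq190_and_hmv_supSize_sectG`) and `h190₁`/`hmv₁` (p29's `B11Ineq190ActualDeriv.ineq190_and_hmv_covDerivBlockSize_sectG`,
covariant derivatives at `Uhb`) SUPPLIED; CHAIN 2 — `ℍ₂` of the representation (1.93) of `Uhb` over `U₁ := U_{h,□}((1,V_h))` — enters
EXACTLY through the printed bound (1.94) *"< αε_h"* (`hB₁`–`hB₄`, `hBD₁`, `hBD₂`, `hY₂`; row B15.Eq1.94 is proved along the flow in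
`B15Ineq194Last`), unchanged.  This supersedes the `_mv` form `B15From190LayerSizes.ineq196_twoSup_of_ineq190_layer_mv` (whose
`Hop`/`hderiv` letters were abstract mean-value data): here the `ℍ`-operator IS [15]'s chart and its differentiability is Prop. 9's
analyticity (`B11MeanValue190Chart`, inside r08's/p29's theorems).  Remaining: r08's located leaves of Sect. G, the presentation
letters `hev`/`hev₁`, the knit's side conditions verbatim (`h190p`, `h15`, `hX`/`hfar`, `δ2LM₂R_h ≤ τD`, the γ-clause `11d²B₃γ² < 1/24`,
the χ_{h,1/2}-restriction `hhalf`, `β ≤ ¼`, `ε_h ≤ 1/10`, `t ∈ (0,1]`, membership of the plaquette data).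
[cite: Balaban1989LargeFieldI, (1.90)–(1.96) pp.198–199; Balaban1985Variational, Prop. 9 (190) pp.308–309, (179)–(180) p.306, (115) p.294] -/
theorem ineq196_twoSup_layer_sectG (Reg : Regime 𝒢 0 W B₀ θ C₄ a₃ 𝔧 𝔞 ε₄) (hWa : AnalyticOnNhd ℂ W {Y : 𝒴 | ‖Y‖ < a₃})
    {D : 𝒴 → X → 𝔸} (H : (X → 𝔸) →L[ℂ] 𝒴) (hTm : AnalyticOnNhd ℂ (fun Y : 𝒴 => Y - H (D Y)) {Y : 𝒴 | ‖Y‖ < ε₄ + 𝔞})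
    (hTm0 : (0 : 𝒴) - H (D 0) = 0)
    -- chain 1's argument field: the (1.90) tower of `Wf` (print: `U″_{k,Z}`), `K` levels, in the domain of (180)
    (dep : X → ℕ) (pt : X → B7Prop1Explicit.Site d) (dir : X → Fin d)
    {L : ℕ} (hL : 2 ≤ L) (hd1 : 1 ≤ d) {G : Subgroup 𝔸ˣ} (hAG : AvgClosed d L G) {K : ℕ}
    (Wf : B7Prop1Explicit.Site d → Fin d → 𝔸ˣ) (hWf : ∀ x κ, Wf x κ ∈ G)
    (hB : ‖H₀ (fun i => mlog (((avgIter L Wf (K - dep i) (pt i) (dir i) *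
          (pullIter L (avgIter L Wf K) (dep i) (pt i) (dir i))⁻¹ : 𝔸ˣ) : 𝔸)))‖ < 𝔞 ∧
      ‖D2 (H₀ (fun i => mlog (((avgIter L Wf (K - dep i) (pt i) (dir i) *
          (pullIter L (avgIter L Wf K) (dep i) (pt i) (dir i))⁻¹ : 𝔸ˣ) : 𝔸))))‖ < 𝔧)
    -- sizes and presentation; chain 1's background `Uhb = U_{h,□}(V″)`
    (boxB : gB.Site → Finset X) (blkB : X → gB.Site) (hcover : ∀ i, i ∈ boxB (blkB i))
    (box : gB.Site → Finset (B7Prop1Explicit.Site d)) (blk : B7Prop1Explicit.Site d → gB.Site)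
    (y₀ : gB.Site) (S : gB.Site → Finset (B7Prop1Explicit.Site d × Fin d × Fin d)) {ξ : ℝ}
    {Uhb : B7Prop1Explicit.Site d → Fin d → 𝔸ˣ}
    (ev : B7Prop1Explicit.Site d → (𝒴 →L[ℝ] (Fin d → 𝔸)))
    {bN : BlockNorm gB 𝒴} {b3 : BlockNorm gB 𝒵}
    (hev : ∀ (y : gB.Site) (v : 𝒴), ∀ x ∈ box y, ‖ev x v‖ ≤ bN.loc y v)
    (hev₁ : ∀ (y : gB.Site) (v : 𝒴), (covDerivBlockSize gB y₀ S ξ Uhb).loc y (fun x => ev x v) ≤ bN.loc y v)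
    (hN : ∀ (y : gB.Site) (v : 𝒴), bN.loc y v ≤ ‖v‖)
    {δ₀ BG θW cΔ A₀ AH θD c : ℝ}
    (htri : Triangle254 gB) (hd : ∀ a b : gB.Site, 0 ≤ gB.dist a b) (hδ₀ : 0 ≤ δ₀)
    (hc : 0 ≤ c) (hBG : 0 ≤ BG) (hθW : 0 ≤ θW) (hcΔ : 0 ≤ cΔ) (hA₀ : 0 ≤ A₀) (hAH : 0 ≤ AH) (hθD : 0 ≤ θD)
    (hG : HasMaj b3 bN (𝒢.restrictScalars ℝ : 𝒵 →ₗ[ℝ] 𝒴) (fun y y' => BG * Real.exp (-(δ₀ * gB.dist y y'))))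
    (hD2H0 : HasMaj (supSize (X := X) (E := 𝔸) gB boxB blkB) b3 ((D2 ∘L H₀).restrictScalars ℝ : (X → 𝔸) →ₗ[ℝ] 𝒵)
      (fun y y' => cΔ * Real.exp (-(δ₀ * gB.dist y y'))))
    (hH0 : HasMaj (supSize (X := X) (E := 𝔸) gB boxB blkB) bN (H₀.restrictScalars ℝ : (X → 𝔸) →ₗ[ℝ] 𝒴)
      (fun y y' => A₀ * Real.exp (-(δ₀ * gB.dist y y'))))
    (hH : HasMaj (supSize (X := X) (E := 𝔸) gB boxB blkB) bN (H.restrictScalars ℝ : (X → 𝔸) →ₗ[ℝ] 𝒴)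
      (fun y y' => AH * Real.exp (-(δ₀ / 2 * gB.dist y y'))))
    (h189 : ∀ B' : X → 𝔸, ‖H₀ B'‖ < 𝔞 → ‖D2 (H₀ B')‖ < 𝔧 →
      Ineq189 bN b3 ((fderiv ℂ W (solA180 𝒢 W D2 H₀ ε₄ B' + H₀ B')).restrictScalars ℝ : 𝒴 →ₗ[ℝ] 𝒵) θW δ₀)
    (hDfr : ∀ B' : X → 𝔸, ‖H₀ B'‖ < 𝔞 → ‖D2 (H₀ B')‖ < 𝔧 →
      ∃ 𝔇 : 𝒴 →L[ℂ] (X → 𝔸), HasFDerivAt D 𝔇 (solA180 𝒢 W D2 H₀ ε₄ B' + H₀ B') ∧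
        HasMaj bN (supSize (X := X) (E := 𝔸) gB boxB blkB) (𝔇.restrictScalars ℝ : 𝒴 →ₗ[ℝ] (X → 𝔸))
          (fun y y' => θD * Real.exp (-(δ₀ / 2 * gB.dist y y'))))
    (hq : qG b3.κ bN.κ BG θW c < 1)
    -- the [IV] side: the letters of `B15From190LayerSizes.ineq196_twoSup_of_ineq190_layer` minus `h190₀,₁`, `hmv₀,₁`
    {σ τ Dd B₃ δ M₂ εh γ gh : ℝ} {r R : ℕ}
    (hrow : RowSum gB σ c) (hτ : 0 ≤ τ) (hστ : σ + τ ≤ δ₀ / 8) (y : gB.Site) (hε : 0 < εh)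
    (hs3 : C0 d * (εh * (1 / 2)) ≤ 1 / 3) (hs2 : 2 * (εh * (1 / 2)) ≤ c2' d L)
    (hs : 11 * (d : ℝ) ^ 2 * (εh * (1 / 2)) ≤ 1 / 6) (lo hi : B7Prop1Explicit.Site d) (hlohi : lo ≤ hi)
    (h190p : pdevOn (tlo L lo K) (thi L hi K) Wf < εh * (1 / 2) * (((L : ℝ) ^ K)⁻¹) ^ 2)
    (h15 : ∀ n, n < K → ∀ z, tlo L lo n ≤ z → z ≤ thi L hi n → ∀ r : Fin d → Fin L,
      axialFn (avgIter L Wf (K - (n + 1))) ((L : ℤ) • z) ((L : ℤ) • z + boxVec L r) = 1)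
    (hX : ∀ i, dep i ≤ K ∧ tlo L lo (dep i) ≤ pt i ∧ pt i + e (dir i) ≤ thi L hi (dep i))
    (hfar : ∀ y' i, i ∈ boxB y' → Dd ≤ gB.dist y y')
    (hξ : 0 < ξ) (hUhb : ∀ z κ, Uhb z κ ∈ U1 𝔸)
    {Hf₁ : B7Prop1Explicit.Site d → Fin d → 𝔸}
    (hHf₁ : Hf₁ = fun x => ev x (chartH179 𝒢 W D2 H₀ (fun Y : 𝒴 => Y - H (D Y)) ε₄
      (fun i => mlog (((avgIter L Wf (K - dep i) (pt i) (dir i) *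
          (pullIter L (avgIter L Wf K) (dep i) (pt i) (dir i))⁻¹ : 𝔸ˣ) : 𝔸)))))
    (hH₁sa : ∀ z κ, IsSelfAdjoint (Hf₁ z κ))
    {g₁ : B7Prop1Explicit.Site d → 𝔸ˣ} (hg₁ : ∀ z, g₁ z ∈ U1 𝔸)
    {U₁ : B7Prop1Explicit.Site d → Fin d → 𝔸ˣ} (hU₁ : ∀ z κ, U₁ z κ ∈ U1 𝔸)
    {H₂ : B7Prop1Explicit.Site d → Fin d → 𝔸} (hH₂sa : ∀ z κ, IsSelfAdjoint (H₂ z κ))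
    {g₂ : B7Prop1Explicit.Site d → 𝔸ˣ} (hg₂ : ∀ z, g₂ z ∈ U1 𝔸)
    (hrep : Uhb = gaugeAct g₂ (B8Lemma1NonAbelian.mulCfg (B8Eq146AExpansion.expCfg (B8Eq146AExpansion.iEta ξ H₂)) U₁))
    (μ ν : Fin d) (x : B7Prop1Explicit.Site d) {Linv Y₂ β t : ℝ}
    (hgeom : δ * 2 * L * M₂ * R ≤ τ * Dd) (hCB : const190 1 bN.κ b3.κ BG θW cΔ A₀ AH θD c * c ≤ B₃) (hB₃ : 0 < B₃)
    (hr : 1 ≤ r) (hR : B14.IsRj L r gh R) (hgh : 0 < gh) (hgγ : gh ≤ γ) (hγe : 1 ≤ Real.log (γ ^ 2)⁻¹)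
    (hc1 : 1 < δ * 2 * L * M₂) (hRh : 0 < (R : ℝ)) (hγ : 11 * (d : ℝ) ^ 2 * B₃ * γ ^ 2 < 1 / 24)
    (hx : x ∈ box y) (hxμ : x + e μ ∈ box y) (hxν : x + e ν ∈ box y)
    (hS₁ : (x, μ, ν) ∈ S y) (hS₂ : (x, ν, μ) ∈ S y)
    (hB₁ : ‖H₂ x μ‖ ≤ Y₂) (hB₂ : ‖H₂ (x + e μ) ν‖ ≤ Y₂) (hB₃' : ‖H₂ (x + e ν) μ‖ ≤ Y₂) (hB₄ : ‖H₂ x ν‖ ≤ Y₂)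
    (hBD₁ : ‖B8Ineq132.covDerivFwd ξ U₁ μ (fun z => H₂ z ν) x‖ ≤ Y₂)
    (hBD₂ : ‖B8Ineq132.covDerivFwd ξ U₁ ν (fun z => H₂ z μ) x‖ ≤ Y₂) (hY₂ : Y₂ < 1 / 24 * εh)
    (hhalf : ‖B8Ineq132.plaqF U₁ μ ν x - 1‖ < 1 / 2 * (εh * ξ ^ 2)) (hL0 : 0 ≤ Linv) (hL1 : Linv ≤ 1)
    (hε1 : εh ≤ 1 / 10) (hβ : β ≤ 1 / 4) (ht0 : 0 < t) (ht1 : t ≤ 1) :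
    B15.BasicStep.Ineq196 ‖B8Ineq132.plaqF (gaugeAct g₁ (B8Lemma1NonAbelian.mulCfg (B8Eq146AExpansion.expCfg
        (B8Eq146AExpansion.iEta ξ Hf₁)) Uhb)) μ ν x - 1‖ β t (εh * ξ ^ 2) := by
  have hrow8 : RowSum gB (δ₀ / 8) c := hrow.mono hd (by linarith)
  obtain ⟨hK, h190₀, hmv₀⟩ := pair_sup_sectG Reg hWa H hTm hTm0 hB boxB blkB hcover box blk ev hev hN htri hd hδ₀ hrow8 hc hBG
    hθW hcΔ hA₀ hAH hθD hG hD2H0 hH0 hH h189 hDfr hq y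
  obtain ⟨h190₁, hmv₁⟩ := pair_cov_sectG Reg hWa H hTm hTm0 hB boxB blkB hcover y₀ S ev hev₁ hN htri hd hδ₀ hrow8 hc hBG hθW
    hcΔ hA₀ hAH hθD hG hD2H0 hH0 hH h189 hDfr hq y
  subst hHf₁
  exact ineq196_twoSup_of_ineq190_layer boxB blkB dep pt dir box blk y₀ S h190₀ h190₁ hK hd hrow hτ hστ y hL hd1 hAG Wf hWf hε
    hs3 hs2 hs lo hi hlohi h190p h15 hX hfar hξ hUhb hH₁sa hg₁ hU₁ hH₂sa hg₂ hrep μ ν x hmv₀ hmv₁ hgeom hCB hB₃ hr hR hgh hgγ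
    hγe hc1 hRh hγ hx hxμ hxν hS₁ hS₂ hB₁ hB₂ hB₃' hB₄ hBD₁ hBD₂ hY₂ hhalf hL0 hL1 hε1 hβ ht0 ht1

end Eq196

/-! ## §8 (1.98) p. 200: the two p. 199 `ℍ`-chains of two different representations = TWO schemes, both END TO END from [15]
Sect. G -/

section Eq198

variable {X₁ X₂ : Type} [Fintype X₁] [Fintype X₂]
variable {𝒴₁ 𝒵₁ 𝒴₂ 𝒵₂ : Type} [NormedAddCommGroup 𝒴₁] [NormedSpace ℂ 𝒴₁] [NormedAddCommGroup 𝒵₁] [NormedSpace ℂ 𝒵₁]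
  [CompleteSpace 𝒴₁] [CompleteSpace 𝒵₁] [NormedAddCommGroup 𝒴₂] [NormedSpace ℂ 𝒴₂] [NormedAddCommGroup 𝒵₂]
  [NormedSpace ℂ 𝒵₂] [CompleteSpace 𝒴₂] [CompleteSpace 𝒵₂] {gB : B6.Geometry}
variable {𝔸 : Type} [CStarAlgebra 𝔸] [Nontrivial 𝔸]
  {𝒢₁ : 𝒵₁ →L[ℂ] 𝒴₁} {W₁ : 𝒴₁ → 𝒵₁} {D2₁ : 𝒴₁ →L[ℂ] 𝒵₁} {H₀₁ : (X₁ → 𝔸) →L[ℂ] 𝒴₁} {B₀₁ θ₁ C₄₁ a₃₁ 𝔧₁ 𝔞₁ ε₄₁ : ℝ}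
  {𝒢₂ : 𝒵₂ →L[ℂ] 𝒴₂} {W₂ : 𝒴₂ → 𝒵₂} {D2₂ : 𝒴₂ →L[ℂ] 𝒵₂} {H₀₂ : (X₂ → 𝔸) →L[ℂ] 𝒴₂} {B₀₂ θ₂ C₄₂ a₃₂ 𝔧₂ 𝔞₂ ε₄₂ : ℝ}

/-- **(1.98) p. 200 ON THE LATTICE, BOTH p. 199 `ℍ`-CHAINS END TO END FROM THE LOCATED LEAVES OF [15] SECT. G WITH THEIR PRINTED
SIZES, chain 1 ALL SIZES CONCRETE** — r12's `B15From190LayerSizes.ineq198_twoSup_of_ineq190_layer199` (two-sup reading; CHAIN 1 —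
`U″_{k,Z} = (e^{iξℍ₁}C)^{g₁}` over the configuration `C` of (1.97), argument field p29's two-field layer field `B₁` of the layer `Σ`
on the finite set `X₁` (*"bounded by … < 23d²ε_h"*, `loc_layer199_le`), p. 199 exponent `δ(M/M₁)(j−h) + ½δMR_h`; CHAIN 2 — `C =
(e^{iξℍ₂}C₀)^{g₂}` over `C₀ = U₀^{ū₀}`, argument field a free `B′ : X₂ → 𝔸` under (1.82) `|B′(b)| < δ′_k`, *"bounded by B₃δ′_k … <
αε_j"*) — the two `ℍ`-functions being the presented charts of TWO SCHEMES of [15] (two backgrounds ⇒ two spaces (115), two sets of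
operators; indices ₁, ₂): `ℍ₁ = x ↦ ev₁ x (𝓗₁(B₁))`, `ℍ₂ = x ↦ ev₂ x (𝓗₂(B′))`, and ALL EIGHT located hypotheses `h190₁₀`, `h190₁₁`,
`h190₂₀`, `h190₂₁`, `hmv₁₀`, `hmv₁₁`, `hmv₂₀`, `hmv₂₁` SUPPLIED (r08's `ineq190_and_hmv_supSize_sectG`, p29's
`ineq190_and_hmv_covDerivBlockSize_sectG`, per scheme; the (190) constant of the knit is `max` of the two explicit `const190 1 …`,
`HasMaj.mono`).  The geometry `gB`, the rate `δ₀` and the [3] row-sum datum `c` are print's universal constants, shared by the two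
schemes.  Remaining: the located leaves of Sect. G of BOTH schemes, their presentation letters, and the knit's side conditions verbatim
(p29's (1.96)/(1.80)/(1.82)/(D) inputs of the layer field, `hfar₁`, `hgeom₁`, the (B)- and (C)-chain letters of `B15Bounds199`, the two
α′-clauses from γ, (1.80) `h180` for `C₀(∂p)`, `2α′ ≤ 1/8`, the scale inequality).
[cite: Balaban1989LargeFieldI, (1.97)–(1.98) pp.199–200, (1.80) p.195, (1.82) p.196; Balaban1985Variational, Prop. 9 (190) pp.308–309, (179)–(180) p.306, (115) p.294] -/
theorem ineq198_twoSup_layer199_sectG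
    -- scheme 1 (chain 1, background `C` of (1.97)): regime, analyticity letters, Sect. C map
    (Reg₁ : Regime 𝒢₁ 0 W₁ B₀₁ θ₁ C₄₁ a₃₁ 𝔧₁ 𝔞₁ ε₄₁) (hWa₁ : AnalyticOnNhd ℂ W₁ {Y : 𝒴₁ | ‖Y‖ < a₃₁})
    {Dm₁ : 𝒴₁ → X₁ → 𝔸} (Hm₁ : (X₁ → 𝔸) →L[ℂ] 𝒴₁)
    (hTm₁ : AnalyticOnNhd ℂ (fun Y : 𝒴₁ => Y - Hm₁ (Dm₁ Y)) {Y : 𝒴₁ | ‖Y‖ < ε₄₁ + 𝔞₁}) (hTm0₁ : (0 : 𝒴₁) - Hm₁ (Dm₁ 0) = 0)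
    -- scheme 2 (chain 2, background `C₀ = U₀^{ū₀}`)
    (Reg₂ : Regime 𝒢₂ 0 W₂ B₀₂ θ₂ C₄₂ a₃₂ 𝔧₂ 𝔞₂ ε₄₂) (hWa₂ : AnalyticOnNhd ℂ W₂ {Y : 𝒴₂ | ‖Y‖ < a₃₂})
    {Dm₂ : 𝒴₂ → X₂ → 𝔸} (Hm₂ : (X₂ → 𝔸) →L[ℂ] 𝒴₂)
    (hTm₂ : AnalyticOnNhd ℂ (fun Y : 𝒴₂ => Y - Hm₂ (Dm₂ Y)) {Y : 𝒴₂ | ‖Y‖ < ε₄₂ + 𝔞₂}) (hTm0₂ : (0 : 𝒴₂) - Hm₂ (Dm₂ 0) = 0)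
    -- chain 1's argument field: p29's two-field layer tower (fine fields `U′`, `U₀′`), in the domain of (180) of scheme 1
    (dep : X₁ → ℕ) (pt : X₁ → B7Prop1Explicit.Site d) (dir : X₁ → Fin d)
    {L : ℕ} (hL : 2 ≤ L) (hd1 : 1 ≤ d) {G : Subgroup 𝔸ˣ} (hAG : AvgClosed d L G) {h k j : ℕ} (hhk : h ≤ k)
    (U₀' U' : B7Prop1Explicit.Site d → Fin d → 𝔸ˣ) (hU₀' : ∀ x κ, U₀' x κ ∈ G) (hU' : ∀ x κ, U' x κ ∈ G)
    (hdom₁ : ‖H₀₁ (fun i => mlog (((avgIter L U' (h - dep i) (pt i) (dir i) *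
          (avgIter L U₀' (h - dep i) (pt i) (dir i))⁻¹ : 𝔸ˣ) : 𝔸)))‖ < 𝔞₁ ∧
      ‖D2₁ (H₀₁ (fun i => mlog (((avgIter L U' (h - dep i) (pt i) (dir i) *
          (avgIter L U₀' (h - dep i) (pt i) (dir i))⁻¹ : 𝔸ˣ) : 𝔸))))‖ < 𝔧₁)
    -- chain 2's argument field `B′` under (1.82), in the domain of (180) of scheme 2
    {δ'k : ℝ} (B' : X₂ → 𝔸) (hB' : ∀ i, ‖B' i‖ ≤ δ'k) (hdom₂ : ‖H₀₂ B'‖ < 𝔞₂ ∧ ‖D2₂ (H₀₂ B')‖ < 𝔧₂)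
    -- input sizes, output sizes, the two presentations (backgrounds `Cc` = `C`, `C₀`)
    (boxB₁ : gB.Site → Finset X₁) (blkB₁ : X₁ → gB.Site) (hcover₁ : ∀ i, i ∈ boxB₁ (blkB₁ i))
    (boxB₂ : gB.Site → Finset X₂) (blkB₂ : X₂ → gB.Site) (hcover₂ : ∀ i, i ∈ boxB₂ (blkB₂ i))
    (box : gB.Site → Finset (B7Prop1Explicit.Site d)) (blk : B7Prop1Explicit.Site d → gB.Site)
    (y₀ : gB.Site) (S : gB.Site → Finset (B7Prop1Explicit.Site d × Fin d × Fin d)) {ξ : ℝ}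
    {Cc C₀ : B7Prop1Explicit.Site d → Fin d → 𝔸ˣ}
    (ev₁ : B7Prop1Explicit.Site d → (𝒴₁ →L[ℝ] (Fin d → 𝔸))) (ev₂ : B7Prop1Explicit.Site d → (𝒴₂ →L[ℝ] (Fin d → 𝔸)))
    {bN₁ : BlockNorm gB 𝒴₁} {b3₁ : BlockNorm gB 𝒵₁} {bN₂ : BlockNorm gB 𝒴₂} {b3₂ : BlockNorm gB 𝒵₂}
    (hev₁₀ : ∀ (y : gB.Site) (v : 𝒴₁), ∀ x ∈ box y, ‖ev₁ x v‖ ≤ bN₁.loc y v)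
    (hev₁₁ : ∀ (y : gB.Site) (v : 𝒴₁), (covDerivBlockSize gB y₀ S ξ Cc).loc y (fun x => ev₁ x v) ≤ bN₁.loc y v)
    (hN₁ : ∀ (y : gB.Site) (v : 𝒴₁), bN₁.loc y v ≤ ‖v‖)
    (hev₂₀ : ∀ (y : gB.Site) (v : 𝒴₂), ∀ x ∈ box y, ‖ev₂ x v‖ ≤ bN₂.loc y v)
    (hev₂₁ : ∀ (y : gB.Site) (v : 𝒴₂), (covDerivBlockSize gB y₀ S ξ C₀).loc y (fun x => ev₂ x v) ≤ bN₂.loc y v)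
    (hN₂ : ∀ (y : gB.Site) (v : 𝒴₂), bN₂.loc y v ≤ ‖v‖)
    -- the located leaves of [15] Sect. G for the two schemes (shared: geometry, `δ₀`, the [3] row-sum datum `c`)
    {δ₀ c BG₁ θW₁ cΔ₁ A₀₁ AH₁ θD₁ BG₂ θW₂ cΔ₂ A₀₂ AH₂ θD₂ : ℝ}
    (htri : Triangle254 gB) (hd : ∀ a b : gB.Site, 0 ≤ gB.dist a b) (hδ₀ : 0 ≤ δ₀) (hc : 0 ≤ c)
    (hBG₁ : 0 ≤ BG₁) (hθW₁ : 0 ≤ θW₁) (hcΔ₁ : 0 ≤ cΔ₁) (hA₀₁ : 0 ≤ A₀₁) (hAH₁ : 0 ≤ AH₁) (hθD₁ : 0 ≤ θD₁)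
    (hG₁ : HasMaj b3₁ bN₁ (𝒢₁.restrictScalars ℝ : 𝒵₁ →ₗ[ℝ] 𝒴₁) (fun y y' => BG₁ * Real.exp (-(δ₀ * gB.dist y y'))))
    (hD2H0₁ : HasMaj (supSize (X := X₁) (E := 𝔸) gB boxB₁ blkB₁) b3₁ ((D2₁ ∘L H₀₁).restrictScalars ℝ : (X₁ → 𝔸) →ₗ[ℝ] 𝒵₁)
      (fun y y' => cΔ₁ * Real.exp (-(δ₀ * gB.dist y y'))))
    (hH0₁ : HasMaj (supSize (X := X₁) (E := 𝔸) gB boxB₁ blkB₁) bN₁ (H₀₁.restrictScalars ℝ : (X₁ → 𝔸) →ₗ[ℝ] 𝒴₁)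
      (fun y y' => A₀₁ * Real.exp (-(δ₀ * gB.dist y y'))))
    (hH₁ : HasMaj (supSize (X := X₁) (E := 𝔸) gB boxB₁ blkB₁) bN₁ (Hm₁.restrictScalars ℝ : (X₁ → 𝔸) →ₗ[ℝ] 𝒴₁)
      (fun y y' => AH₁ * Real.exp (-(δ₀ / 2 * gB.dist y y'))))
    (h189₁ : ∀ B'' : X₁ → 𝔸, ‖H₀₁ B''‖ < 𝔞₁ → ‖D2₁ (H₀₁ B'')‖ < 𝔧₁ →
      Ineq189 bN₁ b3₁ ((fderiv ℂ W₁ (solA180 𝒢₁ W₁ D2₁ H₀₁ ε₄₁ B'' + H₀₁ B'')).restrictScalars ℝ : 𝒴₁ →ₗ[ℝ] 𝒵₁) θW₁ δ₀)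
    (hDfr₁ : ∀ B'' : X₁ → 𝔸, ‖H₀₁ B''‖ < 𝔞₁ → ‖D2₁ (H₀₁ B'')‖ < 𝔧₁ →
      ∃ 𝔇 : 𝒴₁ →L[ℂ] (X₁ → 𝔸), HasFDerivAt Dm₁ 𝔇 (solA180 𝒢₁ W₁ D2₁ H₀₁ ε₄₁ B'' + H₀₁ B'') ∧
        HasMaj bN₁ (supSize (X := X₁) (E := 𝔸) gB boxB₁ blkB₁) (𝔇.restrictScalars ℝ : 𝒴₁ →ₗ[ℝ] (X₁ → 𝔸))
          (fun y y' => θD₁ * Real.exp (-(δ₀ / 2 * gB.dist y y'))))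
    (hq₁ : qG b3₁.κ bN₁.κ BG₁ θW₁ c < 1)
    (hBG₂ : 0 ≤ BG₂) (hθW₂ : 0 ≤ θW₂) (hcΔ₂ : 0 ≤ cΔ₂) (hA₀₂ : 0 ≤ A₀₂) (hAH₂ : 0 ≤ AH₂) (hθD₂ : 0 ≤ θD₂)
    (hG₂ : HasMaj b3₂ bN₂ (𝒢₂.restrictScalars ℝ : 𝒵₂ →ₗ[ℝ] 𝒴₂) (fun y y' => BG₂ * Real.exp (-(δ₀ * gB.dist y y'))))
    (hD2H0₂ : HasMaj (supSize (X := X₂) (E := 𝔸) gB boxB₂ blkB₂) b3₂ ((D2₂ ∘L H₀₂).restrictScalars ℝ : (X₂ → 𝔸) →ₗ[ℝ] 𝒵₂)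
      (fun y y' => cΔ₂ * Real.exp (-(δ₀ * gB.dist y y'))))
    (hH0₂ : HasMaj (supSize (X := X₂) (E := 𝔸) gB boxB₂ blkB₂) bN₂ (H₀₂.restrictScalars ℝ : (X₂ → 𝔸) →ₗ[ℝ] 𝒴₂)
      (fun y y' => A₀₂ * Real.exp (-(δ₀ * gB.dist y y'))))
    (hH₂ : HasMaj (supSize (X := X₂) (E := 𝔸) gB boxB₂ blkB₂) bN₂ (Hm₂.restrictScalars ℝ : (X₂ → 𝔸) →ₗ[ℝ] 𝒴₂)
      (fun y y' => AH₂ * Real.exp (-(δ₀ / 2 * gB.dist y y'))))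
    (h189₂ : ∀ B'' : X₂ → 𝔸, ‖H₀₂ B''‖ < 𝔞₂ → ‖D2₂ (H₀₂ B'')‖ < 𝔧₂ →
      Ineq189 bN₂ b3₂ ((fderiv ℂ W₂ (solA180 𝒢₂ W₂ D2₂ H₀₂ ε₄₂ B'' + H₀₂ B'')).restrictScalars ℝ : 𝒴₂ →ₗ[ℝ] 𝒵₂) θW₂ δ₀)
    (hDfr₂ : ∀ B'' : X₂ → 𝔸, ‖H₀₂ B''‖ < 𝔞₂ → ‖D2₂ (H₀₂ B'')‖ < 𝔧₂ →
      ∃ 𝔇 : 𝒴₂ →L[ℂ] (X₂ → 𝔸), HasFDerivAt Dm₂ 𝔇 (solA180 𝒢₂ W₂ D2₂ H₀₂ ε₄₂ B'' + H₀₂ B'') ∧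
        HasMaj bN₂ (supSize (X := X₂) (E := 𝔸) gB boxB₂ blkB₂) (𝔇.restrictScalars ℝ : 𝒴₂ →ₗ[ℝ] (X₂ → 𝔸))
          (fun y y' => θD₂ * Real.exp (-(δ₀ / 2 * gB.dist y y'))))
    (hq₂ : qG b3₂.κ bN₂.κ BG₂ θW₂ c < 1)
    -- the [IV] side: the letters of `B15From190LayerSizes.ineq198_twoSup_of_ineq190_layer199` minus the eight located hypotheses
    {σ τ D₁ B₃ δ M M₁ εh εj εk γ gh β₀ α' rk rj s : ℝ} {r R : ℕ}
    (hrow : RowSum gB σ c) (hσ : σ ≤ δ₀ / 8) (hτ : 0 ≤ τ) (hστ : σ + τ ≤ δ₀ / 8) (y : gB.Site)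
    {Cw Xc rr : ℝ} (hε : 0 < εh) (hCw : 0 ≤ Cw) (hδ0 : 0 ≤ δ'k) (lo hi : B7Prop1Explicit.Site d) (hlohi : lo ≤ hi)
    (h96 : pdevOn (tlo L lo h) (thi L hi h) U' < 3 / 4 * εh * (((L : ℝ) ^ h)⁻¹) ^ 2)
    (h80 : pdevOn (tlo L lo h) (thi L hi h) U₀' < Cw * εk * (((L : ℝ) ^ k)⁻¹) ^ 2)
    (hD : εk ≤ (1 + β₀) * Real.sqrt (k - h : ℕ) * εh)
    (hXc : Xc = (((L : ℝ) ^ (k - h)) ^ 2)⁻¹ * Real.sqrt (k - h : ℕ) * Cw * (1 + β₀)) (hX1 : Xc ≤ 1)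
    (hδr : δ'k ≤ (1 + β₀) * Real.sqrt (k - h : ℕ) * rr * εh)
    (hsmall : 2 * (1 + β₀) * Real.sqrt (k - h : ℕ) * rr < (d : ℝ) ^ 2)
    (hs3 : C0 d * εh ≤ 1 / 3) (hs2 : 2 * εh ≤ c2' d L) (hs6 : 11 * (d : ℝ) ^ 2 * εh + δ'k ≤ 1 / 6)
    (h19 : ∀ n, n < h → ∀ z, tlo L lo n ≤ z → z ≤ thi L hi n → ∀ r : Fin d → Fin L,
      axialFn (avgIter L U' (h - (n + 1))) ((L : ℤ) • z) ((L : ℤ) • z + boxVec L r) =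
        axialFn (avgIter L U₀' (h - (n + 1))) ((L : ℤ) • z) ((L : ℤ) • z + boxVec L r))
    (h82 : ∀ x ν, lo ≤ x → x + e ν ≤ hi →
      ‖((avgIter L U' h x ν * (avgIter L U₀' h x ν)⁻¹ : 𝔸ˣ) : 𝔸) - 1‖ ≤ δ'k)
    (hX : ∀ i, dep i ≤ h ∧ tlo L lo (dep i) ≤ pt i ∧ pt i + e (dir i) ≤ thi L hi (dep i))
    (hfar₁ : ∀ y' i, i ∈ boxB₁ y' → D₁ ≤ gB.dist y y')
    (hξ : 0 < ξ) (hCc : ∀ z κ, Cc z κ ∈ U1 𝔸)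
    {Hf₁ : B7Prop1Explicit.Site d → Fin d → 𝔸}
    (hHf₁ : Hf₁ = fun x => ev₁ x (chartH179 𝒢₁ W₁ D2₁ H₀₁ (fun Y : 𝒴₁ => Y - Hm₁ (Dm₁ Y)) ε₄₁
      (fun i => mlog (((avgIter L U' (h - dep i) (pt i) (dir i) *
          (avgIter L U₀' (h - dep i) (pt i) (dir i))⁻¹ : 𝔸ˣ) : 𝔸)))))
    (hH₁sa : ∀ z κ, IsSelfAdjoint (Hf₁ z κ))
    {g₁ : B7Prop1Explicit.Site d → 𝔸ˣ} (hg₁ : ∀ z, g₁ z ∈ U1 𝔸)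
    (hC₀ : ∀ z κ, C₀ z κ ∈ U1 𝔸)
    {Hf₂ : B7Prop1Explicit.Site d → Fin d → 𝔸}
    (hHf₂ : Hf₂ = fun x => ev₂ x (chartH179 𝒢₂ W₂ D2₂ H₀₂ (fun Y : 𝒴₂ => Y - Hm₂ (Dm₂ Y)) ε₄₂ B'))
    (hH₂sa : ∀ z κ, IsSelfAdjoint (Hf₂ z κ))
    {g₂ : B7Prop1Explicit.Site d → 𝔸ˣ} (hg₂ : ∀ z, g₂ z ∈ U1 𝔸)
    (hrep : Cc = gaugeAct g₂ (B8Lemma1NonAbelian.mulCfg (B8Eq146AExpansion.expCfg (B8Eq146AExpansion.iEta ξ Hf₂)) C₀))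
    (μ ν : Fin d) (x : B7Prop1Explicit.Site d) {Linv η B₅ dist Cst Lkj : ℝ}
    (hgeom₁ : δ * (M / M₁) * ((j - h : ℕ) : ℝ) + δ * M / 2 * (R : ℝ) ≤ τ * D₁)
    (hCB₁ : const190 1 bN₁.κ b3₁.κ BG₁ θW₁ cΔ₁ A₀₁ AH₁ θD₁ c * c ≤ B₃)
    (hCB₂ : const190 1 bN₂.κ b3₂.κ BG₂ θW₂ cΔ₂ A₀₂ AH₂ θD₂ c * c ≤ B₃) (hB₃ : 0 < B₃)
    (hδM : 1 ≤ δ * (M / M₁)) (hδM2 : 1 ≤ δ * M / 2) (hεj : 0 < εj)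
    (hflowB : εh ≤ (1 + β₀) ^ 2 * (1 + ((j - h : ℕ) : ℝ) ^ β₀) * εj) (hβ₀ : 0 < β₀) (hβ₁ : β₀ ≤ 1)
    (hr : 1 ≤ r) (hR : B14.IsRj L r gh R) (hgh : 0 < gh) (hgγ : gh ≤ γ) (hγe : 1 ≤ Real.log (γ ^ 2)⁻¹)
    (hγB : 23 * (d : ℝ) ^ 2 * B₃ * (1 + β₀) ^ 2 * γ ^ 2 < α')
    (hεk : 0 ≤ εk) (hrj : 0 ≤ rj) (hs0 : 0 ≤ s) (hδ'k : δ'k ≤ rk * εk) (hrk : rk ≤ rj)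
    (hflowC : εk ≤ (1 + β₀) * (1 + s) * εj) (hγC : B₃ * (1 + β₀) * (1 + s) * rj < α')
    (hx : x ∈ box y) (hxμ : x + e μ ∈ box y) (hxν : x + e ν ∈ box y)
    (hS₁ : (x, μ, ν) ∈ S y) (hS₂ : (x, ν, μ) ∈ S y)
    (h180 : B15.Ineq180 ‖B8Ineq132.plaqF C₀ μ ν x - 1‖ εk η B₃ B₅ M δ dist Cst)
    (hα' : 2 * α' ≤ 1 / 8) (hL0 : 0 ≤ Linv) (hL1 : Linv ≤ 1) (hε1 : εj ≤ 1 / 10)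
    (hXst : 0 ≤ Cst * B₃ * B₅ * M ^ 5 * Real.exp (-δ * dist)) (he : 0 ≤ εk * η ^ 2)
    (hscale : εk * η ^ 2 ≤ Lkj * (εj * ξ ^ 2)) (hLkj1 : Lkj ≤ 1) :
    ‖B8Ineq132.plaqF (gaugeAct g₁ (B8Lemma1NonAbelian.mulCfg (B8Eq146AExpansion.expCfg
        (B8Eq146AExpansion.iEta ξ Hf₁)) Cc)) μ ν x - 1‖
      < (2 * Lkj + 4 * (2 * α') + Cst * (1 + Linv * (2 * α') * εj) ^ 2 * B₃ * B₅ * M ^ 5 * Real.exp (-δ * dist) * Lkj)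
        * (εj * ξ ^ 2) := by
  have hrow8 : RowSum gB (δ₀ / 8) c := hrow.mono hd (by linarith)
  -- scheme 1: the two pairs for `ℍ₁` (sup size, covariant derivatives at `Cc`)
  obtain ⟨hK₁, h190₁₀, hmv₁₀⟩ := pair_sup_sectG Reg₁ hWa₁ Hm₁ hTm₁ hTm0₁ hdom₁ boxB₁ blkB₁ hcover₁ box blk ev₁ hev₁₀ hN₁ htri
    hd hδ₀ hrow8 hc hBG₁ hθW₁ hcΔ₁ hA₀₁ hAH₁ hθD₁ hG₁ hD2H0₁ hH0₁ hH₁ h189₁ hDfr₁ hq₁ y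
  obtain ⟨h190₁₁, hmv₁₁⟩ := pair_cov_sectG Reg₁ hWa₁ Hm₁ hTm₁ hTm0₁ hdom₁ boxB₁ blkB₁ hcover₁ y₀ S ev₁ hev₁₁ hN₁ htri hd hδ₀
    hrow8 hc hBG₁ hθW₁ hcΔ₁ hA₀₁ hAH₁ hθD₁ hG₁ hD2H0₁ hH0₁ hH₁ h189₁ hDfr₁ hq₁ y
  -- scheme 2: the two pairs for `ℍ₂` (sup size, covariant derivatives at `C₀`)
  obtain ⟨-, h190₂₀, hmv₂₀⟩ := pair_sup_sectG Reg₂ hWa₂ Hm₂ hTm₂ hTm0₂ hdom₂ boxB₂ blkB₂ hcover₂ box blk ev₂ hev₂₀ hN₂ htri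
    hd hδ₀ hrow8 hc hBG₂ hθW₂ hcΔ₂ hA₀₂ hAH₂ hθD₂ hG₂ hD2H0₂ hH0₂ hH₂ h189₂ hDfr₂ hq₂ y
  obtain ⟨h190₂₁, hmv₂₁⟩ := pair_cov_sectG Reg₂ hWa₂ Hm₂ hTm₂ hTm0₂ hdom₂ boxB₂ blkB₂ hcover₂ y₀ S ev₂ hev₂₁ hN₂ htri hd hδ₀
    hrow8 hc hBG₂ hθW₂ hcΔ₂ hA₀₂ hAH₂ hθD₂ hG₂ hD2H0₂ hH0₂ hH₂ h189₂ hDfr₂ hq₂ y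
  -- one constant for the knit: the max of the two (190) constants (monotonicity of majorants in the kernel)
  set C₁ := const190 1 bN₁.κ b3₁.κ BG₁ θW₁ cΔ₁ A₀₁ AH₁ θD₁ c
  set C₂ := const190 1 bN₂.κ b3₂.κ BG₂ θW₂ cΔ₂ A₀₂ AH₂ θD₂ c
  have hm₁ : ∀ a b : gB.Site, C₁ * Real.exp (-(δ₀ / 8 * gB.dist a b)) ≤ max C₁ C₂ * Real.exp (-(δ₀ / 8 * gB.dist a b)) :=
    fun a b => mul_le_mul_of_nonneg_right (le_max_left _ _) (Real.exp_nonneg _)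
  have hm₂ : ∀ a b : gB.Site, C₂ * Real.exp (-(δ₀ / 8 * gB.dist a b)) ≤ max C₁ C₂ * Real.exp (-(δ₀ / 8 * gB.dist a b)) :=
    fun a b => mul_le_mul_of_nonneg_right (le_max_right _ _) (Real.exp_nonneg _)
  have hK : 0 ≤ max C₁ C₂ := hK₁.trans (le_max_left _ _)
  have hCB : max C₁ C₂ * c ≤ B₃ := by
    rw [max_mul_of_nonneg _ _ hc]
    exact max_le hCB₁ hCB₂
  subst hHf₁ hHf₂
  exact ineq198_twoSup_of_ineq190_layer199 boxB₁ blkB₁ dep pt dir boxB₂ blkB₂ box blk y₀ S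
    (fun t => (h190₁₀ t).mono hm₁) (fun t => (h190₁₁ t).mono hm₁) (fun t => (h190₂₀ t).mono hm₂)
    (fun t => (h190₂₁ t).mono hm₂) hK hd hrow hσ hτ hστ y hL hd1 hAG hhk U₀' U' hU₀' hU' hε hCw hδ0 lo hi hlohi h96 h80 hD hXc
    hX1 hδr hsmall hs3 hs2 hs6 h19 h82 hX hfar₁ B' hB' hξ hCc hH₁sa hg₁ hC₀ hH₂sa hg₂ hrep μ ν x hmv₁₀ hmv₁₁ hmv₂₀ hmv₂₁
    hgeom₁ hCB hB₃ hδM hδM2 hεj hflowB hβ₀ hβ₁ hr hR hgh hgγ hγe hγB hεk hrj hs0 hδ'k hrk hflowC hγC hx hxμ hxν hS₁ hS₂ h180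
    hα' hL0 hL1 hε1 hXst he hscale hLkj1

end Eq198

/-! ## §9 (v1.1) (1.31) with the Sect. C letters from [15] Proposition 3 (r08's `B11Ineq190FromProp3`) -/

section OfInputs

open B11Ineq190FromProp3 B11Prop3Model

variable {X : Type} [Fintype X]
variable {𝒴 𝒵 : Type} [NormedAddCommGroup 𝒴] [NormedSpace ℂ 𝒴] [NormedAddCommGroup 𝒵] [NormedSpace ℂ 𝒵]
  [CompleteSpace 𝒴] [CompleteSpace 𝒵] {gB : B6.Geometry}
variable {𝔸 : Type} [CStarAlgebra 𝔸] [Nontrivial 𝔸]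
  {𝒢 : 𝒵 →L[ℂ] 𝒴} {W : 𝒴 → 𝒵} {D2 : 𝒴 →L[ℂ] 𝒵} {H₀ : (X → 𝔸) →L[ℂ] 𝒴} {B₀ θ C₄ a₃ 𝔧 𝔞 ε₄ : ℝ}
  {C : 𝒴 → X → 𝔸} {H : (X → 𝔸) →L[ℂ] 𝒴} {C₂ C₃ B₀' c₄ ε₃ : ℝ}

/-- **(1.31) END TO END FROM [15] SECT. G AND PROPOSITION 3, ALL SIZES CONCRETE** — §1's `ineq131_lt_layer_sectG` with the Sect. C
transformation `Tm = · − H(D ·)` taken at `D := B11Prop3Model.Dfix C H C₂` (THE solution of [15] (49)): its three letters `hTm` (analytic on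
`‖Y‖ < ε₄ + 𝔞`), `hTm0` (`Tm 0 = 0`) and the differentiability half of `hDfr` are r08's theorems from Proposition 3's inputs (44)/(46)/(72)
(`B11Prop3Model.Inputs C H C₂ C₃ B₀′ c₄`), the analyticity of `C` on `‖Y‖ < 2c₄`, the printed smallness `18C₂B₀′ε₃ ≤ 1`, `2ε₃ ≤ c₄` and the
nesting `ε₄ + 𝔞 ≤ ε₃` (`B11Ineq190FromProp3.analyticOnNhd_Tm_of_le`, `Tm_zero`, `hasFDerivAt_Dfix_of_lt`, `norm_arg180_lt_eps3`); the (73)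
letter is the decay majorant `h73` of the actual derivative of `Dfix` on the domain.  Everything else as in §1.
[cite: Balaban1989LargeFieldI, (1.30)–(1.31) pp.183–184; Balaban1985Variational, Prop. 9 (190) pp.308–309, Prop. 3 p.289, (73) p.289, (179)–(180) p.306] -/
theorem ineq131_lt_layer_of_inputs (Reg : Regime 𝒢 0 W B₀ θ C₄ a₃ 𝔧 𝔞 ε₄) (hWa : AnalyticOnNhd ℂ W {Y : 𝒴 | ‖Y‖ < a₃})
    (hin : Inputs C (H : (X → 𝔸) →ₗ[ℂ] 𝒴) C₂ C₃ B₀' c₄) (hCa : AnalyticOnNhd ℂ C {Y : 𝒴 | ‖Y‖ < 2 * c₄})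
    (hC₂ : 0 ≤ C₂) (hC₃ : 0 ≤ C₃) (hB₀' : 0 ≤ B₀') (hε₃ : 0 < ε₃) (h18 : 18 * C₂ * B₀' * ε₃ ≤ 1) (h2 : 2 * ε₃ ≤ c₄)
    (hnest : ε₄ + 𝔞 ≤ ε₃)
    (dep : X → ℕ) (pt : X → B7Prop1Explicit.Site d) (dir : X → Fin d)
    {L : ℕ} (hL : 2 ≤ L) (hd1 : 1 ≤ d) {G : Subgroup 𝔸ˣ} (hAG : AvgClosed d L G) {j : ℕ}
    {U₀ : B7Prop1Explicit.Site d → Fin d → 𝔸ˣ} (hU₀ : ∀ x κ, U₀ x κ ∈ G)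
    (hB : ‖H₀ (fun i => mlog (((avgIter L U₀ (j - dep i) (pt i) (dir i) *
          (pullIter L (avgIter L U₀ j) (dep i) (pt i) (dir i))⁻¹ : 𝔸ˣ) : 𝔸)))‖ < 𝔞 ∧
      ‖D2 (H₀ (fun i => mlog (((avgIter L U₀ (j - dep i) (pt i) (dir i) *
          (pullIter L (avgIter L U₀ j) (dep i) (pt i) (dir i))⁻¹ : 𝔸ˣ) : 𝔸))))‖ < 𝔧)
    (boxB : gB.Site → Finset X) (blkB : X → gB.Site) (hcover : ∀ i, i ∈ boxB (blkB i))
    (box : gB.Site → Finset (B7Prop1Explicit.Site d)) (blk : B7Prop1Explicit.Site d → gB.Site)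
    (y₀ : gB.Site) (S : gB.Site → Finset (B7Prop1Explicit.Site d × Fin d × Fin d)) {ξ : ℝ}
    (ev : B7Prop1Explicit.Site d → (𝒴 →L[ℝ] (Fin d → 𝔸)))
    {bN : BlockNorm gB 𝒴} {b3 : BlockNorm gB 𝒵}
    (hev : ∀ (y : gB.Site) (v : 𝒴), ∀ x ∈ box y, ‖ev x v‖ ≤ bN.loc y v)
    (hev₁ : ∀ (y : gB.Site) (v : 𝒴), (covDerivBlockSize gB y₀ S ξ U₀).loc y (fun x => ev x v) ≤ bN.loc y v)
    (hN : ∀ (y : gB.Site) (v : 𝒴), bN.loc y v ≤ ‖v‖)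
    {δ₀ BG θW cΔ A₀ AH θD c : ℝ}
    (htri : Triangle254 gB) (hd : ∀ a b : gB.Site, 0 ≤ gB.dist a b) (hδ₀ : 0 ≤ δ₀)
    (hc : 0 ≤ c) (hBG : 0 ≤ BG) (hθW : 0 ≤ θW) (hcΔ : 0 ≤ cΔ) (hA₀ : 0 ≤ A₀) (hAH : 0 ≤ AH) (hθD : 0 ≤ θD)
    (hG : HasMaj b3 bN (𝒢.restrictScalars ℝ : 𝒵 →ₗ[ℝ] 𝒴) (fun y y' => BG * Real.exp (-(δ₀ * gB.dist y y'))))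
    (hD2H0 : HasMaj (supSize (X := X) (E := 𝔸) gB boxB blkB) b3 ((D2 ∘L H₀).restrictScalars ℝ : (X → 𝔸) →ₗ[ℝ] 𝒵)
      (fun y y' => cΔ * Real.exp (-(δ₀ * gB.dist y y'))))
    (hH0 : HasMaj (supSize (X := X) (E := 𝔸) gB boxB blkB) bN (H₀.restrictScalars ℝ : (X → 𝔸) →ₗ[ℝ] 𝒴)
      (fun y y' => A₀ * Real.exp (-(δ₀ * gB.dist y y'))))
    (hH : HasMaj (supSize (X := X) (E := 𝔸) gB boxB blkB) bN (H.restrictScalars ℝ : (X → 𝔸) →ₗ[ℝ] 𝒴)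
      (fun y y' => AH * Real.exp (-(δ₀ / 2 * gB.dist y y'))))
    (h189 : ∀ B' : X → 𝔸, ‖H₀ B'‖ < 𝔞 → ‖D2 (H₀ B')‖ < 𝔧 →
      Ineq189 bN b3 ((fderiv ℂ W (solA180 𝒢 W D2 H₀ ε₄ B' + H₀ B')).restrictScalars ℝ : 𝒴 →ₗ[ℝ] 𝒵) θW δ₀)
    (h73 : ∀ B' : X → 𝔸, ‖H₀ B'‖ < 𝔞 → ‖D2 (H₀ B')‖ < 𝔧 →
      HasMaj bN (supSize (X := X) (E := 𝔸) gB boxB blkB)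
        ((fderiv ℂ (Dfix C (H : (X → 𝔸) →ₗ[ℂ] 𝒴) C₂) (solA180 𝒢 W D2 H₀ ε₄ B' + H₀ B')).restrictScalars ℝ :
          𝒴 →ₗ[ℝ] (X → 𝔸))
        (fun y y' => θD * Real.exp (-(δ₀ / 2 * gB.dist y y'))))
    (hq : qG b3.κ bN.κ BG θW c < 1)
    -- the [IV] side, as in §1
    {σ τ Dd B₃ δ M₂ εj β γ gj : ℝ} {r R : ℕ}
    (hrow : RowSum gB σ c) (hτ : 0 ≤ τ) (hστ : σ + τ ≤ δ₀ / 8) (y : gB.Site)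
    (hε : 0 < εj) (hε3 : C0 d * εj ≤ 1 / 3) (hε2 : 2 * εj ≤ c2' d L) (hεs : 11 * (d : ℝ) ^ 2 * εj ≤ 1 / 6)
    (lo hi : B7Prop1Explicit.Site d) (hlohi : lo ≤ hi)
    (h124 : pdevOn (tlo L lo j) (thi L hi j) U₀ < (1 - β * (1 / 2)) * εj * (((L : ℝ) ^ j)⁻¹) ^ 2)
    (h15 : ∀ n, n < j → ∀ z, tlo L lo n ≤ z → z ≤ thi L hi n → ∀ r : Fin d → Fin L,
      axialFn (avgIter L U₀ (j - (n + 1))) ((L : ℤ) • z) ((L : ℤ) • z + boxVec L r) = 1)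
    (hX : ∀ i, dep i ≤ j ∧ tlo L lo (dep i) ≤ pt i ∧ pt i + e (dir i) ≤ thi L hi (dep i))
    (hfar : ∀ y' i, i ∈ boxB y' → Dd ≤ gB.dist y y')
    (hξ : 0 < ξ) {Hf : B7Prop1Explicit.Site d → Fin d → 𝔸}
    (hHf : Hf = fun x => ev x (chartH179 𝒢 W D2 H₀
      (fun Y : 𝒴 => Y - H (Dfix C (H : (X → 𝔸) →ₗ[ℂ] 𝒴) C₂ Y)) ε₄
      (fun i => mlog (((avgIter L U₀ (j - dep i) (pt i) (dir i) *
          (pullIter L (avgIter L U₀ j) (dep i) (pt i) (dir i))⁻¹ : 𝔸ˣ) : 𝔸)))))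
    (hsa : ∀ z κ, IsSelfAdjoint (Hf z κ))
    {g : B7Prop1Explicit.Site d → 𝔸ˣ} (hg : ∀ z, g z ∈ U1 𝔸) (μ ν : Fin d) (x : B7Prop1Explicit.Site d)
    (hgeom : δ * 2 * M₂ * R ≤ τ * Dd) (hCB : const190 1 bN.κ b3.κ BG θW cΔ A₀ AH θD c * c ≤ B₃) (hB₃ : 0 ≤ B₃)
    (hr : 1 ≤ r) (hR : B14.IsRj L r gj R) (hgj : 0 < gj) (hgγ : gj ≤ γ) (hγe : 1 ≤ Real.log (γ ^ 2)⁻¹)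
    (hc1 : 1 ≤ δ * 2 * M₂) (hγ : B₃ * (22 * (d : ℝ) ^ 2) * γ ^ 2 < β / 10)
    (hx : x ∈ box y) (hxμ : x + e μ ∈ box y) (hxν : x + e ν ∈ box y)
    (hS₁ : (x, μ, ν) ∈ S y) (hS₂ : (x, ν, μ) ∈ S y)
    (hβ0 : 0 < β) (hβ1 : β ≤ 1) (hε1 : εj ≤ 1) (hεξ : εj * ξ ≤ ((L : ℝ) ^ 2)⁻¹)
    (hdev₀ : ‖B8Ineq132.plaqF U₀ μ ν x - 1‖ < (1 - β / 2) * εj * ξ ^ 2) :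
    ‖B8Ineq132.plaqF (gaugeAct g (B8Lemma1NonAbelian.mulCfg (B8Eq146AExpansion.expCfg
        (B8Eq146AExpansion.iEta ξ Hf)) U₀)) μ ν x - 1‖ < εj * ξ ^ 2 :=
  ineq131_lt_layer_sectG Reg hWa (D := Dfix C (H : (X → 𝔸) →ₗ[ℂ] 𝒴) C₂) H
    (analyticOnNhd_Tm_of_le hin hCa hC₂ hB₀' hε₃ h18 h2 hnest) (Tm_zero hin hC₂ hB₀' hε₃ h18 h2)
    dep pt dir hL hd1 hAG hU₀ hB boxB blkB hcover box blk y₀ S ev hev hev₁ hN htri hd hδ₀ hc hBG hθW hcΔ hA₀ hAH hθD hG hD2H0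
    hH0 hH h189
    (fun B' h𝔄 hJ => ⟨_, hasFDerivAt_Dfix_of_lt hin hC₂ hC₃ hB₀' hε₃ h18 h2 (norm_arg180_lt_eps3 Reg hJ h𝔄 hnest), h73 B' h𝔄 hJ⟩)
    hq hrow hτ hστ y hε hε3 hε2 hεs lo hi hlohi h124 h15 hX hfar hξ hHf hsa hg μ ν x hgeom hCB hB₃ hr hR hgj hgγ hγe hc1 hγ hx hxμ
    hxν hS₁ hS₂ hβ0 hβ1 hε1 hεξ hdev₀

end OfInputs

end Literature.MathematicalPhysics.QuantumFieldTheory.Balaban1983to89.B15From190SectG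

end
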